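/-
# LINE «hexadecade» on crux `MatrixDescartes` (stmt-ValiantsHypothesis-18050) — lens = barrier
val-idea-13 g1 (planner-val-idea-13-0), 2026-08-28.  VP ≠ VNP is NOT moved by this file.

**v8 — VERDICT ACCEPTED (val-idea-crit-4 VERDICT #2/#2a–c, 2026-08-28T06:19Z–06:59Z; this seat read them
only at 07:16Z — process failure, owned).  LENS OUTCOME = FOUND-NOTHING-WITH-MAP in the Literature (τ)
currency.**  The critic's W-TOWER — `H_0 = Y − 4Z`, `H_k(Y,Z) = H_{k−1}(Y² + λ²Z², λYZ)`, `λ = 16^{2^{k−1}}`,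
`W_k = H_k(·,1) ∈ ℤ[X]` monic of degree `2^k`: the Chebyshev doubling `y ↦ y² − 2` conjugated by the Joukowski
map `x ↦ x + λ²/x` (LOG-SYMMETRIC root doubling) and re-dilated by `16^{2^j}` per level, i.e. exactly
`not_separatedRealZeroTauBound`'s dilation trick in multiplicative coordinates — is HEXADECADAL (one simple
positive root per hexadecade `(16^i,16^{i+1})`, `i < 2^k`, `x₀ = 1`) at `τ(W_k) = O(k)` (certificate
run/shared/lean/pub/ideators/val-idea-crit-4/W_tower_certificate.md sha12 a15d977173a2; independently
re-verified here by exact integer arithmetic, strict grid alternation for `k ≤ 7`, `wtower_check.py`; even the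
tree's sharing-free substitution calculus `constantFreeComplexity_aeval_le` gives `τ(W_k) ≤ k² + O(k) ≪ 2^k`).
CONSEQUENCES RECORDED IN THIS FILE: `HexRealZeroTauBound c` is FALSE for EVERY `c`; the theorems
`not_isPBounded_tauPer_of_hexRealZeroTauBound(')` and `hexTwinPays : HexTwinPays` are kernel-correct but
VACUOUS (unsatisfiable hypothesis — ex falso; they «pay» nothing); the earlier title claim «the sector lies
just outside the TauRealZeros technique class, the escaping hypothesis is the SPACING» is WITHDRAWN:
`chebyshev_T_not_isHexadecadal` / `barrier_witness_not_hexadecadal` certify only that the catalogued WITNESS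
families (`T_{2^k}`, ±-rooted dilated Dickson) miss the sector, while the barrier's MECHANISM re-enters it.
DICHOTOMY OF RECORD (crit-4): approximate-GP / spacing / sign-pattern sectors that contain `V_ν` are
barrier-covered (W-towers approximate an exact 16-GP to any fixed precision at logarithmic cost); exact-arithmetic
sectors (AP: Pochhammer–Wilkinson; GP: q-Pochhammer `hexPoch`) are barrier-free but witness-free.

WHAT THE FILE STILL HOLDS (honest booking; LAW tier, 0 provers requested):
* Sector `IsHexadecadal p`: `p` flips sign `natDegree p` times along SOME ratio-16 geometric progression
  `x₀, 16x₀, …, 16^N x₀` (all roots real, simple, one-signed, one per hexadecade; a strict sign condition at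
  `N+1` explicit points).
* `HexLinLogLaw A := SectorLinLogLaw IsHexadecadal A` — the «O(K log K)» door law demanded only in that sector:
  a PROVED-WEAKER variant of the doors of record ON THE SAME WALL
  (`MatrixDescartes → LinLogLaw 1 → GPLinLogLaw 1 → HexLinLogLaw 1`, `HypLinLogLaw A → HexLinLogLaw A`) that
  still decides the summit, `valiant_of_hexLinLogLaw : (∃ A, HexLinLogLaw A) → ValiantsHypothesis`
  (kernel-checked glue + `isHexadecadal_map_tavenasV`: Tavenas' `V_ν` alternates on the exact ratio-16
  progression `x_u = -4^{2u+1}/4^N`, tree `sign_eval_xPt`).  Census-inert by construction (∃A-eventual in the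
  quasi-polynomial window, like A3); the sector buys NO certified tool there — the dictionary
  `eval_det_pencil_gp` returns Descartes' rule for symmetric-matrix exponential sums = the A3 wall; and the
  W-tower neither supports nor bites the matrix law (the `W_k` are dense univariates, not known to be
  few-letter small symmetric pencils).
* Reusable bricks (crit-4 booking: STRUCTURE tier): `hutchCoeff_chDefinable` (the Hutchinson–Tavenas
  coefficient table `4^{k(n−k)}` is CH/poly-definable from the tree's `FP` bricks) and `isHexadecadal_map_hutchW`
  (every-degree `W_N` alternates on the exact 16-GP); the Bürgisser Thm. 4.1(2) runs built on them are the
  vacuous twin theorems above.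
* RUNGS (ALL PROVED): `θ(m,1) = 0` (`gpAltLawAt_one`); `θ(m,2) ≤ m` (`gpAltLawAt_two` — two-term pencils of
  ANY size obey the GP-alternation law: `det = X^{m d₀}·q(X^δ)`, `deg q ≤ m`, injectivity of `x ↦ x^δ` on a
  half-line); `θ(1,K) ≤ K − 1` (`gpAltLawAt_one_left`, rank one = Descartes); the GENERIC CEILING
  `θ(m,K) ≤ C(m+K−1,m) − 1` for all `m`, `K ≥ 1` (`gpAltLawAt_descartes`, tree `stub_descartesCeiling` on the
  pencil or its `X ↦ −X` reflection; corollary `gpAltLawAt_polyRow`: `≤ (m+K−1)^{K−1} − 1`) — so the ONE stub's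
  open content is exactly the polylog gap between `2^{K·polylog K}` and `2^{A·K·log K}` uniform in `c`;
  CALIBRATION `thetaCalibration` (v5): both rows are EQUALITIES (`¬ θ(m,2) ≤ m−1`, `¬ θ(1,K) ≤ K−2`, by the
  interlacing lemma `alternatesGP_interlace` and the designs `X·I − diag(2·16^i)`, `∏_{i<K−1}(X − 2·16^i)`) and
  the sector contains a symmetric pencil determinant of EVERY size (`isHexadecadal_det_diagPencil`);
  ADDITIVE HANDLE `hexStampLaw : HexStampLaw` (v7, kernel-closed): a nonzero hexadecadal determinant has NO
  internal zero coefficient (`coeff_ne_zero_of_isHexadecadal`: `deg`-many one-signed roots need `deg + 1`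
  monomials), so EVERY `e ≤ deg` is a sum `d_{g(1)} + ⋯ + d_{g(m)}` of letter exponents (tree
  `StubDescartesCeiling.coeff_det_pencil_eq_zero`): the exponent design is an exact ADDITIVE BASIS of order `m`
  for `[0, deg]`, `deg ≤ n(m, K−1)` = the Rohrbach–Stöhr postage-stamp range [Guy, UPNT C12, p.133:
  `n(h,2) = ⌊(h²+6h+1)/4⌋` (Stöhr), `n(h,k) ≤ ((k−1)^{k−2}/(k−2)!)(h/k)^k + O(h^{k−1})` (Rødseth)]; first
  format where the sector provably BEATS Descartes: `hexDegRowTwoThree` — a hexadecadal `(2,3)` determinant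
  has degree `≤ 4 = n(2,2)` (Descartes / positive-root count allow 5; `4` is attained by the diagonal design
  `(x+2)(x+512) ⊕ (x+32)(x+8192)` on `D = {0,1,2}`, not formalised).  In this currency the law says: symmetric
  `m × m` determinantal structure costs an exponential loss against the additive optimum `(m/K)^{K−1}`;
  WITNESS OF WEAKNESS `linLogLawPolyFormats_all : LinLogLawOnPolyFormats` (v6, kernel-closed): on POLYNOMIAL
  formats `m ≤ K^a` the sector-free lin-log law holds with `A = 2a+3` for EVERY symmetric pencil (Descartes:
  `#roots ≤ 2·C(m+K−1,m) − 1 ≤ 2^{(2a+3)K log₂K}`), hence so do `HexLinLogLaw` and A3's `LinLogLaw` there,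
  while the crux `MatrixDescartes` on the same formats asks `2^{o(K log K)}` and is not decided by Descartes —
  the doors' ENTIRE open content is the quasi-polynomial window `K^a < m ≤ 2^{(log K + c)^c}`, `A` uniform in `c`;
  `GPAltLawAt ← RealRootLawAt`;
  HEIGHT RUNG `hexHeightBound : HexHeightBound` (PROVED, v2): for INTEGER pencils of height `h` whose determinant
  is hexadecadal of degree `N`, `2N² ≤ m(⌊log₂(mKh)⌋+1)(N+1) + 6N` — i.e. `N ≤ ½·m·(log₂(mKh)+1) + 3`:
  in the barrier's own constant-free / bounded-height world the sector law is a THEOREM with exponential room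
  (heart `height_ineq_of_isHexadecadal`: integer coefficients + one root per hexadecade force
  `16^{N(N-3)/2} ≤ H^{N+1}` via `e₁` and `a₀` of the roots; format side `abs_coeff_det_pencil_le`:
  `|coeff| ≤ m!·K^m·h^m`, and integrality `coeff_det_pencilZ_int` via `RingHom.map_det`).
  The door's entire open content is therefore «free real constants of unbounded height».
* DICTIONARY (PROVED `eval_det_pencil_gp`): the GP samples of `det F_{d,S}` are the determinants of a `K`-term
  symmetric MATRIX EXPONENTIAL SUM `k ↦ det(Σ_l (16^{d_l})^k T_l)`, `T_l = x₀^{d_l} S_l` — an orbit of the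
  linear map `diag(16^{d_l})` on pencil coordinates; the law bounds inertia-parity flips along that orbit.

Obligations: EXACTLY ONE sorry — the law stub `stub_hexLinLogLaw` (the crux re-dressed, weaker).
Everything else (edges, witness membership, the witness-exclusion certificate `chebyshev_T_not_isHexadecadal`,
the VACUOUS twin theorems `hexTwinPays` etc., the rungs `hexHeightBound` / `thetaRowTwo` / `gpAltLawAt_one`, the
additive handle, the polynomial-format theorem) is proved, 0 axioms beyond Mathlib's.  Composition to the target BY NAME: `valiantsHypothesis_of_stubs : _root_.ValiantsHypothesis`.
The generic glue (`SectorLinLogLaw`, `detTransfer_proof`, `false_of_vpFamily`, `valiant_of_sectorLinLogLaw`) is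
copied VERBATIM from LINE «amplify» v5 (val-idea-6 g2) for self-containedness (Cruxes workfiles are not importable
on the farm); credit there.
-/
import Mathlib
import Summits.ValiantsHypothesis.ValiantsHypothesis.Theses.LacunarySymmetroid
import Summits.ValiantsHypothesis.ValiantsHypothesis.Theorems.LacunarySymmetroidPencilTransfer
import Summits.ValiantsHypothesis.ValiantsHypothesis.Theorems.LacunarySymmetroidThetaWitness
import Summits.ValiantsHypothesis.ValiantsHypothesis.Theorems.LacunarySymmetroidMatrixDescartesHyperbolicThetaWitness
import Summits.ValiantsHypothesis.ValiantsHypothesis.Theorems.LacunarySymmetroidMatrixDescartesCensusDefs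
import Literature.Computability.AlgebraicComplexity.TavenasHutchinsonFamily
import Literature.Barriers.ValiantsHypothesis.TauRealZeros
import Literature.Computability.AlgebraicComplexity.TauConjectureProofs
import Literature.Computability.AlgebraicComplexity.BurgisserThm41Proofs
import Literature.Computability.AlgebraicComplexity.EsymmFromProductBits
import Literature.Computability.AlgebraicComplexity.RealTauKnownCases
import Summits.ValiantsHypothesis.ValiantsHypothesis.Theorems.LacunarySymmetroidMatrixDescartesStubDescartesCeiling
import Summits.ValiantsHypothesis.ValiantsHypothesis.Theorems.LacunarySymmetroidMatrixDescartesStubNegRoots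

set_option linter.dupNamespace false
set_option maxHeartbeats 800000

noncomputable section

namespace Summit.ValiantsHypothesis.ValiantsHypothesis.Theses.LacunarySymmetroid.HexadecadeLine

open scoped BigOperators Polynomial
open Polynomial
open Summit.ValiantsHypothesis.ValiantsHypothesis.Theses.LacunarySymmetroid (MatrixDescartes)
open Summit.ValiantsHypothesis.ValiantsHypothesis.Theorems.LacunarySymmetroidMatrixDescartes (RealRootLawAt
  stub_descartesCeiling stub_negRoots NegRoots.card_negRoots_le_card_posRoots_reflect
  StubDescartesCeiling.coeff_det_pencil_eq_zero)
open Literature.Computability.AlgebraicComplexity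
open Literature.Barriers.ValiantsHypothesis (RealZeroTauBound)

/-- The lacunary symmetric pencil `F_{d,S}(X) = Σ_l X^{d l} S_l` (census currency; verbatim from «amplify»). -/
abbrev pencil {m K : ℕ} (d : Fin K → ℕ) (S : Fin K → Matrix (Fin m) (Fin m) ℝ) :
    Matrix (Fin m) (Fin m) ℝ[X] :=
  ∑ l, ((Polynomial.X : ℝ[X]) ^ d l) • (S l).map Polynomial.C

/-! ## The sector: sign alternation along a geometric progression -/

/-- `p` changes sign between any two consecutive points of the geometric progression
`x₀, x₀ r, …, x₀ r^N` (`N` sign flips read off `N + 1` explicit sample points). -/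
def AlternatesGP (r : ℝ) (N : ℕ) (p : ℝ[X]) : Prop :=
  ∃ x₀ : ℝ, x₀ ≠ 0 ∧ ∀ k : ℕ, k < N → p.eval (x₀ * r ^ k) * p.eval (x₀ * r ^ (k + 1)) < 0

/-- **The hexadecadal sector**: `p` flips sign `natDegree p` times along some ratio-`16` geometric progression.
Consequences (proved below): all roots real and simple (`card_roots_eq_natDegree_of_isHexadecadal`), all of ONE
sign (`roots_sameSign_of_isHexadecadal`), one per hexadecade.  The ratio `16` is dictated by the witness
(`xPt N (u+1) = 16 · xPt N u`); a smaller ratio is a STRONGER law, a larger one loses the witness. -/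
def IsHexadecadal (p : ℝ[X]) : Prop := AlternatesGP 16 p.natDegree p

/-! ## The laws -/

/-- A3 of LINE «amplify» (for comparison and the edges): `≤ 2^{A·K⌊log₂K⌋}` distinct real roots on
quasi-polynomial formats. -/
def LinLogLaw (A : ℕ) : Prop :=
  ∀ c : ℕ, ∃ K₀ : ℕ, ∀ K m : ℕ, K₀ ≤ K → m ≤ 2 ^ ((Nat.log 2 K + c) ^ c) →
    ∀ (d : Fin K → ℕ) (S : Fin K → Matrix (Fin m) (Fin m) ℝ), (∀ l, (S l).IsSymm) →
      (pencil d S).det.roots.toFinset.card ≤ 2 ^ (A * (K * Nat.log 2 K))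

/-- Sector version of the law (verbatim from «amplify»). -/
def SectorLinLogLaw (P : ℝ[X] → Prop) (A : ℕ) : Prop :=
  ∀ c : ℕ, ∃ K₀ : ℕ, ∀ K m : ℕ, K₀ ≤ K → m ≤ 2 ^ ((Nat.log 2 K + c) ^ c) →
    ∀ (d : Fin K → ℕ) (S : Fin K → Matrix (Fin m) (Fin m) ℝ), (∀ l, (S l).IsSymm) →
      P (pencil d S).det → (pencil d S).det.roots.toFinset.card ≤ 2 ^ (A * (K * Nat.log 2 K))

/-- Sector version of the amplified witness (verbatim from «amplify»). -/
def SectorWitnessPow (P : ℝ[X] → Prop) (a : ℕ) : Prop :=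
  ∃ (Θ : ∀ n : ℕ, MvPolynomial (Fin n) ℝ) (d : ∀ n : ℕ, Fin n → ℕ),
    IsVNPFamily (fun n => MvPolynomial.map (algebraMap ℝ ℂ) (Θ n)) ∧
      ∃ n₀ : ℕ, ∀ n : ℕ, n₀ ≤ n →
        P (MvPolynomial.aeval (fun i => (Polynomial.X : ℝ[X]) ^ d n i) (Θ n)) ∧
        2 ^ (a * (n * Nat.log 2 n)) ≤
          (MvPolynomial.aeval (fun i => (Polynomial.X : ℝ[X]) ^ d n i) (Θ n)).roots.toFinset.card + 1

/-- **X1 — THE CRUX OF THE LINE.**  The «O(K log K)» law demanded ONLY of pencils whose determinant is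
hexadecadal (flips sign `deg`-many times along a ratio-16 geometric progression). -/
def HexLinLogLaw (A : ℕ) : Prop := SectorLinLogLaw IsHexadecadal A

/-- The GP law (stronger than X1, weaker than `LinLogLaw`): for EVERY symmetric pencil, the number of sign
flips of `det F` along any ratio-16 geometric progression is `≤ 2^{A·K⌊log₂K⌋}` on quasi-polynomial formats.
Hypothesis = finitely many strict polynomial inequalities at explicit points (no root functional). -/
def GPLinLogLaw (A : ℕ) : Prop :=
  ∀ c : ℕ, ∃ K₀ : ℕ, ∀ K m : ℕ, K₀ ≤ K → m ≤ 2 ^ ((Nat.log 2 K + c) ^ c) →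
    ∀ (d : Fin K → ℕ) (S : Fin K → Matrix (Fin m) (Fin m) ℝ), (∀ l, (S l).IsSymm) →
      ∀ N : ℕ, AlternatesGP 16 N (pencil d S).det → N ≤ 2 ^ (A * (K * Nat.log 2 K))

/-- The real-rooted-simple sector of LINE «hyperbolic» / «amplify» (for the edge `HypLinLogLaw → HexLinLogLaw`). -/
def IsRealRootedSimple (p : ℝ[X]) : Prop := p.roots.toFinset.card = p.natDegree

/-- The weakest door of record before this file («amplify» ∘ «hyperbolic»). -/
def HypLinLogLaw (A : ℕ) : Prop := SectorLinLogLaw IsRealRootedSimple A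

/-- Instrument row `θ(m,K) ≤ B`: no symmetric `(m,K)` pencil determinant flips sign more than `B` times along a
ratio-16 geometric progression. -/
def GPAltLawAt (m K B : ℕ) : Prop :=
  ∀ (d : Fin K → ℕ) (S : Fin K → Matrix (Fin m) (Fin m) ℝ), (∀ l, (S l).IsSymm) →
    ∀ N : ℕ, AlternatesGP 16 N (pencil d S).det → N ≤ B

/-- Integer pencil viewed over `ℝ`. -/
abbrev pencilZ {m K : ℕ} (d : Fin K → ℕ) (S : Fin K → Matrix (Fin m) (Fin m) ℤ) :
    Matrix (Fin m) (Fin m) ℝ[X] :=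
  pencil d (fun l => (S l).map ((↑) : ℤ → ℝ))

/-- **HEIGHT RUNG, square-root form** (NOT registered, no stub; the LINEAR form `HexHeightBound` is PROVED
below as `hexHeightBound`): for an INTEGER `(m,K)` pencil with entries of absolute value `≤ h` whose
determinant is hexadecadal of degree `N`, `N² ≤ 2m(⌊log₂(mKh)⌋ + 1) + 2N + 2`.  (Same method with the
middle elementary symmetric function `e_{N/2}` of the roots instead of `e₁`: some coefficient has absolute
value `≥ 2^{N²/2 − N − 1}`, while every coefficient of a height-`h` pencil determinant is `≤ m!(Kh)^m`.) -/
def HexHeightRung : Prop :=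
  ∀ (m K h : ℕ) (d : Fin K → ℕ) (S : Fin K → Matrix (Fin m) (Fin m) ℤ),
    (∀ l i j, (S l i j).natAbs ≤ h) → IsHexadecadal (pencilZ d S).det →
      (pencilZ d S).det.natDegree ^ 2 ≤
        2 * m * (Nat.log 2 (m * K * h) + 1) + 2 * (pencilZ d S).det.natDegree + 2

/-- **Literature-side twin — FALSE FOR EVERY `c`** (val-idea-crit-4 VERDICT #2, W-tower: hexadecadal
`W_k ∈ ℤ[X]`, `2^k` zeros one per hexadecade, `τ(W_k) = O(k)`; certificate W_tower_certificate.md a15d977173a2,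
re-verified exactly for `k ≤ 7` by this seat): the τ-bound on REAL zeros restricted to hexadecadal integer
polynomials.  Implied by the refuted class (`hexRealZeroTauBound_of_realZeroTauBound`); the catalogued witnesses
`T_{2^k}` miss the sector (`barrier_witness_not_hexadecadal`) but the Joukowski-conjugated doubling tower does
not.  Kept as a definition so that the refutation has a name to point at; every theorem below with this
hypothesis is VACUOUS.  KERNEL (v9, § W-TOWER at the end of the file): `WTower.not_hexRealZeroTauBound_one :
¬ HexRealZeroTauBound 1` (exact certificate, `k = 8`) and `WTower.not_hexRealZeroTauBound_of_wTowerSigns :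
(∀ k ≥ 1, WTowerSigns k) → ∀ c, ¬ HexRealZeroTauBound c`.  v10: `WTower.wTowerSigns_all : ∀ k ≥ 1, WTowerSigns k`
PROVED (Joukowski itinerary), hence **`WTower.not_hexRealZeroTauBound : ∀ c, ¬ HexRealZeroTauBound c`** —
sorry-free (`#print axioms`: propext, Classical.choice, Quot.sound). -/
def HexRealZeroTauBound (c : ℕ) : Prop :=
  ∀ f : Polynomial ℤ, f ≠ 0 → IsHexadecadal (f.map (Int.castRingHom ℝ)) →
    (f.map (Int.castRingHom ℝ)).roots.toFinset.card ≤
      (constantFreeComplexity ((MvPolynomial.uniqueAlgEquiv ℤ (Fin 1)).symm f) + 2) ^ c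

/-! ## Obligations (the stubs) -/

/-- OBLIGATION X1 (THE CRUX of the line; a format-level LAW, weaker than `MatrixDescartes`, `LinLogLaw A`,
`GPLinLogLaw A` and `HypLinLogLaw A` — edges below). -/
theorem stub_hexLinLogLaw : ∃ A : ℕ, HexLinLogLaw A := by
  sorry

/- The square-root form `HexHeightRung` (below, a `def` only) sharpens the PROVED linear form
`hexHeightBound` (section HEIGHT CURRENCY) by using `e_{N/2}` of the roots instead of `e_1`; it is not
needed by anything and is left unregistered (no stub). -/

/-! ## Sign flips along a geometric progression give one-signed roots, one per step -/

/-- IVT between two points where `p` takes values of opposite signs. -/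
theorem exists_root_Ioo_of_mul_neg (p : ℝ[X]) {a b : ℝ} (hab : a < b)
    (h : p.eval a * p.eval b < 0) : ∃ c, a < c ∧ c < b ∧ p.IsRoot c := by
  have hcont := p.continuousOn (s := Set.Icc a b)
  rcases mul_neg_iff.1 h with ⟨ha, hb⟩ | ⟨ha, hb⟩
  · obtain ⟨c, hc, hc0⟩ := intermediate_value_Ioo' hab.le hcont ⟨hb, ha⟩
    exact ⟨c, hc.1, hc.2, hc0⟩
  · obtain ⟨c, hc, hc0⟩ := intermediate_value_Ioo hab.le hcont ⟨ha, hb⟩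
    exact ⟨c, hc.1, hc.2, hc0⟩

/-- **`N` flips along a ratio-`r` progression (`r > 1`) give `N` distinct roots of the sign of `x₀`.** -/
theorem exists_roots_of_alternatesGP {r : ℝ} (hr : 1 < r) {N : ℕ} {p : ℝ[X]}
    (h : AlternatesGP r N p) :
    ∃ x₀ : ℝ, x₀ ≠ 0 ∧ ∃ T : Finset ℝ, T ⊆ p.roots.toFinset ∧ T.card = N ∧ ∀ t ∈ T, 0 < x₀ * t := by
  classical
  obtain ⟨x₀, hx0, hs⟩ := h
  refine ⟨x₀, hx0, ?_⟩
  have hp : ∀ k, k < N → p ≠ 0 := by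
    intro k hk hp0
    have := hs k hk
    rw [hp0, eval_zero, zero_mul] at this
    exact lt_irrefl _ this
  have hr0 : 0 < r := by linarith
  have hpow : ∀ k : ℕ, r ^ k < r ^ (k + 1) := fun k => pow_lt_pow_right₀ hr (Nat.lt_succ_self k)
  have hmono : ∀ {k k' : ℕ}, k ≤ k' → r ^ k ≤ r ^ k' := fun hkk' => pow_le_pow_right₀ hr.le hkk'
  rcases lt_or_gt_of_ne hx0 with hneg | hpos
  · -- `x₀ < 0`: the points decrease
    have hlt : ∀ k, x₀ * r ^ (k + 1) < x₀ * r ^ k := fun k => mul_lt_mul_of_neg_left (hpow k) hneg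
    have hroot : ∀ k, k < N → ∃ c, x₀ * r ^ (k + 1) < c ∧ c < x₀ * r ^ k ∧ p.IsRoot c := by
      intro k hk
      exact exists_root_Ioo_of_mul_neg p (hlt k) (by rw [mul_comm]; exact hs k hk)
    choose! c hc using hroot
    have hinj : Set.InjOn c (Finset.range N : Set ℕ) := by
      intro k hk k' hk' hkk
      have hkN : k < N := by simpa using hk
      have hkN' : k' < N := by simpa using hk'
      by_contra hne
      rcases lt_or_gt_of_ne hne with hlt' | hlt'
      · have h1 : x₀ * r ^ k' ≤ x₀ * r ^ (k + 1) :=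
          mul_le_mul_of_nonpos_left (hmono (by omega)) hneg.le
        have h2 := (hc k hkN).1
        have h3 := (hc k' hkN').2.1
        linarith
      · have h1 : x₀ * r ^ k ≤ x₀ * r ^ (k' + 1) :=
          mul_le_mul_of_nonpos_left (hmono (by omega)) hneg.le
        have h2 := (hc k' hkN').1
        have h3 := (hc k hkN).2.1
        linarith
    refine ⟨(Finset.range N).image c, ?_, ?_, ?_⟩
    · intro t ht
      obtain ⟨k, hk, rfl⟩ := Finset.mem_image.1 ht
      have hk' : k < N := Finset.mem_range.1 hk
      rw [Multiset.mem_toFinset, mem_roots (hp k hk')]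
      exact (hc k hk').2.2
    · rw [Finset.card_image_of_injOn hinj, Finset.card_range]
    · intro t ht
      obtain ⟨k, hk, rfl⟩ := Finset.mem_image.1 ht
      have hk' : k < N := Finset.mem_range.1 hk
      have h1 : c k < x₀ * r ^ k := (hc k hk').2.1
      have h2 : x₀ * r ^ k < 0 := mul_neg_of_neg_of_pos hneg (pow_pos hr0 k)
      exact mul_pos_of_neg_of_neg hneg (h1.trans h2)
  · -- `0 < x₀`: the points increase
    have hlt : ∀ k, x₀ * r ^ k < x₀ * r ^ (k + 1) := fun k => mul_lt_mul_of_pos_left (hpow k) hpos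
    have hroot : ∀ k, k < N → ∃ c, x₀ * r ^ k < c ∧ c < x₀ * r ^ (k + 1) ∧ p.IsRoot c := by
      intro k hk
      exact exists_root_Ioo_of_mul_neg p (hlt k) (hs k hk)
    choose! c hc using hroot
    have hinj : Set.InjOn c (Finset.range N : Set ℕ) := by
      intro k hk k' hk' hkk
      have hkN : k < N := by simpa using hk
      have hkN' : k' < N := by simpa using hk'
      by_contra hne
      rcases lt_or_gt_of_ne hne with hlt' | hlt'
      · have h1 : x₀ * r ^ (k + 1) ≤ x₀ * r ^ k' :=
          mul_le_mul_of_nonneg_left (hmono (by omega)) hpos.le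
        have h2 := (hc k hkN).2.1
        have h3 := (hc k' hkN').1
        linarith
      · have h1 : x₀ * r ^ (k' + 1) ≤ x₀ * r ^ k :=
          mul_le_mul_of_nonneg_left (hmono (by omega)) hpos.le
        have h2 := (hc k' hkN').2.1
        have h3 := (hc k hkN).1
        linarith
    refine ⟨(Finset.range N).image c, ?_, ?_, ?_⟩
    · intro t ht
      obtain ⟨k, hk, rfl⟩ := Finset.mem_image.1 ht
      have hk' : k < N := Finset.mem_range.1 hk
      rw [Multiset.mem_toFinset, mem_roots (hp k hk')]
      exact (hc k hk').2.2
    · rw [Finset.card_image_of_injOn hinj, Finset.card_range]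
    · intro t ht
      obtain ⟨k, hk, rfl⟩ := Finset.mem_image.1 ht
      have hk' : k < N := Finset.mem_range.1 hk
      have h1 : x₀ * r ^ k < c k := (hc k hk').1
      have h2 : 0 < x₀ * r ^ k := mul_pos hpos (pow_pos hr0 k)
      exact mul_pos hpos (h2.trans h1)

/-- `N` flips along a ratio-`r` progression force `N` distinct real roots. -/
theorem le_card_roots_of_alternatesGP {r : ℝ} (hr : 1 < r) {N : ℕ} {p : ℝ[X]}
    (h : AlternatesGP r N p) : N ≤ p.roots.toFinset.card := by
  obtain ⟨x₀, -, T, hT, hcard, -⟩ := exists_roots_of_alternatesGP hr h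
  rw [← hcard]
  exact Finset.card_le_card hT

/-- Hexadecadal ⇒ real-rooted with simple roots (the sector sits INSIDE the sector of LINE «hyperbolic»). -/
theorem card_roots_eq_natDegree_of_isHexadecadal {p : ℝ[X]} (h : IsHexadecadal p) :
    p.roots.toFinset.card = p.natDegree :=
  le_antisymm ((Multiset.toFinset_card_le _).trans (card_roots' p))
    (le_card_roots_of_alternatesGP (by norm_num) h)

theorem isRealRootedSimple_of_isHexadecadal {p : ℝ[X]} (h : IsHexadecadal p) : IsRealRootedSimple p :=
  card_roots_eq_natDegree_of_isHexadecadal h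

/-- Hexadecadal ⇒ ALL roots have the sign of the base point `x₀` (none is `0`, none has the other sign). -/
theorem roots_sameSign_of_isHexadecadal {p : ℝ[X]} (h : IsHexadecadal p) :
    ∃ x₀ : ℝ, x₀ ≠ 0 ∧ ∀ t ∈ p.roots.toFinset, 0 < x₀ * t := by
  obtain ⟨x₀, hx0, T, hT, hcard, hsign⟩ := exists_roots_of_alternatesGP (by norm_num : (1 : ℝ) < 16) h
  refine ⟨x₀, hx0, fun t ht => hsign t ?_⟩
  have hTeq : T = p.roots.toFinset := Finset.eq_of_subset_of_card_le hT (by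
    rw [hcard]; exact (Multiset.toFinset_card_le _).trans (card_roots' p))
  rw [hTeq]
  exact ht

/-! ## WITNESS EXCLUSION (NOT class exclusion — header, VERDICT #2): the Chebyshev family lies OUTSIDE the sector -/

/-- **Every Chebyshev polynomial `T_n`, `n ≥ 2`, is NOT hexadecadal** (it has the roots `cos(π/2n) > 0` and
`cos(π − π/2n) < 0`, of opposite signs).  This excludes the catalogued WITNESS family `T_{2^k}` of
`TauRealZeros` from the sector — NOT the barrier's mechanism: the Joukowski-conjugated doubling tower `W_k`
(header) is hexadecadal at `τ = O(k)`. -/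
theorem chebyshev_T_not_isHexadecadal (n : ℕ) (hn : 2 ≤ n) :
    ¬ IsHexadecadal (Polynomial.Chebyshev.T ℝ n) := by
  intro h
  obtain ⟨x₀, hx0, hsign⟩ := roots_sameSign_of_isHexadecadal h
  have hT0 : Polynomial.Chebyshev.T ℝ n ≠ 0 := fun h0 => by
    have h1 := Polynomial.Chebyshev.T_eval_one (R := ℝ) n
    rw [h0, eval_zero] at h1
    exact zero_ne_one h1
  have hn' : (2 : ℝ) ≤ n := by exact_mod_cast hn
  have hn0 : (n : ℝ) ≠ 0 := by positivity
  set θ : ℝ := Real.pi / (2 * n) with hθ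
  have hθlt : θ < Real.pi / 2 := by
    rw [hθ, div_lt_div_iff_of_pos_left Real.pi_pos (by positivity) (by norm_num)]
    linarith
  have hθpos : 0 < θ := by rw [hθ]; positivity
  have hcos : 0 < Real.cos θ := Real.cos_pos_of_mem_Ioo ⟨by linarith, hθlt⟩
  have hnθ : (n : ℝ) * θ = Real.pi / 2 := by
    rw [hθ]; field_simp
  have hr1 : (Polynomial.Chebyshev.T ℝ n).IsRoot (Real.cos θ) := by
    rw [IsRoot.def, Polynomial.Chebyshev.T_real_cos]
    push_cast
    rw [hnθ, Real.cos_pi_div_two]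
  have hr2 : (Polynomial.Chebyshev.T ℝ n).IsRoot (-Real.cos θ) := by
    rw [IsRoot.def, ← Real.cos_pi_sub, Polynomial.Chebyshev.T_real_cos]
    push_cast
    rw [mul_sub, hnθ, Real.cos_sub_pi_div_two, Real.sin_nat_mul_pi]
  have h1 := hsign _ (by rw [Multiset.mem_toFinset, mem_roots hT0]; exact hr1)
  have h2 := hsign _ (by rw [Multiset.mem_toFinset, mem_roots hT0]; exact hr2)
  have h3 : x₀ * Real.cos θ + x₀ * -Real.cos θ = 0 := by ring
  linarith

/-- The barrier's catalogued witnesses `T_{2^k}` (`k ≥ 1`), as integer polynomials mapped to `ℝ`, are not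
hexadecadal — so the refutation `not_exists_realZeroTauBound` does not transfer VERBATIM; it transfers after
one conjugation (the W-tower, header): witness-exclusion is NOT class-exclusion. -/
theorem barrier_witness_not_hexadecadal (k : ℕ) (hk : 1 ≤ k) :
    ¬ IsHexadecadal ((Polynomial.Chebyshev.T ℤ ((2 ^ k : ℕ) : ℤ)).map (Int.castRingHom ℝ)) := by
  rw [Polynomial.Chebyshev.map_T]
  have h2 : 2 ≤ 2 ^ k := by
    calc 2 = 2 ^ 1 := by norm_num
      _ ≤ 2 ^ k := Nat.pow_le_pow_right (by norm_num) hk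
  exact chebyshev_T_not_isHexadecadal (2 ^ k) h2

/-- The refuted class implies the restricted one (both are FALSE; see the header). -/
theorem hexRealZeroTauBound_of_realZeroTauBound {c : ℕ} (h : RealZeroTauBound c) :
    HexRealZeroTauBound c := fun f hf _ => h f hf

/-! ## (VACUOUS since VERDICT #2 — hypothesis `HexRealZeroTauBound c₀` is false ∀ c₀) Literature-currency edge,
first version: `HexRealZeroTauBound c₀ ⇒ τ(PER_n)` not polynomially bounded, through Bürgisser 2009, Thm. 4.1(2)
(tree theorem `Burgisser2009_thm41_2_holds`) applied to the HEXADECADAL FACTORIAL `H_n = ∏_{k<n}(X − 16^k)`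
(`isHexadecadal_map_hexPoch`).  Kept for the record and for the bricks; it proves nothing about τ(PER). -/

/-- The hexadecadal factorial `H_n = ∏_{k<n} (X − 16^k) ∈ ℤ[X]` (`q`-Pochhammer at `q = 16`). -/
def hexPoch (n : ℕ) : Polynomial ℤ := ∏ k ∈ Finset.range n, (X - C ((16 : ℤ) ^ k))

theorem hexPoch_monic (n : ℕ) : (hexPoch n).Monic :=
  monic_prod_of_monic _ _ fun _ _ => monic_X_sub_C _

theorem hexPoch_ne_zero (n : ℕ) : hexPoch n ≠ 0 := (hexPoch_monic n).ne_zero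

theorem natDegree_hexPoch (n : ℕ) : (hexPoch n).natDegree = n := by
  unfold hexPoch
  rw [natDegree_prod_of_monic _ _ (fun _ _ => monic_X_sub_C _)]
  simp only [natDegree_X_sub_C, Finset.sum_const, Finset.card_range, smul_eq_mul, mul_one]

/-- `H_n` as the sum of its monomials up to degree `n` (the shape used in Thm. 4.1(2)). -/
theorem sum_range_coeff_hexPoch (n : ℕ) :
    ∑ k ∈ Finset.range (n + 1), C ((hexPoch n).coeff k) * X ^ k = hexPoch n :=
  (as_sum_range_C_mul_X_pow' _ (by rw [natDegree_hexPoch]; exact Nat.lt_succ_self n)).symm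

theorem map_hexPoch (n : ℕ) :
    (hexPoch n).map (Int.castRingHom ℝ) = ∏ k ∈ Finset.range n, (X - C ((16 : ℝ) ^ k)) := by
  unfold hexPoch
  rw [Polynomial.map_prod]
  refine Finset.prod_congr rfl fun k _ => ?_
  rw [Polynomial.map_sub, Polynomial.map_X, Polynomial.map_C]
  congr 2
  simp

/-- The sign computation: the quarter-points `16^k/4 < 16^{k+1}/4` straddle exactly one root (`16^k`) of `H_n`. -/
theorem prod_quarterPoints_neg {n k : ℕ} (hk : k < n) :
    (∏ i ∈ Finset.range n, ((1 / 4 : ℝ) * 16 ^ k - (16 : ℝ) ^ i)) *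
      (∏ i ∈ Finset.range n, ((1 / 4 : ℝ) * 16 ^ (k + 1) - (16 : ℝ) ^ i)) < 0 := by
  classical
  rw [← Finset.prod_mul_distrib, ← Finset.mul_prod_erase _ _ (Finset.mem_range.2 hk)]
  have h16k : (0 : ℝ) < 16 ^ k := by positivity
  apply mul_neg_of_neg_of_pos
  · have h1 : (1 / 4 : ℝ) * 16 ^ k - 16 ^ k < 0 := by nlinarith
    have h2 : 0 < (1 / 4 : ℝ) * 16 ^ (k + 1) - 16 ^ k := by rw [pow_succ]; nlinarith
    exact mul_neg_of_neg_of_pos h1 h2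
  · apply Finset.prod_pos
    intro i hi
    rw [Finset.mem_erase, Finset.mem_range] at hi
    obtain ⟨hik, -⟩ := hi
    have h16i : (0 : ℝ) < 16 ^ i := by positivity
    rcases lt_or_gt_of_ne hik with hlt | hgt
    · have hle : (16 : ℝ) ^ i * 16 ≤ 16 ^ k := by
        rw [← pow_succ]; exact pow_le_pow_right₀ (by norm_num) hlt
      have h1 : 0 < (1 / 4 : ℝ) * 16 ^ k - 16 ^ i := by nlinarith
      have h2 : 0 < (1 / 4 : ℝ) * 16 ^ (k + 1) - 16 ^ i := by rw [pow_succ]; nlinarith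
      exact mul_pos h1 h2
    · have hle : (16 : ℝ) ^ k * 16 ≤ 16 ^ i := by
        rw [← pow_succ]; exact pow_le_pow_right₀ (by norm_num) hgt
      have h1 : (1 / 4 : ℝ) * 16 ^ k - 16 ^ i < 0 := by nlinarith
      have h2 : (1 / 4 : ℝ) * 16 ^ (k + 1) - 16 ^ i < 0 := by rw [pow_succ]; nlinarith
      exact mul_pos_of_neg_of_neg h1 h2

/-- `H_n` flips sign `n` times along the ratio-16 progression `16^k/4`. -/
theorem alternatesGP_map_hexPoch (n : ℕ) : AlternatesGP 16 n ((hexPoch n).map (Int.castRingHom ℝ)) := by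
  refine ⟨1 / 4, by norm_num, fun k hk => ?_⟩
  rw [map_hexPoch, Polynomial.eval_prod, Polynomial.eval_prod]
  simp only [eval_sub, eval_X, eval_C]
  exact prod_quarterPoints_neg hk

/-- **The hexadecadal factorial lies in the sector.** -/
theorem isHexadecadal_map_hexPoch (n : ℕ) : IsHexadecadal ((hexPoch n).map (Int.castRingHom ℝ)) := by
  unfold IsHexadecadal
  rw [natDegree_map_eq_of_injective (Int.castRingHom ℝ).injective_int, natDegree_hexPoch]
  exact alternatesGP_map_hexPoch n

/-- Scaling by a nonzero constant preserves the sector. -/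
theorem isHexadecadal_C_mul {a : ℝ} (ha : a ≠ 0) {p : ℝ[X]} (h : IsHexadecadal p) :
    IsHexadecadal (C a * p) := by
  unfold IsHexadecadal at h ⊢
  rw [natDegree_C_mul ha]
  obtain ⟨x₀, hx0, hs⟩ := h
  refine ⟨x₀, hx0, fun k hk => ?_⟩
  have h1 := hs k hk
  have ha2 : 0 < a * a := mul_self_pos.2 ha
  simp only [eval_mul, eval_C]
  nlinarith

/-- RESIDUAL (routine, Bürgisser Cor. 3.9-type iterated multiplication in `CH`; NOT a crux): the coefficient
table `(n,k) ↦ [X^k] H_n` is definable in `CH/poly`. -/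
def HexPochCoeffCH : Prop := IsCHPolyDefinable (fun n => n) (fun n k => (hexPoch n).coeff k)

/-- (VACUOUS: the hypothesis `h` is unsatisfiable, W-tower.) `HexRealZeroTauBound c₀` ⇒ `τ(PER_n)` is not
polynomially bounded (modulo the routine `HexPochCoeffCH`).  Printed argument of Bürgisser's Thm. 1.1(2) with `∏(X − k)` replaced by the
hexadecadal factorial: `τ(Per) = n^{O(1)}` ⇒ (Thm. 4.1(2), PROVED in tree) `τ(2^{e(n)} H_n) ≤ (log₂ n + 2)^c`;
`2^{e(n)} H_n` is hexadecadal with `n` real roots ⇒ `n ≤ ((log₂ n + 2)^c + 2)^{c₀}` for all `n` — absurd. -/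
theorem not_isPBounded_tauPer_of_hexRealZeroTauBound {c₀ : ℕ} (h : HexRealZeroTauBound c₀)
    (hCH : HexPochCoeffCH) :
    ¬ IsPBounded (fun n => constantFreeComplexity (perPoly (Fin n) ℤ)) := by
  intro hP
  obtain ⟨e, -, c, hc⟩ :=
    Burgisser2009_thm41_2_holds hP (fun n => n) (fun n k => (hexPoch n).coeff k) hCH
  set g : ℕ → Polynomial ℤ := fun n => C ((2 : ℤ) ^ e n) * hexPoch n with hg
  have hg_ne : ∀ n, g n ≠ 0 := fun n =>
    mul_ne_zero (C_ne_zero.2 (pow_ne_zero _ two_ne_zero)) (hexPoch_ne_zero n)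
  have hτg : ∀ n, tauPoly (g n) ≤ (Nat.log 2 n + 2) ^ c := fun n => by
    simpa only [hg, sum_range_coeff_hexPoch] using hc n
  have h2 : ∀ n, (Int.castRingHom ℝ) ((2 : ℤ) ^ e n) ≠ 0 := fun n => by simp
  have hhex : ∀ n, IsHexadecadal ((g n).map (Int.castRingHom ℝ)) := fun n => by
    simp only [hg]
    rw [Polynomial.map_mul, Polynomial.map_C]
    exact isHexadecadal_C_mul (h2 n) (isHexadecadal_map_hexPoch n)
  have hroots : ∀ n, ((g n).map (Int.castRingHom ℝ)).roots.toFinset.card = n := fun n => by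
    rw [card_roots_eq_natDegree_of_isHexadecadal (hhex n),
      natDegree_map_eq_of_injective (Int.castRingHom ℝ).injective_int]
    simp only [hg]
    rw [natDegree_C_mul (pow_ne_zero _ two_ne_zero), natDegree_hexPoch]
  have key : ∀ n, n ≤ ((Nat.log 2 n + 2) ^ c + 2) ^ c₀ := fun n =>
    calc n = ((g n).map (Int.castRingHom ℝ)).roots.toFinset.card := (hroots n).symm
      _ ≤ (constantFreeComplexity ((MvPolynomial.uniqueAlgEquiv ℤ (Fin 1)).symm (g n)) + 2) ^ c₀ :=
          h (g n) (hg_ne n) (hhex n)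
      _ = (tauPoly (g n) + 2) ^ c₀ := rfl
      _ ≤ ((Nat.log 2 n + 2) ^ c + 2) ^ c₀ :=
          Nat.pow_le_pow_left (Nat.add_le_add_right (hτg n) 2) _
  obtain ⟨n, hn⟩ := exists_pow_log_lt c c₀
  exact absurd (key n) (not_le.2 hn)

/-! ## BRICKS on the Hutchinson–Tavenas family of every degree (STRUCTURE tier; the Bürgisser run built on
them, `not_isPBounded_tauPer_of_hexRealZeroTauBound'` / `hexTwinPays`, is VACUOUS since VERDICT #2)

`W_N = ∑_{i<N} 4^{i(N-1-i)} X^i` (so `tavenasV ν = W_{2^ν}` literally): hexadecadal for EVERY `N`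
(the tree's dominance sum `zSum_sign` is degree-generic), and its coefficient table in Bürgisser's
format, `(n,k) ↦ [X^k] W_{n+1} = 4^{k(n-k)}` (`k ≤ n`), is definable in `CH` by a two-comparison
polynomial-time bit test (`bit_j 4^{k(n-k)} = [j = 2k(n-k)]`) — no iterated product, no Cor. 3.9. -/

/-- The Hutchinson–Tavenas polynomial with `N` terms: `W_N = ∑_{i<N} 2^{2i(N-1-i)} X^i`. -/
def hutchW (N : ℕ) : Polynomial ℤ :=
  ∑ i ∈ Finset.range N, C ((2 : ℤ) ^ (2 * (i * (N - 1 - i)))) * X ^ i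

/-- Tavenas' `V_ν` IS `W_{2^ν}`. -/
theorem tavenasV_eq_hutchW (ν : ℕ) : tavenasV ν = hutchW (2 ^ ν) := rfl

theorem coeff_hutchW (N i : ℕ) :
    (hutchW N).coeff i = if i < N then 2 ^ (2 * (i * (N - 1 - i))) else 0 := by
  simp only [hutchW, finsetSum_coeff, coeff_C_mul_X_pow]
  rw [Finset.sum_ite_eq]
  simp only [Finset.mem_range]

theorem natDegree_hutchW (N : ℕ) : (hutchW N).natDegree = N - 1 := by
  rcases N with _ | n
  · simp [hutchW]
  · apply le_antisymm
    · refine natDegree_sum_le_of_forall_le _ _ fun k hk => (natDegree_C_mul_X_pow_le _ _).trans ?_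
      have := Finset.mem_range.1 hk
      omega
    · refine le_natDegree_of_ne_zero ?_
      rw [coeff_hutchW]
      simp

theorem hutchW_ne_zero {N : ℕ} (hN : 1 ≤ N) : hutchW N ≠ 0 := fun h => by
  have h1 := coeff_hutchW N (N - 1)
  rw [h, coeff_zero, if_pos (by omega)] at h1
  exact absurd h1.symm (pow_ne_zero _ two_ne_zero)

theorem map_hutchW (N : ℕ) : (hutchW N).map (Int.castRingHom ℝ) =
    ∑ i ∈ Finset.range N, C ((2 : ℝ) ^ (2 * (i * (N - 1 - i)))) * X ^ i := by
  unfold hutchW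
  rw [Polynomial.map_sum]
  refine Finset.sum_congr rfl fun i _ => ?_
  rw [Polynomial.map_mul, Polynomial.map_pow, map_X, map_C]
  simp

/-- Exact evaluation at the tree's points: `4^{N(N-1)} · W_N(x_u) = Z_u` (tree `zSum`), `u < N`. -/
theorem pow_mul_eval_xPt_hutchW (N u : ℕ) (hu : u < N) :
    (4 : ℝ) ^ (N * (N - 1)) * ((hutchW N).map (Int.castRingHom ℝ)).eval (xPt N u) =
      (zSum N u : ℝ) := by
  rw [map_hutchW, eval_finsetSum, Finset.mul_sum, zSum, Int.cast_sum]
  refine Finset.sum_congr rfl fun i hi => ?_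
  have hi' : i < N := Finset.mem_range.1 hi
  rw [eval_mul, eval_C, eval_pow, eval_X]
  push_cast
  have h2 : (2 : ℝ) ^ (2 * (i * (N - 1 - i))) = 4 ^ (i * (N - 1 - i)) := by
    rw [pow_mul]; norm_num
  have key : (4 : ℝ) ^ (N * (N - 1)) * 4 ^ (i * (N - 1 - i)) * 4 ^ ((2 * u + 1) * i) =
      4 ^ (N * (N - 1) + u * u - sqd i u) * 4 ^ (N * i) := by
    rw [← pow_add, ← pow_add, ← pow_add, expo_identity hi' hu]
  have h4c : (4 : ℝ) ^ (N * i) ≠ 0 := by positivity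
  rw [h2, xPt, div_pow, neg_pow, ← pow_mul, ← pow_mul]
  have hre : (4 : ℝ) ^ (N * (N - 1)) * (4 ^ (i * (N - 1 - i)) *
      ((-1) ^ i * 4 ^ ((2 * u + 1) * i) / 4 ^ (N * i)))
      = (-1) ^ i * (4 ^ (N * (N - 1)) * 4 ^ (i * (N - 1 - i)) * 4 ^ ((2 * u + 1) * i)) /
        4 ^ (N * i) := by
    ring
  rw [hre, key, ← mul_assoc, mul_div_cancel_right₀ _ h4c]

/-- Sign alternation of `W_N` at the ratio-16 points `x_u`, `u < N`. -/
theorem sign_eval_xPt_hutchW (N u : ℕ) (hu : u < N) :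
    0 < (-1 : ℝ) ^ u * ((hutchW N).map (Int.castRingHom ℝ)).eval (xPt N u) := by
  have h := zSum_sign hu
  have h' : (0 : ℝ) < (((-1) ^ u * zSum N u : ℤ) : ℝ) := by exact_mod_cast h
  rw [Int.cast_mul, Int.cast_pow, Int.cast_neg, Int.cast_one, ← pow_mul_eval_xPt_hutchW N u hu,
    mul_left_comm] at h'
  exact (mul_pos_iff_of_pos_left (by positivity)).1 h'

/-- The tree's alternation points ARE a ratio-16 geometric progression: `x_u = (−4/4^N)·16^u`. -/
theorem xPt_eq (N u : ℕ) : xPt N u = (-(4 : ℝ) / 4 ^ N) * 16 ^ u := by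
  have h : (4 : ℝ) ^ (2 * u + 1) = 4 * 16 ^ u := by
    rw [pow_succ, pow_mul, show (4 : ℝ) ^ 2 = 16 by norm_num, mul_comm]
  unfold xPt
  rw [h]
  ring

theorem alternatesGP_map_hutchW (N : ℕ) :
    AlternatesGP 16 (N - 1) ((hutchW N).map (Int.castRingHom ℝ)) := by
  refine ⟨-(4 : ℝ) / 4 ^ N, div_ne_zero (by norm_num) (by positivity), fun k hk => ?_⟩
  have h1 := sign_eval_xPt_hutchW N k (by omega)
  have h2 := sign_eval_xPt_hutchW N (k + 1) (by omega)
  rw [xPt_eq] at h1 h2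
  rw [pow_succ] at h2
  rcases neg_one_pow_eq_or ℝ k with h | h <;> rw [h] at h1 h2 <;> nlinarith

theorem natDegree_map_hutchW (N : ℕ) : ((hutchW N).map (Int.castRingHom ℝ)).natDegree = N - 1 := by
  rw [natDegree_map_eq_of_injective (Int.castRingHom ℝ).injective_int, natDegree_hutchW]

/-- **Every `W_N` lies in the hexadecadal sector.** -/
theorem isHexadecadal_map_hutchW (N : ℕ) : IsHexadecadal ((hutchW N).map (Int.castRingHom ℝ)) := by
  unfold IsHexadecadal
  rw [natDegree_map_hutchW]
  exact alternatesGP_map_hutchW N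

/-- Bürgisser-format coefficient table: `b(n,k) = [X^k] W_{n+1} = 4^{k(n-k)}` for `k ≤ n` (else `0`). -/
def hutchCoeff (n k : ℕ) : ℤ := if k ≤ n then 2 ^ (2 * (k * (n - k))) else 0

theorem hutchCoeff_nonneg (n k : ℕ) : 0 ≤ hutchCoeff n k := by
  unfold hutchCoeff; split_ifs <;> positivity

theorem sum_range_hutchCoeff (n : ℕ) :
    ∑ k ∈ Finset.range (n + 1), C (hutchCoeff n k) * X ^ k = hutchW (n + 1) := by
  unfold hutchW hutchCoeff
  refine Finset.sum_congr rfl fun k hk => ?_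
  rw [if_pos (Nat.lt_succ_iff.1 (Finset.mem_range.1 hk)), Nat.add_sub_cancel]

section CHDefinability
open Literature.Computability.Complexity Literature.Computability.Complexity.Classes
open Literature.Computability.Complexity.Brick

/-- The exponent `2k(n-k)` read off a bit query `⟨⟨bin n, bin k⟩, ⟨bin j, [b]⟩⟩` (total readers of Cor. 3.9). -/
def hutE (w : List Bool) : ℕ := 2 * (cor39QK w * (cor39QN w - cor39QK w))

/-- The numeral of `k(n-k)` as an `FP` string function. -/
def hutExpHalf : List Bool → List Bool := prodFn ∘ fanoutFn (sndF ∘ fstF) (subFn ∘ fstF)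

theorem hutExpHalf_apply (w : List Bool) :
    hutExpHalf w = Computability.encodeNat (cor39QK w * (cor39QN w - cor39QK w)) := by
  simp only [hutExpHalf, Function.comp_apply, fanoutFn_apply, prodFn_boolPair, cor39QK, cor39QN]
  have hsub : subFn (fstF w) = Computability.encodeNat (bitsToNat (fstP (fstP w)) - bitsToNat (sndP (fstP w))) := rfl
  rw [hsub, bitsToNat_encodeNat]
  rfl

theorem hutExpHalf_mem_FP : hutExpHalf ∈ FP :=
  comp_mem_FP prodFn_mem_FP (fanoutFn_mem_FP (comp_mem_FP sndF_mem_FP fstF_mem_FP)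
    (comp_mem_FP subFn_mem_FP fstF_mem_FP))

/-- The numeral of `2k(n-k)`. -/
def hutExpNum : List Bool → List Bool := addFn ∘ fanoutFn hutExpHalf hutExpHalf

theorem hutExpNum_apply (w : List Bool) : hutExpNum w = Computability.encodeNat (hutE w) := by
  simp only [hutExpNum, Function.comp_apply, fanoutFn_apply, hutExpHalf_apply, addFn_boolPair,
    bitsToNat_encodeNat, hutE]
  congr 1
  ring

theorem hutExpNum_mem_FP : hutExpNum ∈ FP :=
  comp_mem_FP addFn_mem_FP (fanoutFn_mem_FP hutExpHalf_mem_FP hutExpHalf_mem_FP)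

/-- The tests `j < 2k(n-k)` and `2k(n-k) < j` as languages. -/
def hutJLtLang : Language Bool := {w | cor39QJ w < hutE w}
def hutELtLang : Language Bool := {w | hutE w < cor39QJ w}

theorem hutJLtLang_mem_P : hutJLtLang ∈ Classes.P := by
  have hval : ∀ w, (ltFn ∘ fanoutFn (fstF ∘ sndF) hutExpNum) w = [decide (cor39QJ w < hutE w)] := fun w => by
    simp only [Function.comp_apply, fanoutFn_apply, hutExpNum_apply, ltFn_boolPair, bitsToNat_encodeNat, cor39QJ]
    rfl
  refine mem_P_of_mem_FP (comp_mem_FP ltFn_mem_FP (fanoutFn_mem_FP (comp_mem_FP fstF_mem_FP sndF_mem_FP)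
    hutExpNum_mem_FP)) _ fun w => ⟨fun hw => ?_, fun hw => ?_⟩
  · rw [hval, decide_eq_true (show cor39QJ w < hutE w from hw)]
  · rw [hval, decide_eq_false (show ¬ cor39QJ w < hutE w from hw)]

theorem hutELtLang_mem_P : hutELtLang ∈ Classes.P := by
  have hval : ∀ w, (ltFn ∘ fanoutFn hutExpNum (fstF ∘ sndF)) w = [decide (hutE w < cor39QJ w)] := fun w => by
    simp only [Function.comp_apply, fanoutFn_apply, hutExpNum_apply, ltFn_boolPair, bitsToNat_encodeNat, cor39QJ]
    rfl
  refine mem_P_of_mem_FP (comp_mem_FP ltFn_mem_FP (fanoutFn_mem_FP hutExpNum_mem_FP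
    (comp_mem_FP fstF_mem_FP sndF_mem_FP))) _ fun w => ⟨fun hw => ?_, fun hw => ?_⟩
  · rw [hval, decide_eq_true (show hutE w < cor39QJ w from hw)]
  · rw [hval, decide_eq_false (show ¬ hutE w < cor39QJ w from hw)]

/-- The test `j = 2k(n-k)` (two comparisons). -/
def hutJEqLang : Language Bool := hutJLtLangᶜ ⊓ hutELtLangᶜ

theorem mem_hutJEqLang_iff (w : List Bool) : w ∈ hutJEqLang ↔ cor39QJ w = hutE w := by
  change (¬ (cor39QJ w < hutE w) ∧ ¬ (hutE w < cor39QJ w)) ↔ _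
  omega

theorem hutJEqLang_mem_CH : hutJEqLang ∈ CH :=
  inter_P_mem_CH (compl_mem_P_iff.2 hutJLtLang_mem_P) (P_subset_CH (compl_mem_P_iff.2 hutELtLang_mem_P))

/-- **The bit language** of the table `4^{k(n-k)}`: `b = 1 ↔ j = 2k(n-k)`. -/
def hutBitLang : Language Bool := (cor39BLang ⊓ hutJEqLang) ⊔ (cor39BLangᶜ ⊓ hutJEqLangᶜ)

theorem mem_hutBitLang_iff (w : List Bool) :
    w ∈ hutBitLang ↔ (cor39QB w = true ↔ cor39QJ w = hutE w) := by
  rw [← mem_hutJEqLang_iff]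
  change (cor39QB w = true ∧ w ∈ hutJEqLang) ∨ (¬ cor39QB w = true ∧ ¬ w ∈ hutJEqLang) ↔ _
  tauto

theorem hutBitLang_mem_CH : hutBitLang ∈ CH :=
  union_mem_CH (inter_P_mem_CH cor39BLang_mem_P hutJEqLang_mem_CH)
    (inter_P_mem_CH (compl_mem_P_iff.2 cor39BLang_mem_P) (compl_mem_CH hutJEqLang_mem_CH))

/-- **The coefficient table of the Hutchinson–Tavenas family is definable in `CH`** (Bürgisser Def. 3.1):
sign language `⊤`, bit language `hutBitLang`, bit-size `4^{k(n-k)} ≤ 2^{n²}`. -/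
theorem hutchCoeff_chDefinable : IsCHDefinable (fun n => n) hutchCoeff := by
  refine ⟨⟨1, fun n => by show n ≤ n ^ 1 + 1; simp⟩, ⟨2, fun n k _ hk => ?_⟩,
    ⟨⊤, P_subset_CH top_mem_P, fun n k _ => ⟨fun _ => hutchCoeff_nonneg n k, fun _ => trivial⟩⟩,
    ⟨hutBitLang, hutBitLang_mem_CH, fun n k j b hk => ?_⟩⟩
  · -- polynomial bit-size
    rw [abs_of_nonneg (hutchCoeff_nonneg n k), hutchCoeff, if_pos hk]
    have hle : 2 * (k * (n - k)) ≤ n ^ 2 := by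
      obtain ⟨m, rfl⟩ := Nat.exists_eq_add_of_le hk
      rw [Nat.add_sub_cancel_left]
      nlinarith
    exact pow_le_pow_right₀ (by norm_num) hle
  · -- the bit language
    obtain ⟨hn, hk', hj, hb⟩ := cor39Q_encBitQuery n k j b
    rw [mem_hutBitLang_iff, hb, hj, hutE, hk', hn, hutchCoeff, if_pos hk, Int.natAbs_pow,
      show (2 : ℤ).natAbs = 2 from rfl]
    by_cases hje : j = 2 * (k * (n - k))
    · rw [hje, Nat.testBit_two_pow_self]
      simp
    · rw [Nat.testBit_two_pow_of_ne (Ne.symm hje)]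
      cases b <;> simp [hje]

end CHDefinability

/-- (VACUOUS: the hypothesis `h` is unsatisfiable — W-tower, header.)  `HexRealZeroTauBound c₀` ⇒ `τ(PER_n)`
is not polynomially bounded, with no residual: Bürgisser's Thm. 4.1(2) (tree theorem `Burgisser2009_thm41_2_holds`) run on the hexadecadal family
`W_{n+1}` whose coefficient table is `CH`-definable by `hutchCoeff_chDefinable`; `2^{e(n)} W_{n+1}` is
hexadecadal with exactly `n` real roots, so the sector τ-bound forces `n ≤ ((log₂ n + 2)^c + 2)^{c₀}`. -/
theorem not_isPBounded_tauPer_of_hexRealZeroTauBound' {c₀ : ℕ} (h : HexRealZeroTauBound c₀) :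
    ¬ IsPBounded (fun n => constantFreeComplexity (perPoly (Fin n) ℤ)) := by
  intro hP
  obtain ⟨e, -, c, hc⟩ :=
    Burgisser2009_thm41_2_holds hP (fun n => n) hutchCoeff hutchCoeff_chDefinable.isCHPolyDefinable
  set g : ℕ → Polynomial ℤ := fun n => C ((2 : ℤ) ^ e n) * hutchW (n + 1) with hg
  have hg_ne : ∀ n, g n ≠ 0 := fun n =>
    mul_ne_zero (C_ne_zero.2 (pow_ne_zero _ two_ne_zero)) (hutchW_ne_zero (by omega))
  have hτg : ∀ n, tauPoly (g n) ≤ (Nat.log 2 n + 2) ^ c := fun n => by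
    simpa only [hg, sum_range_hutchCoeff] using hc n
  have h2 : ∀ n, (Int.castRingHom ℝ) ((2 : ℤ) ^ e n) ≠ 0 := fun n => by simp
  have hhex : ∀ n, IsHexadecadal ((g n).map (Int.castRingHom ℝ)) := fun n => by
    simp only [hg]
    rw [Polynomial.map_mul, Polynomial.map_C]
    exact isHexadecadal_C_mul (h2 n) (isHexadecadal_map_hutchW (n + 1))
  have hroots : ∀ n, ((g n).map (Int.castRingHom ℝ)).roots.toFinset.card = n := fun n => by
    rw [card_roots_eq_natDegree_of_isHexadecadal (hhex n),
      natDegree_map_eq_of_injective (Int.castRingHom ℝ).injective_int]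
    simp only [hg]
    rw [natDegree_C_mul (pow_ne_zero _ two_ne_zero), natDegree_hutchW, Nat.add_sub_cancel]
  have key : ∀ n, n ≤ ((Nat.log 2 n + 2) ^ c + 2) ^ c₀ := fun n =>
    calc n = ((g n).map (Int.castRingHom ℝ)).roots.toFinset.card := (hroots n).symm
      _ ≤ (constantFreeComplexity ((MvPolynomial.uniqueAlgEquiv ℤ (Fin 1)).symm (g n)) + 2) ^ c₀ :=
          h (g n) (hg_ne n) (hhex n)
      _ = (tauPoly (g n) + 2) ^ c₀ := rfl
      _ ≤ ((Nat.log 2 n + 2) ^ c + 2) ^ c₀ :=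
          Nat.pow_le_pow_left (Nat.add_le_add_right (hτg n) 2) _
  obtain ⟨n, hn⟩ := exists_pow_log_lt c c₀
  exact absurd (key n) (not_le.2 hn)

/-- **VACUOUS IMPLICATION** (statement form, kernel-closed by `hexTwinPays`; RETRACTED as a «paying edge»:
its hypothesis `HexRealZeroTauBound c₀` is false for every `c₀` by the W-tower, VERDICT #2).  Recorded, not
booked. -/
def HexTwinPays : Prop :=
  ∀ c₀ : ℕ, HexRealZeroTauBound c₀ → ¬ IsPBounded (fun n => constantFreeComplexity (perPoly (Fin n) ℤ))

theorem hexTwinPays : HexTwinPays := fun _ h => not_isPBounded_tauPer_of_hexRealZeroTauBound' h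

/-! ## DICTIONARY: GP samples of the determinant = a symmetric-matrix exponential sum -/

/-- Evaluating the determinant of the pencil = determinant of the evaluated pencil. -/
theorem eval_det_pencil {m K : ℕ} (d : Fin K → ℕ) (S : Fin K → Matrix (Fin m) (Fin m) ℝ) (y : ℝ) :
    (pencil d S).det.eval y = (∑ l, (y ^ d l) • S l).det := by
  rw [← Polynomial.coe_evalRingHom, RingHom.map_det, RingHom.mapMatrix_apply]
  congr 1
  ext i j
  simp [Matrix.map_apply, Matrix.sum_apply, Matrix.smul_apply, Polynomial.eval_finsetSum]
  exact Finset.sum_congr rfl fun _ _ => mul_comm _ _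

/-- **The `k`-th GP sample is `det(Σ_l ρ_l^k T_l)` with `ρ_l = 16^{d_l}`, `T_l = x₀^{d_l} S_l`**: the sign
pattern the law bounds is the inertia-parity sequence along an orbit of the linear map `diag(16^{d_l})`. -/
theorem eval_det_pencil_gp {m K : ℕ} (d : Fin K → ℕ) (S : Fin K → Matrix (Fin m) (Fin m) ℝ)
    (x₀ : ℝ) (k : ℕ) :
    (pencil d S).det.eval (x₀ * 16 ^ k) = (∑ l, ((16 : ℝ) ^ d l) ^ k • (x₀ ^ d l • S l)).det := by
  rw [eval_det_pencil]
  congr 1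
  refine Finset.sum_congr rfl fun l _ => ?_
  have hsc : (x₀ * 16 ^ k) ^ d l = ((16 : ℝ) ^ d l) ^ k * x₀ ^ d l := by
    rw [mul_pow, ← pow_mul, ← pow_mul, Nat.mul_comm k (d l)]
    ring
  rw [hsc, smul_smul]

/-! ## RUNGS -/

/-- One letter: `det(X^{d₀} S₀) = (X^{d₀})^m · det S₀`. -/
theorem det_pencil_fin_one {m : ℕ} (d : Fin 1 → ℕ) (S : Fin 1 → Matrix (Fin m) (Fin m) ℝ) :
    (pencil d S).det = ((Polynomial.X : ℝ[X]) ^ d 0) ^ m * Polynomial.C (S 0).det := by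
  have h1 : pencil d S = (Polynomial.X : ℝ[X]) ^ d 0 • (S 0).map Polynomial.C := by
    simp [pencil]
  rw [h1, Matrix.det_smul, Fintype.card_fin]
  congr 1
  rw [← RingHom.mapMatrix_apply, ← RingHom.map_det]

/-- **`θ(m,1) = 0`**: a one-letter pencil determinant never flips sign along a progression of ratio `r ≥ 0`. -/
theorem alternatesGP_fin_one {m : ℕ} (d : Fin 1 → ℕ) (S : Fin 1 → Matrix (Fin m) (Fin m) ℝ) {r : ℝ}
    (hr : 0 ≤ r) {N : ℕ} (h : AlternatesGP r N (pencil d S).det) : N = 0 := by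
  obtain ⟨x₀, -, hs⟩ := h
  by_contra hN
  have h0 := hs 0 (Nat.pos_of_ne_zero hN)
  rw [det_pencil_fin_one] at h0
  simp only [pow_zero, mul_one, zero_add, pow_one, eval_mul, eval_pow, eval_X, eval_C] at h0
  have hx : 0 ≤ x₀ * (x₀ * r) := by
    rw [← mul_assoc]; exact mul_nonneg (mul_self_nonneg x₀) hr
  have hnn : 0 ≤ ((x₀ ^ d 0) ^ m * (S 0).det) * (((x₀ * r) ^ d 0) ^ m * (S 0).det) := by
    have heq : ((x₀ ^ d 0) ^ m * (S 0).det) * (((x₀ * r) ^ d 0) ^ m * (S 0).det)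
        = ((x₀ * (x₀ * r)) ^ d 0) ^ m * (S 0).det ^ 2 := by ring
    rw [heq]
    exact mul_nonneg (pow_nonneg (pow_nonneg hx _) _) (sq_nonneg _)
  linarith

/-- Row `θ(m,1) ≤ 0` (PROVED). -/
theorem gpAltLawAt_one (m : ℕ) : GPAltLawAt m 1 0 :=
  fun d S _ _ h => (alternatesGP_fin_one d S (by norm_num) h).le

/-- Every census row `RealRootLawAt m K B` (tree: `η(2,4)=…`, `M(m,K) ≤ B` rows) is a row of this instrument. -/
theorem gpAltLawAt_of_realRootLawAt {m K B : ℕ} (h : RealRootLawAt m K B) : GPAltLawAt m K B :=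
  fun d S hS _ hN => (le_card_roots_of_alternatesGP (by norm_num) hN).trans (h d S hS)

/-! ### Row `θ(m,2) = m` (PROVED upper bound): two-letter pencils have at most `m` flips along any GP

`det F(y) = (y^{d₀})^m · q(y^{d₁}/y^{d₀})` with `q(u) = det(u·S₁ + S₀)` of degree `≤ m`, and
`t ↦ t^{d₁}/t^{d₀}` is injective on a half-line when `d₀ ≠ d₁`; the `N` one-signed roots produced by
`exists_roots_of_alternatesGP` therefore inject into the roots of `q`.  (Equality: `S₀ = I`,
`S₁ = −diag(16^{−i})`, `d = (0,1)` gives `det = ∏(1 − X·16^{−i})`, `m` flips — not formalised.) -/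

theorem eval_det_X_smul_add {m : ℕ} (A B : Matrix (Fin m) (Fin m) ℝ) (u : ℝ) :
    (((X : ℝ[X]) • A.map C + B.map C).det).eval u = (u • A + B).det := by
  have h := (Polynomial.evalRingHom u).map_det ((X : ℝ[X]) • A.map C + B.map C)
  rw [Polynomial.coe_evalRingHom] at h
  rw [h]
  congr 1
  ext i j
  simp [Matrix.add_apply, Matrix.smul_apply, Matrix.map_apply]
  exact mul_comm _ _

theorem eval_det_pencil_two {m : ℕ} (d : Fin 2 → ℕ) (S : Fin 2 → Matrix (Fin m) (Fin m) ℝ)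
    {y : ℝ} (hy : y ≠ 0) :
    (pencil d S).det.eval y =
      (y ^ d 0) ^ m * (((X : ℝ[X]) • (S 1).map C + (S 0).map C).det).eval (y ^ d 1 / y ^ d 0) := by
  rw [eval_det_pencil, eval_det_X_smul_add, Fin.sum_univ_two]
  have h0 : y ^ d 0 ≠ 0 := pow_ne_zero _ hy
  have hmat : y ^ d 0 • S 0 + y ^ d 1 • S 1 = (y ^ d 0) • ((y ^ d 1 / y ^ d 0) • S 1 + S 0) := by
    rw [smul_add, smul_smul, mul_div_cancel₀ _ h0, add_comm]
  rw [hmat, Matrix.det_smul, Fintype.card_fin]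

/-- `t ↦ t^{d₁}/t^{d₀}` is injective on nonzero reals of one sign when `d₀ ≠ d₁`. -/
theorem gpRatio_injOn {d₀ d₁ : ℕ} (hd : d₀ ≠ d₁) {x₀ t t' : ℝ} (ht : 0 < x₀ * t) (ht' : 0 < x₀ * t')
    (h : t ^ d₁ / t ^ d₀ = t' ^ d₁ / t' ^ d₀) : t = t' := by
  rcases mul_pos_iff.mp ht with ⟨hx, htp⟩ | ⟨hx, htn⟩ <;>
    rcases mul_pos_iff.mp ht' with ⟨hx', htp'⟩ | ⟨hx', htn'⟩
  rotate_left 1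
  · exact absurd hx (not_lt.mpr hx'.le)
  · exact absurd hx' (not_lt.mpr hx.le)
  rotate_left 1
  all_goals
    have ha : 0 < |t| := abs_pos.mpr (by rintro rfl; simp at *)
    have hb : 0 < |t'| := abs_pos.mpr (by rintro rfl; simp at *)
    have habs : |t| ^ d₁ / |t| ^ d₀ = |t'| ^ d₁ / |t'| ^ d₀ := by
      rw [← abs_pow, ← abs_pow, ← abs_div, h, abs_div, abs_pow, abs_pow]
    have hq : (|t| / |t'|) ^ d₁ = (|t| / |t'|) ^ d₀ := by
      rw [div_pow, div_pow, div_eq_div_iff (pow_ne_zero _ hb.ne') (pow_ne_zero _ hb.ne')]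
      rw [div_eq_div_iff (pow_ne_zero _ ha.ne') (pow_ne_zero _ hb.ne')] at habs
      linarith [habs]
    have hr : |t| / |t'| = 1 := by
      by_contra hne
      exact hd ((pow_right_injective₀ (div_pos ha hb) hne) hq).symm
    have hab : |t| = |t'| := by rwa [div_eq_one_iff_eq hb.ne'] at hr
  · rw [abs_of_pos htp, abs_of_pos htp'] at hab; exact hab
  · rw [abs_of_neg htn, abs_of_neg htn'] at hab; linarith

/-- Row `θ(m,2) ≤ m` (PROVED): a two-letter symmetric pencil of size `m` has at most `m` sign flips along
any ratio-16 geometric progression.  (The symmetry hypothesis is not even used.) -/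
theorem gpAltLawAt_two (m : ℕ) : GPAltLawAt m 2 m := by
  classical
  intro d S _ N hN
  obtain ⟨x₀, hx₀, T, hTsub, hTcard, hTsign⟩ := exists_roots_of_alternatesGP (by norm_num) hN
  set p : ℝ[X] := (pencil d S).det with hp_def
  set q : ℝ[X] := ((X : ℝ[X]) • (S 1).map C + (S 0).map C).det with hq_def
  have hq_deg : q.natDegree ≤ m := by
    simpa using Polynomial.natDegree_det_X_add_C_le (S 1) (S 0)
  have key : ∀ y : ℝ, y ≠ 0 → p.eval y = (y ^ d 0) ^ m * q.eval (y ^ d 1 / y ^ d 0) :=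
    fun y hy => eval_det_pencil_two d S hy
  have hinf : Set.Infinite {y : ℝ | y ≠ 0} := by
    have h := (Set.finite_singleton (0 : ℝ)).infinite_compl
    convert h using 1
    ext y
    simp
  -- every `t ∈ T` is a nonzero root of `p ≠ 0`
  have hT : ∀ t ∈ T, t ≠ 0 ∧ p ≠ 0 ∧ p.eval t = 0 := by
    intro t ht
    have hmem := hTsub ht
    rw [Multiset.mem_toFinset, mem_roots', IsRoot.def] at hmem
    refine ⟨?_, hmem.1, hmem.2⟩
    rintro rfl
    have := hTsign 0 ht
    simp at this
  have hroot : ∀ t ∈ T, q.eval (t ^ d 1 / t ^ d 0) = 0 := by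
    intro t ht
    obtain ⟨ht0, -, hev⟩ := hT t ht
    have h := key t ht0
    rw [hev] at h
    exact (mul_eq_zero.mp h.symm).resolve_left (pow_ne_zero _ (pow_ne_zero _ ht0))
  -- if `p` vanished at every nonzero real it would be `0`, contradicting `t ∈ p.roots`
  have hp_ne : ∀ t ∈ T, ¬ (∀ y : ℝ, y ≠ 0 → p.eval y = 0) := by
    intro t ht hall
    exact (hT t ht).2.1 (Polynomial.eq_zero_of_infinite_isRoot p (hinf.mono fun y hy => hall y hy))
  by_cases hq0 : q = 0
  · -- then `p` vanishes off `0`, so `T = ∅`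
    have hTe : T = ∅ := by
      by_contra hne
      obtain ⟨t, ht⟩ := Finset.nonempty_iff_ne_empty.mpr hne
      exact hp_ne t ht fun y hy => by rw [key y hy, hq0, eval_zero, mul_zero]
    rw [← hTcard, hTe, Finset.card_empty]
    exact Nat.zero_le _
  by_cases hd : d 0 = d 1
  · -- equal exponents: `q(1) = 0` would again force `p = 0`
    have hTe : T = ∅ := by
      by_contra hne
      obtain ⟨t, ht⟩ := Finset.nonempty_iff_ne_empty.mpr hne
      have h1 : q.eval 1 = 0 := by
        have h := hroot t ht
        rwa [hd, div_self (pow_ne_zero _ (hT t ht).1)] at h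
      exact hp_ne t ht fun y hy => by rw [key y hy, hd, div_self (pow_ne_zero _ hy), h1, mul_zero]
    rw [← hTcard, hTe, Finset.card_empty]
    exact Nat.zero_le _
  · have hmap : Set.MapsTo (fun t : ℝ => t ^ d 1 / t ^ d 0) (T : Set ℝ) (q.roots.toFinset : Set ℝ) := by
      intro t ht
      rw [Finset.mem_coe, Multiset.mem_toFinset, mem_roots hq0, IsRoot.def]
      exact hroot t ht
    have hinj : Set.InjOn (fun t : ℝ => t ^ d 1 / t ^ d 0) (T : Set ℝ) :=
      fun t ht t' ht' h => gpRatio_injOn hd (hTsign t ht) (hTsign t' ht') h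
    calc N = T.card := hTcard.symm
      _ ≤ q.roots.toFinset.card := Finset.card_le_card_of_injOn _ hmap hinj
      _ ≤ Multiset.card q.roots := Multiset.toFinset_card_le _
      _ ≤ q.natDegree := Polynomial.card_roots' q
      _ ≤ m := hq_deg

/-! ### Row `θ(1,K) ≤ K − 1` (PROVED, every `K`): rank one is Descartes' rule

A `1 × 1` pencil determinant is a `K`-nomial; its `N` one-signed GP-separated roots are fewer than
its monomials (tree `card_roots_toFinset_filter_pos_lt_card_support` / `_neg_`, Descartes via sign
variations).  Equality `θ(1,K) = K − 1`: `∏_{i<K-1}(X − 16^i)` expanded has `K` monomials — not formalised. -/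

theorem det_pencil_one_left {K : ℕ} (d : Fin K → ℕ) (S : Fin K → Matrix (Fin 1) (Fin 1) ℝ) :
    (pencil d S).det = ∑ l, C (S l 0 0) * X ^ d l := by
  rw [Matrix.det_fin_one]
  simp only [Matrix.sum_apply, Matrix.smul_apply, Matrix.map_apply, smul_eq_mul]
  exact Finset.sum_congr rfl fun l _ => mul_comm _ _

theorem card_support_det_pencil_one_left {K : ℕ} (d : Fin K → ℕ)
    (S : Fin K → Matrix (Fin 1) (Fin 1) ℝ) : (pencil d S).det.support.card ≤ K := by
  classical
  have hsub : (pencil d S).det.support ⊆ Finset.univ.image d := by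
    intro e he
    rw [mem_support_iff, det_pencil_one_left, finsetSum_coeff] at he
    by_contra hne
    apply he
    refine Finset.sum_eq_zero fun l _ => ?_
    rw [coeff_C_mul_X_pow, if_neg]
    rintro rfl
    exact hne (Finset.mem_image_of_mem d (Finset.mem_univ l))
  exact (Finset.card_le_card hsub).trans (Finset.card_image_le.trans (by simp))

/-- **θ(1,K) ≤ K − 1.** -/
theorem gpAltLawAt_one_left (K : ℕ) : GPAltLawAt 1 K (K - 1) := by
  classical
  intro d S _ N hN
  obtain ⟨x₀, hx₀, T, hTsub, hTcard, hTsign⟩ := exists_roots_of_alternatesGP (by norm_num) hN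
  set p := (pencil d S).det with hp
  rcases eq_or_ne p 0 with h0 | h0
  · have hT : T = ∅ := Finset.subset_empty.1 (by simpa [h0] using hTsub)
    rw [hT, Finset.card_empty] at hTcard
    omega
  have hK : p.support.card ≤ K := card_support_det_pencil_one_left d S
  rcases lt_or_gt_of_ne hx₀ with hneg | hpos
  · have hTsub' : T ⊆ p.roots.toFinset.filter (· < 0) := fun t ht => by
      refine Finset.mem_filter.2 ⟨hTsub ht, ?_⟩
      rcases pos_and_pos_or_neg_and_neg_of_mul_pos (hTsign t ht) with ⟨h1, -⟩ | ⟨-, h2⟩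
      · exact absurd h1 (lt_asymm hneg)
      · exact h2
    have hlt := (Finset.card_le_card hTsub').trans_lt (card_roots_toFinset_filter_neg_lt_card_support h0)
    omega
  · have hTsub' : T ⊆ p.roots.toFinset.filter (0 < ·) := fun t ht => by
      refine Finset.mem_filter.2 ⟨hTsub ht, ?_⟩
      rcases pos_and_pos_or_neg_and_neg_of_mul_pos (hTsign t ht) with ⟨-, h1⟩ | ⟨h2, -⟩
      · exact h1
      · exact absurd h2 (lt_asymm hpos)
    have hlt := (Finset.card_le_card hTsub').trans_lt (card_roots_toFinset_filter_pos_lt_card_support h0)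
    omega

/-- **θ(1,K) ≤ K − 1 for every `K`** (statement form, kernel-closed by `thetaRowOneLeft`). -/
def ThetaRowOneLeft : Prop := ∀ K : ℕ, GPAltLawAt 1 K (K - 1)

theorem thetaRowOneLeft : ThetaRowOneLeft := gpAltLawAt_one_left

/-! ### Generic row (PROVED): the positive Descartes ceiling `θ(m,K) ≤ C(m+K−1, m) − 1`, all `m`, `K ≥ 1`

The `N` one-signed roots from `exists_roots_of_alternatesGP` are positive roots of the pencil or — after
the reflection `X ↦ −X`, `S_l ↦ (−1)^{d_l} S_l` (tree `NegRoots.card_negRoots_le_card_posRoots_reflect`) —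
of the reflected pencil, and either has fewer positive roots than the `C(m+K−1, m)` possible monomials
(tree `stub_descartesCeiling`).  This is the instrument's GENERIC CEILING: exponential in `min(m,K)·log`, so
the open content of `HexLinLogLaw` is exactly the gap between `log C(m+K−1,m) ≈ K·log m` (for `m ≫ K`,
`m ≤ 2^{polylog K}`: `K·polylog K`) and the lin-log `K·log K` — the SAME polylog gap as the crux, now on a
sector where the TauRealZeros mechanism is certified absent. -/

theorem gpAltLawAt_descartes (m K : ℕ) (hK : 0 < K) :
    GPAltLawAt m K (Nat.choose (m + K - 1) m - 1) := by
  classical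
  intro d S _ N hN
  obtain ⟨x₀, hx₀, T, hTsub, hTcard, hTsign⟩ := exists_roots_of_alternatesGP (by norm_num) hN
  set p := (pencil d S).det with hp
  rcases eq_or_ne p 0 with h0 | h0
  · have hT : T = ∅ := Finset.subset_empty.1 (by simpa [h0] using hTsub)
    rw [hT, Finset.card_empty] at hTcard
    omega
  rcases lt_or_gt_of_ne hx₀ with hneg | hpos
  · have hTsub' : T ⊆ p.roots.toFinset.filter (fun t => t < 0) := fun t ht => by
      refine Finset.mem_filter.2 ⟨hTsub ht, ?_⟩
      rcases pos_and_pos_or_neg_and_neg_of_mul_pos (hTsign t ht) with ⟨h1, -⟩ | ⟨-, h2⟩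
      · exact absurd h1 (lt_asymm hneg)
      · exact h2
    have h1 := Finset.card_le_card hTsub'
    have h2 : (p.roots.toFinset.filter (fun t => t < 0)).card ≤
        ((pencil d (fun l => ((-1 : ℝ) ^ d l) • S l)).det.roots.toFinset.filter (fun t => 0 < t)).card :=
      NegRoots.card_negRoots_le_card_posRoots_reflect S d h0
    have h3 : ((pencil d (fun l => ((-1 : ℝ) ^ d l) • S l)).det.roots.toFinset.filter
        (fun t => 0 < t)).card + 1 ≤ Nat.choose (m + K - 1) m :=
      stub_descartesCeiling K m hK d (fun l => ((-1 : ℝ) ^ d l) • S l)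
    omega
  · have hTsub' : T ⊆ p.roots.toFinset.filter (fun t => 0 < t) := fun t ht => by
      refine Finset.mem_filter.2 ⟨hTsub ht, ?_⟩
      rcases pos_and_pos_or_neg_and_neg_of_mul_pos (hTsign t ht) with ⟨-, h1⟩ | ⟨h2, -⟩
      · exact h1
      · exact absurd h2 (lt_asymm hpos)
    have h1 := Finset.card_le_card hTsub'
    have h3 : (p.roots.toFinset.filter (fun t => 0 < t)).card + 1 ≤ Nat.choose (m + K - 1) m :=
      stub_descartesCeiling K m hK d S
    omega

/-- **Fixed-`K` polynomial row** (PROVED): `θ(m,K) ≤ (m+K−1)^{K−1} − 1` — for every FIXED number of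
letters the sector law holds with a bound polynomial in the size `m` (Descartes ceiling + `C(n,k) ≤ n^k`). -/
theorem gpAltLawAt_polyRow (m K : ℕ) (hK : 0 < K) : GPAltLawAt m K ((m + K - 1) ^ (K - 1) - 1) := by
  intro d S hS N hN
  have h := gpAltLawAt_descartes m K hK d S hS N hN
  have hc : Nat.choose (m + K - 1) m ≤ (m + K - 1) ^ (K - 1) := by
    rw [show m + K - 1 = m + (K - 1) by omega, Nat.choose_symm_add]
    exact Nat.choose_le_pow _ _
  omega

/-- **The generic Descartes ceiling of the instrument** (statement form, kernel-closed by `thetaDescartes`). -/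
def ThetaDescartesCeiling : Prop := ∀ m K : ℕ, 0 < K → GPAltLawAt m K (Nat.choose (m + K - 1) m - 1)

theorem thetaDescartes : ThetaDescartesCeiling := gpAltLawAt_descartes

/-! ### Witness of weakness (PROVED): on POLYNOMIAL formats `m ≤ K^a` the lin-log law is a THEOREM

Descartes' ceiling gives `#roots ≤ 2·C(m+K−1,m) − 1 ≤ 2·(m+K−1)^{K−1} ≤ 2^{(2a+3)·K·log₂K}` whenever
`m ≤ K^a`, `K ≥ 2` — for EVERY symmetric pencil, no sector needed.  So the sector-free law `LinLogLaw` (A3)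
and a fortiori `HexLinLogLaw` are PROVED on polynomial formats with `A = 2a + 3`, while the crux
`MatrixDescartes` on the same formats asks `#roots^q ≤ 2^{K log K}` for EVERY `q`, i.e. `2^{o(K log K)}`, which
Descartes does not give: a regime where the door is decided and the crux is not.  The ENTIRE open content of
`stub_hexLinLogLaw` is the quasi-polynomial window `K^a < m ≤ 2^{(log K + c)^c}` with `A` uniform in `c`. -/

/-- The lin-log law restricted to polynomial formats `m ≤ K^a` (sector-free). -/
def LinLogLawPolyFormats (a A : ℕ) : Prop :=
  ∀ K m : ℕ, 2 ≤ K → m ≤ K ^ a →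
    ∀ (d : Fin K → ℕ) (S : Fin K → Matrix (Fin m) (Fin m) ℝ), (∀ l, (S l).IsSymm) →
      (pencil d S).det.roots.toFinset.card ≤ 2 ^ (A * (K * Nat.log 2 K))

/-- Descartes, all real zeros: `#roots ≤ 2·C(m+K−1,m) − 1` (tree stubs `stub_descartesCeiling`, `stub_negRoots`). -/
theorem card_roots_det_pencil_le_descartes {m K : ℕ} (hK : 0 < K) (d : Fin K → ℕ)
    (S : Fin K → Matrix (Fin m) (Fin m) ℝ) :
    (pencil d S).det.roots.toFinset.card ≤ 2 * Nat.choose (m + K - 1) m - 1 := by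
  have h1 : ((pencil d S).det.roots.toFinset.filter fun t => 0 < t).card + 1 ≤ Nat.choose (m + K - 1) m :=
    stub_descartesCeiling K m hK d S
  have h2 : ((pencil d (fun l => ((-1 : ℝ) ^ d l) • S l)).det.roots.toFinset.filter fun t => 0 < t).card + 1
      ≤ Nat.choose (m + K - 1) m :=
    stub_descartesCeiling K m hK d (fun l => ((-1 : ℝ) ^ d l) • S l)
  have h3 : (pencil d S).det.roots.toFinset.card ≤
      ((pencil d S).det.roots.toFinset.filter fun t => 0 < t).card +
        ((pencil d (fun l => ((-1 : ℝ) ^ d l) • S l)).det.roots.toFinset.filter fun t => 0 < t).card + 1 :=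
    stub_negRoots K m d S
  omega

/-- **The lin-log law holds on polynomial formats** (`A = 2a + 3`), for every symmetric pencil. -/
theorem linLogLaw_polyFormats (a : ℕ) : LinLogLawPolyFormats a (2 * a + 3) := by
  intro K m hK hm d S _
  have h1 := card_roots_det_pencil_le_descartes (show 0 < K by omega) d S
  have hc : Nat.choose (m + K - 1) m ≤ (m + K - 1) ^ (K - 1) := by
    rw [show m + K - 1 = m + (K - 1) by omega, Nat.choose_symm_add]
    exact Nat.choose_le_pow _ _
  -- `m + K - 1 ≤ K^(a+1)`
  have hb : m + K - 1 ≤ K ^ (a + 1) := by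
    have h2K : 2 * K ^ a ≤ K ^ (a + 1) := by
      rw [pow_succ, mul_comm]; exact Nat.mul_le_mul_left _ hK
    rcases Nat.eq_zero_or_pos a with rfl | ha
    · simp at hm ⊢; omega
    · have hKa : K ≤ K ^ a := Nat.le_self_pow ha.ne' K
      omega
  set L := Nat.log 2 K with hL
  have hL1 : 1 ≤ L := Nat.le_log_of_pow_le one_lt_two (by simpa using hK)
  have hlog : K ≤ 2 ^ (L + 1) := (Nat.lt_pow_succ_log_self one_lt_two K).le
  have hKpos : 0 < K ^ (a + 1) := by positivity
  calc (pencil d S).det.roots.toFinset.card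
      ≤ 2 * Nat.choose (m + K - 1) m - 1 := h1
    _ ≤ 2 * (m + K - 1) ^ (K - 1) := by omega
    _ ≤ 2 * (K ^ (a + 1)) ^ (K - 1) := by gcongr
    _ ≤ 2 * (K ^ (a + 1)) ^ K :=
        Nat.mul_le_mul_left 2 (Nat.pow_le_pow_right hKpos (Nat.sub_le K 1))
    _ ≤ 2 * (2 ^ (L + 1)) ^ ((a + 1) * K) := by rw [← pow_mul]; gcongr
    _ = 2 ^ (1 + (L + 1) * ((a + 1) * K)) := by rw [← pow_mul, pow_add, pow_one]
    _ ≤ 2 ^ ((2 * a + 3) * (K * L)) := by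
        apply Nat.pow_le_pow_right two_pos
        have e1 : a * K ≤ a * K * L := Nat.le_mul_of_pos_right _ hL1
        have e2 : K ≤ K * L := Nat.le_mul_of_pos_right _ hL1
        have e3 : 2 ≤ K * L := le_trans hK e2
        nlinarith [e1, e2, e3]

/-- Corollary: the SECTOR law on polynomial formats. -/
theorem hexLinLogLaw_polyFormats (a K m : ℕ) (hK : 2 ≤ K) (hm : m ≤ K ^ a) (d : Fin K → ℕ)
    (S : Fin K → Matrix (Fin m) (Fin m) ℝ) (hS : ∀ l, (S l).IsSymm) (_h : IsHexadecadal (pencil d S).det) :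
    (pencil d S).det.roots.toFinset.card ≤ 2 ^ ((2 * a + 3) * (K * Nat.log 2 K)) :=
  linLogLaw_polyFormats a K m hK hm d S hS

/-- **Witness of weakness** (statement form, kernel-closed by `linLogLawPolyFormats_all`): for every `a` the
lin-log law holds on the formats `m ≤ K^a` with `A = 2a+3`. -/
def LinLogLawOnPolyFormats : Prop := ∀ a : ℕ, LinLogLawPolyFormats a (2 * a + 3)

theorem linLogLawPolyFormats_all : LinLogLawOnPolyFormats := linLogLaw_polyFormats

/-! ### The additive handle (PROVED): hexadecadal ⇒ FULL support ⇒ the exponent design is an exact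
additive basis of order `m` — the sector law meets the POSTAGE-STAMP problem

A hexadecadal `p ≠ 0` has `natDegree p` one-signed roots, so by Descartes it needs all `natDegree p + 1`
monomials: NO internal coefficient vanishes (`coeff_ne_zero_of_isHexadecadal`).  For `p = det(Σ_l x^{d_l} S_l)` the
coefficient of `x^e` vanishes unless `e = d_{g(1)} + ⋯ + d_{g(m)}` for some row-to-letter map `g`
(tree `StubDescartesCeiling.coeff_det_pencil_eq_zero`).  Hence (`hexStampLaw`): EVERY `e ≤ deg` is a sum of
`m` letters' exponents — `{d_l}` is an additive basis of order `m` for `[0, deg]`, and `deg ≤ n(m, K−1)`, the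
classical `m`-range of `K−1` positive stamp values (Rohrbach–Stöhr postage-stamp function).  This re-proves the
generic ceiling with no root counting beyond Descartes-for-support, gives `θ_hex(m,2) ≤ n(m,1) = m` again, and at
the first interacting format BEATS Descartes: `hexDegRow_two_three` — a hexadecadal `(2,3)` determinant has
degree `≤ 4 = n(2,2)` (Descartes/positive-root census allow `5`).  The law's open content in this currency:
symmetric determinantal designs on EXTREMAL additive bases (`m ≫ K`, range `≈ (m/K)^{K−1}`) with full
hexadecadal sign structure. -/

/-- **No internal zero coefficient** in a nonzero hexadecadal polynomial. -/
theorem coeff_ne_zero_of_isHexadecadal {p : ℝ[X]} (hp : p ≠ 0) (h : IsHexadecadal p) {e : ℕ}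
    (he : e ≤ p.natDegree) : p.coeff e ≠ 0 := by
  classical
  intro hzero
  obtain ⟨x₀, hx₀, T, hTsub, hTcard, hTsign⟩ := exists_roots_of_alternatesGP (by norm_num) h
  have hsupp : p.support.card ≤ p.natDegree := by
    have hsub : p.support ⊆ (Finset.range (p.natDegree + 1)).erase e := by
      intro n hn
      rw [Finset.mem_erase, Finset.mem_range]
      refine ⟨?_, Nat.lt_succ_of_le (le_natDegree_of_mem_supp n hn)⟩
      rintro rfl
      exact (mem_support_iff.1 hn) hzero
    have hcard := Finset.card_le_card hsub
    rw [Finset.card_erase_of_mem (Finset.mem_range.2 (Nat.lt_succ_of_le he)), Finset.card_range] at hcard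
    simpa using hcard
  rcases lt_or_gt_of_ne hx₀ with hneg | hpos
  · have hT' : T ⊆ p.roots.toFinset.filter (fun t => t < 0) := fun t ht => by
      refine Finset.mem_filter.2 ⟨hTsub ht, ?_⟩
      rcases pos_and_pos_or_neg_and_neg_of_mul_pos (hTsign t ht) with ⟨h1, -⟩ | ⟨-, h2⟩
      · exact absurd h1 (lt_asymm hneg)
      · exact h2
    have h1 := Finset.card_le_card hT'
    have h2 := card_roots_toFinset_filter_neg_lt_card_support hp
    omega
  · have hT' : T ⊆ p.roots.toFinset.filter (fun t => 0 < t) := fun t ht => by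
      refine Finset.mem_filter.2 ⟨hTsub ht, ?_⟩
      rcases pos_and_pos_or_neg_and_neg_of_mul_pos (hTsign t ht) with ⟨-, h1⟩ | ⟨h2, -⟩
      · exact h1
      · exact absurd h2 (lt_asymm hpos)
    have h1 := Finset.card_le_card hT'
    have h2 := card_roots_toFinset_filter_pos_lt_card_support hp
    omega

/-- **Hexadecadal determinants sit on exact additive bases**: every exponent `e ≤ deg det` is a sum of `m`
letter exponents. -/
theorem exists_sum_eq_of_isHexadecadal_det {m K : ℕ} (d : Fin K → ℕ)
    (S : Fin K → Matrix (Fin m) (Fin m) ℝ) (hdet : (pencil d S).det ≠ 0)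
    (h : IsHexadecadal (pencil d S).det) {e : ℕ} (he : e ≤ (pencil d S).det.natDegree) :
    ∃ g : Fin m → Fin K, ∑ i, d (g i) = e := by
  by_contra hne
  exact coeff_ne_zero_of_isHexadecadal hdet h he
    (StubDescartesCeiling.coeff_det_pencil_eq_zero d S (fun g hg => hne ⟨g, hg⟩))

/-- **The postage-stamp law** (statement form, kernel-closed by `hexStampLaw`): for every symmetric-or-not
`(m,K)` pencil with nonzero hexadecadal determinant, `[0, deg det]` lies in the `m`-fold sumset of the
exponents — so `deg det ≤ n(m, K−1)`, the postage-stamp range. -/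
def HexStampLaw : Prop :=
  ∀ (m K : ℕ) (d : Fin K → ℕ) (S : Fin K → Matrix (Fin m) (Fin m) ℝ),
    (pencil d S).det ≠ 0 → IsHexadecadal (pencil d S).det →
      ∀ e : ℕ, e ≤ (pencil d S).det.natDegree → ∃ g : Fin m → Fin K, ∑ i, d (g i) = e

theorem hexStampLaw : HexStampLaw := fun _ _ d S hdet h _ he => exists_sum_eq_of_isHexadecadal_det d S hdet h he

/-- The postage-stamp fact `n(2,2) = 4 < 5`: no three stamp values (one of them forced to be `0`) represent
all of `0,…,5` as sums of two. -/
theorem stamp_two_three {d : Fin 3 → ℕ} (h : ∀ e, e ≤ 5 → ∃ g : Fin 2 → Fin 3, d (g 0) + d (g 1) = e) :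
    False := by
  obtain ⟨g1, hg1⟩ := h 1 (by norm_num)
  obtain ⟨a, b, ha, hb⟩ : ∃ a b : Fin 3, d a = 0 ∧ d b = 1 := by
    rcases Nat.eq_zero_or_pos (d (g1 0)) with h0 | h0
    · exact ⟨g1 0, g1 1, h0, by omega⟩
    · exact ⟨g1 1, g1 0, by omega, by omega⟩
  have hab : (a : ℕ) ≠ b := fun hv => by
    have : a = b := Fin.ext hv
    rw [this] at ha; omega
  have ha3 := a.isLt
  have hb3 := b.isLt
  let c : Fin 3 := ⟨3 - a - b, by omega⟩
  have hval : ∀ l : Fin 3, d l = 0 ∨ d l = 1 ∨ d l = d c := by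
    intro l
    have hl3 := l.isLt
    have hcov : (l : ℕ) = a ∨ (l : ℕ) = b ∨ (l : ℕ) = 3 - a - b := by omega
    rcases hcov with hl | hl | hl
    · left; rw [Fin.ext hl]; exact ha
    · right; left; rw [Fin.ext hl]; exact hb
    · right; right; rw [show l = c from Fin.ext hl]
  have hsum : ∀ e, (∃ g : Fin 2 → Fin 3, d (g 0) + d (g 1) = e) →
      e ≤ 2 ∨ e = d c ∨ e = d c + 1 ∨ e = 2 * d c := by
    rintro e ⟨g, rfl⟩
    rcases hval (g 0) with h0 | h0 | h0 <;> rcases hval (g 1) with h1 | h1 | h1 <;> omega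
  have h3 := hsum 3 (h 3 (by norm_num))
  have h5 := hsum 5 (h 5 (by norm_num))
  omega

/-- **Row (2,3) beats Descartes**: a hexadecadal determinant of a three-letter `2 × 2` pencil has degree
`≤ 4 = n(2,2)` (Descartes / the positive-root census allow `5` one-signed roots). -/
theorem hexDegRow_two_three (d : Fin 3 → ℕ) (S : Fin 3 → Matrix (Fin 2) (Fin 2) ℝ)
    (h : IsHexadecadal (pencil d S).det) : (pencil d S).det.natDegree ≤ 4 := by
  by_cases hdet : (pencil d S).det = 0
  · rw [hdet, natDegree_zero]; exact Nat.zero_le _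
  by_contra hlt
  push Not at hlt
  refine stamp_two_three (d := d) fun e he => ?_
  obtain ⟨g, hg⟩ := exists_sum_eq_of_isHexadecadal_det d S hdet h (show e ≤ _ by omega)
  exact ⟨g, by simpa [Fin.sum_univ_two] using hg⟩

/-- **The (2,3) hexadecadal degree row** (statement form, kernel-closed by `hexDegRowTwoThree`). -/
def HexDegRowTwoThree : Prop :=
  ∀ (d : Fin 3 → ℕ) (S : Fin 3 → Matrix (Fin 2) (Fin 2) ℝ),
    IsHexadecadal (pencil d S).det → (pencil d S).det.natDegree ≤ 4

theorem hexDegRowTwoThree : HexDegRowTwoThree := hexDegRow_two_three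

/-- **θ(m,2) ≤ m for every size `m`** (statement form, kernel-closed by `thetaRowTwo`). -/
def ThetaRowTwo : Prop := ∀ m : ℕ, GPAltLawAt m 2 m

theorem thetaRowTwo : ThetaRowTwo := gpAltLawAt_two

/-! ### Calibration (PROVED): the rows `θ(m,2) = m` and `θ(1,K) = K − 1` are ATTAINED, and the sector is
populated at every size

Converse of `exists_roots_of_alternatesGP` for split polynomials: `a · ∏_{i<N}(X − r_i)` whose roots
INTERLACE the progression (`x₀16^i < r_i < x₀16^{i+1}`, `x₀ > 0`) flips `N` times
(`alternatesGP_interlace`).  Witnesses: the diagonal two-letter pencil `X·I − diag(2·16^i)` of size `m`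
(`m` flips, hexadecadal: `isHexadecadal_det_diagPencil`, so `¬ θ(m,2) ≤ m − 1`) and the `1 × 1`, `K`-letter
pencil `∏_{i<K−1}(X − 2·16^i) = Σ_{l<K} c_l X^l` (`K − 1` flips, so `¬ θ(1,K) ≤ K − 2`). -/

/-- Interlacing roots ⇒ GP alternation (with the sign bookkeeping needed for the induction). -/
theorem interlace_aux (a x₀ : ℝ) (ha : a ≠ 0) (hx : 0 < x₀) (r : ℕ → ℝ)
    (hlo : ∀ i, x₀ * 16 ^ i < r i) (hhi : ∀ i, r i < x₀ * 16 ^ (i + 1)) (N : ℕ) :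
    (∀ k, k < N → (C a * ∏ i ∈ Finset.range N, (X - C (r i))).eval (x₀ * 16 ^ k) *
        (C a * ∏ i ∈ Finset.range N, (X - C (r i))).eval (x₀ * 16 ^ (k + 1)) < 0) ∧
    (∀ k, N ≤ k → 0 < a * (C a * ∏ i ∈ Finset.range N, (X - C (r i))).eval (x₀ * 16 ^ k)) := by
  induction N with
  | zero =>
    refine ⟨fun k hk => absurd hk (Nat.not_lt_zero _), fun k _ => ?_⟩
    simpa using mul_self_pos.2 ha
  | succ N ih =>
    obtain ⟨ih1, ih2⟩ := ih
    have hev : ∀ x : ℝ, (C a * ∏ i ∈ Finset.range (N + 1), (X - C (r i))).eval x =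
        (C a * ∏ i ∈ Finset.range N, (X - C (r i))).eval x * (x - r N) := by
      intro x
      rw [Finset.prod_range_succ, ← mul_assoc, eval_mul, eval_sub, eval_X, eval_C]
    have hmono : ∀ {k l : ℕ}, k ≤ l → x₀ * 16 ^ k ≤ x₀ * 16 ^ l := fun hkl =>
      mul_le_mul_of_nonneg_left (pow_le_pow_right₀ (by norm_num) hkl) hx.le
    refine ⟨fun k hk => ?_, fun k hk => ?_⟩
    · rw [hev, hev]
      rcases Nat.lt_succ_iff_lt_or_eq.1 hk with hk' | rfl
      · have hA := ih1 k hk'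
        have h1 : x₀ * 16 ^ k - r N < 0 := by linarith [hlo N, hmono hk'.le]
        have h2 : x₀ * 16 ^ (k + 1) - r N < 0 := by
          linarith [hlo N, hmono (show k + 1 ≤ N by omega)]
        have hP : 0 < (x₀ * 16 ^ k - r N) * (x₀ * 16 ^ (k + 1) - r N) := mul_pos_of_neg_of_neg h1 h2
        nlinarith
      · have hB1 := ih2 k le_rfl
        have hB2 := ih2 (k + 1) (Nat.le_succ k)
        have h1 : x₀ * 16 ^ k - r k < 0 := by linarith [hlo k]
        have h2 : 0 < x₀ * 16 ^ (k + 1) - r k := by linarith [hhi k]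
        have hAA : 0 < (C a * ∏ i ∈ Finset.range k, (X - C (r i))).eval (x₀ * 16 ^ k) *
            (C a * ∏ i ∈ Finset.range k, (X - C (r i))).eval (x₀ * 16 ^ (k + 1)) := by
          have hm := mul_pos hB1 hB2
          by_contra hc
          have hc' := le_of_not_gt hc
          nlinarith [mul_self_nonneg a, mul_nonpos_of_nonneg_of_nonpos (mul_self_nonneg a) hc']
        have hQ : (x₀ * 16 ^ k - r k) * (x₀ * 16 ^ (k + 1) - r k) < 0 := mul_neg_of_neg_of_pos h1 h2
        nlinarith
    · rw [hev, ← mul_assoc]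
      have hB := ih2 k (by omega)
      have h2 : 0 < x₀ * 16 ^ k - r N := by linarith [hhi N, hmono hk]
      exact mul_pos hB h2

/-- **Interlacing ⇒ alternation**: a split polynomial whose roots interlace a ratio-16 GP flips `N` times. -/
theorem alternatesGP_interlace (a x₀ : ℝ) (ha : a ≠ 0) (hx : 0 < x₀) (r : ℕ → ℝ)
    (hlo : ∀ i, x₀ * 16 ^ i < r i) (hhi : ∀ i, r i < x₀ * 16 ^ (i + 1)) (N : ℕ) :
    AlternatesGP 16 N (C a * ∏ i ∈ Finset.range N, (X - C (r i))) :=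
  ⟨x₀, hx.ne', (interlace_aux a x₀ ha hx r hlo hhi N).1⟩

/-- The calibration roots `2·16^i` interlace the GP `16^i` (`x₀ = 1`). -/
theorem calib_lo (i : ℕ) : (1 : ℝ) * 16 ^ i < 2 * 16 ^ i := by
  have : (0 : ℝ) < 16 ^ i := by positivity
  linarith

theorem calib_hi (i : ℕ) : (2 : ℝ) * 16 ^ i < 1 * 16 ^ (i + 1) := by
  have : (0 : ℝ) < 16 ^ i := by positivity
  rw [pow_succ]; linarith

/-- The split calibration polynomial `∏_{i<N}(X − 2·16^i)` flips `N` times. -/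
theorem alternatesGP_calib (N : ℕ) :
    AlternatesGP 16 N (∏ i ∈ Finset.range N, (X - C ((2 : ℝ) * 16 ^ i))) := by
  have h := alternatesGP_interlace 1 1 one_ne_zero one_pos (fun i => (2 : ℝ) * 16 ^ i) calib_lo calib_hi N
  simpa using h

theorem natDegree_calib (N : ℕ) :
    (∏ i ∈ Finset.range N, (X - C ((2 : ℝ) * 16 ^ i))).natDegree = N := by
  rw [natDegree_prod_of_monic _ _ (fun i _ => monic_X_sub_C _)]
  simp only [natDegree_X_sub_C, Finset.sum_const, Finset.card_range, smul_eq_mul, mul_one]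

/-- The two exponents `(0, 1)`. -/
def dTwo : Fin 2 → ℕ := ![0, 1]

/-- The diagonal design `S₀ = −diag(2·16^i)`, `S₁ = I` of size `m`. -/
def diagS (m : ℕ) : Fin 2 → Matrix (Fin m) (Fin m) ℝ :=
  ![Matrix.diagonal (fun i : Fin m => -((2 : ℝ) * 16 ^ (i : ℕ))), 1]

theorem diagS_isSymm (m : ℕ) (l : Fin 2) : (diagS m l).IsSymm := by
  fin_cases l
  · exact Matrix.isSymm_diagonal _
  · exact Matrix.isSymm_one

theorem pencil_diag (m : ℕ) :
    pencil dTwo (diagS m) = Matrix.diagonal (fun i : Fin m => X - C ((2 : ℝ) * 16 ^ (i : ℕ))) := by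
  ext i j
  simp only [pencil, Matrix.sum_apply, Matrix.smul_apply, Matrix.map_apply, Fin.sum_univ_two, dTwo,
    diagS, Matrix.cons_val_zero, Matrix.cons_val_one, Matrix.diagonal_apply,
    Matrix.one_apply, pow_zero, pow_one, smul_eq_mul, one_mul]
  by_cases h : i = j
  · simp [h, sub_eq_add_neg, add_comm]
  · simp [h]

theorem det_pencil_diag (m : ℕ) :
    (pencil dTwo (diagS m)).det = ∏ i ∈ Finset.range m, (X - C ((2 : ℝ) * 16 ^ i)) := by
  rw [pencil_diag, Matrix.det_diagonal]
  exact Fin.prod_univ_eq_prod_range (fun i => X - C ((2 : ℝ) * 16 ^ i)) m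

/-- **The sector is populated at every size**: `det (X·I − diag(2·16^i))` is hexadecadal. -/
theorem isHexadecadal_det_diagPencil (m : ℕ) : IsHexadecadal (pencil dTwo (diagS m)).det := by
  unfold IsHexadecadal
  rw [det_pencil_diag, natDegree_calib]
  exact alternatesGP_calib m

/-- **θ(m,2) ≥ m**: the row `θ(m,2) ≤ m` (`gpAltLawAt_two`) is sharp. -/
theorem not_gpAltLawAt_two_pred (m : ℕ) (hm : 1 ≤ m) : ¬ GPAltLawAt m 2 (m - 1) := by
  intro h
  have h1 := h dTwo (diagS m) (diagS_isSymm m) m (by rw [det_pencil_diag]; exact alternatesGP_calib m)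
  omega

/-- The one-by-one `K`-letter design carrying the coefficients of the calibration polynomial. -/
def coeffS (K : ℕ) : Fin K → Matrix (Fin 1) (Fin 1) ℝ :=
  fun l => (∏ i ∈ Finset.range (K - 1), (X - C ((2 : ℝ) * 16 ^ i))).coeff (l : ℕ) •
    (1 : Matrix (Fin 1) (Fin 1) ℝ)

theorem coeffS_isSymm (K : ℕ) (l : Fin K) : (coeffS K l).IsSymm :=
  (Matrix.isSymm_one).smul _

theorem det_pencil_coeffS (K : ℕ) (hK : 1 ≤ K) :
    (pencil (fun l : Fin K => (l : ℕ)) (coeffS K)).det =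
      ∏ i ∈ Finset.range (K - 1), (X - C ((2 : ℝ) * 16 ^ i)) := by
  rw [det_pencil_one_left]
  set p : ℝ[X] := ∏ i ∈ Finset.range (K - 1), (X - C ((2 : ℝ) * 16 ^ i)) with hp
  have hcoef : ∀ l : Fin K, coeffS K l 0 0 = p.coeff (l : ℕ) := fun l => by
    simp [coeffS, hp]
  simp_rw [hcoef]
  rw [Fin.sum_univ_eq_sum_range (fun l => C (p.coeff l) * X ^ l) K]
  have hdeg : p.natDegree + 1 = K := by rw [hp, natDegree_calib]; omega
  conv_rhs => rw [p.as_sum_range_C_mul_X_pow, hdeg]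

/-- **θ(1,K) ≥ K − 1**: the row `θ(1,K) ≤ K − 1` (`gpAltLawAt_one_left`) is sharp. -/
theorem not_gpAltLawAt_one_left_pred (K : ℕ) (hK : 2 ≤ K) : ¬ GPAltLawAt 1 K (K - 2) := by
  intro h
  have h1 := h (fun l : Fin K => (l : ℕ)) (coeffS K) (coeffS_isSymm K) (K - 1)
    (by rw [det_pencil_coeffS K (by omega)]; exact alternatesGP_calib (K - 1))
  omega

/-- **Calibration** (statement form, kernel-closed by `thetaCalibration`): the proved rows `θ(m,2) ≤ m` and
`θ(1,K) ≤ K − 1` are equalities, and the hexadecadal sector contains a symmetric pencil determinant of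
every size. -/
def ThetaCalibration : Prop :=
  (∀ m : ℕ, 1 ≤ m → ¬ GPAltLawAt m 2 (m - 1)) ∧ (∀ K : ℕ, 2 ≤ K → ¬ GPAltLawAt 1 K (K - 2)) ∧
    ∀ m : ℕ, ∃ (d : Fin 2 → ℕ) (S : Fin 2 → Matrix (Fin m) (Fin m) ℝ),
      (∀ l, (S l).IsSymm) ∧ IsHexadecadal (pencil d S).det ∧ (pencil d S).det.natDegree = m

theorem thetaCalibration : ThetaCalibration :=
  ⟨not_gpAltLawAt_two_pred, not_gpAltLawAt_one_left_pred, fun m =>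
    ⟨dTwo, diagS m, diagS_isSymm m, isHexadecadal_det_diagPencil m, by rw [det_pencil_diag, natDegree_calib]⟩⟩

/-! ## HEIGHT CURRENCY — the rung PROVED (linear form)

In the barrier's own constant-free / bounded-height world the sector law is a THEOREM.  Heart:
an integer-coefficient hexadecadal polynomial of degree `N` and height `≤ H` satisfies
`16^{N(N-1)} ≤ H^{N+1}·16^{N(N+1)/2}`, i.e. `16^{N(N-3)/2} ≤ H^{N+1}` — `N < ½·log₂H + 4`. -/

/-- Refined root extraction: one root in each of the `N` consecutive cells of the progression, with its cell. -/
theorem exists_gpRoots_of_alternatesGP {r : ℝ} (hr : 1 < r) {N : ℕ} {p : ℝ[X]}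
    (h : AlternatesGP r N p) :
    ∃ x₀ : ℝ, x₀ ≠ 0 ∧ ∃ c : ℕ → ℝ, ∀ k, k < N →
      p.IsRoot (c k) ∧ 0 < x₀ * c k ∧ |x₀| * r ^ k < |c k| ∧ |c k| < |x₀| * r ^ (k + 1) := by
  obtain ⟨x₀, hx0, hs⟩ := h
  refine ⟨x₀, hx0, ?_⟩
  have hr0 : 0 < r := by linarith
  have hpow : ∀ k : ℕ, r ^ k < r ^ (k + 1) := fun k => pow_lt_pow_right₀ hr (Nat.lt_succ_self k)
  rcases lt_or_gt_of_ne hx0 with hneg | hpos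
  · have hlt : ∀ k, x₀ * r ^ (k + 1) < x₀ * r ^ k := fun k => mul_lt_mul_of_neg_left (hpow k) hneg
    have hroot : ∀ k, k < N → ∃ c, x₀ * r ^ (k + 1) < c ∧ c < x₀ * r ^ k ∧ p.IsRoot c := fun k hk =>
      exists_root_Ioo_of_mul_neg p (hlt k) (by rw [mul_comm]; exact hs k hk)
    choose! c hc using hroot
    refine ⟨c, fun k hk => ?_⟩
    obtain ⟨h1, h2, h3⟩ := hc k hk
    have hck : c k < 0 := h2.trans (mul_neg_of_neg_of_pos hneg (pow_pos hr0 k))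
    refine ⟨h3, mul_pos_of_neg_of_neg hneg hck, ?_, ?_⟩
    · rw [abs_of_neg hneg, abs_of_neg hck]; linarith
    · rw [abs_of_neg hneg, abs_of_neg hck]; linarith
  · have hlt : ∀ k, x₀ * r ^ k < x₀ * r ^ (k + 1) := fun k => mul_lt_mul_of_pos_left (hpow k) hpos
    have hroot : ∀ k, k < N → ∃ c, x₀ * r ^ k < c ∧ c < x₀ * r ^ (k + 1) ∧ p.IsRoot c := fun k hk =>
      exists_root_Ioo_of_mul_neg p (hlt k) (hs k hk)
    choose! c hc using hroot
    refine ⟨c, fun k hk => ?_⟩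
    obtain ⟨h1, h2, h3⟩ := hc k hk
    have hck : 0 < c k := (mul_pos hpos (pow_pos hr0 k)).trans h1
    refine ⟨h3, mul_pos hpos hck, ?_, ?_⟩
    · rw [abs_of_pos hpos, abs_of_pos hck]; exact h1
    · rw [abs_of_pos hpos, abs_of_pos hck]; exact h2

/-- **HEART (height currency).**  An integer-coefficient hexadecadal polynomial of degree `N` and
coefficient height `≤ H` satisfies `16^{(N-1)N} ≤ H^{N+1} · 16^{∑_{k<N}(k+1)}`. -/
theorem height_ineq_of_isHexadecadal {f : ℝ[X]} (hf : IsHexadecadal f)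
    (hint : ∀ e, ∃ z : ℤ, f.coeff e = z) {H : ℝ} (hH1 : 1 ≤ H) (hH : ∀ e, |f.coeff e| ≤ H) :
    (16 : ℝ) ^ ((f.natDegree - 1) * f.natDegree)
      ≤ H ^ (f.natDegree + 1) * 16 ^ (∑ k ∈ Finset.range f.natDegree, (k + 1)) := by
  classical
  set N := f.natDegree with hN
  rcases Nat.eq_zero_or_pos N with hN0 | hNpos
  · rw [hN0]; simpa using hH1
  obtain ⟨x₀, hx0, c, hc⟩ := exists_gpRoots_of_alternatesGP (by norm_num : (1 : ℝ) < 16) hf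
  set t := |x₀| with ht
  have htpos : 0 < t := abs_pos.mpr hx0
  -- the cells are disjoint and increasing, so `c` is injective on `range N`
  have hmono : ∀ {k k'}, k < N → k' < N → k < k' → |c k| < |c k'| := by
    intro k k' hk hk' hkk
    have h1 := (hc k hk).2.2.2
    have h2 := (hc k' hk').2.2.1
    have h3 : t * 16 ^ (k + 1) ≤ t * 16 ^ k' :=
      mul_le_mul_of_nonneg_left (pow_le_pow_right₀ (by norm_num) hkk) htpos.le
    linarith
  have hinj : Set.InjOn c (Finset.range N : Set ℕ) := by
    intro k hk k' hk' hkk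
    have hkN : k < N := by simpa using hk
    have hkN' : k' < N := by simpa using hk'
    by_contra hne
    rcases lt_or_gt_of_ne hne with hlt | hlt
    · exact absurd (congrArg (|·|) hkk) (hmono hkN hkN' hlt).ne
    · exact absurd (congrArg (|·|) hkk).symm (hmono hkN' hkN hlt).ne
  have hf0 : f ≠ 0 := by
    rintro rfl
    simp at hN
    omega
  -- the `N` extracted roots are ALL the roots, without multiplicity
  set T : Finset ℝ := (Finset.range N).image c with hT
  have hTsub : T ⊆ f.roots.toFinset := by
    intro x hx
    obtain ⟨k, hk, rfl⟩ := Finset.mem_image.1 hx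
    rw [Multiset.mem_toFinset, mem_roots hf0]
    exact (hc k (Finset.mem_range.1 hk)).1
  have hTcard : T.card = N := by rw [hT, Finset.card_image_of_injOn hinj, Finset.card_range]
  have hcardle : Multiset.card f.roots ≤ N := card_roots' f
  have hTeq : T = f.roots.toFinset := Finset.eq_of_subset_of_card_le hTsub
    (by rw [hTcard]; exact (Multiset.toFinset_card_le _).trans hcardle)
  have hnodup : f.roots.Nodup := by
    rw [← Multiset.toFinset_card_eq_card_iff_nodup]
    refine le_antisymm (Multiset.toFinset_card_le _) ?_
    rw [← hTeq, hTcard]; exact hcardle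
  have hroots_card : Multiset.card f.roots = N := by
    rw [← Multiset.toFinset_card_of_nodup hnodup, ← hTeq, hTcard]
  have hroots_val : f.roots = T.val := by
    rw [hTeq, Multiset.toFinset_val, hnodup.dedup]
  -- factorisation `f = C a · ∏_{k<N} (X − c k)`
  set a := f.leadingCoeff with ha
  have hfac : f = C a * ∏ k ∈ Finset.range N, (X - C (c k)) := by
    have h := C_leadingCoeff_mul_prod_multiset_X_sub_C hroots_card
    rw [hroots_val] at h
    rw [← h]
    change C a * ∏ x ∈ T, (X - C x) = _
    rw [hT, Finset.prod_image hinj]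
  -- integrality of `a` and of `f.coeff 0`
  have ha0 : a ≠ 0 := leadingCoeff_ne_zero.mpr hf0
  have ha1 : 1 ≤ |a| := by
    obtain ⟨z, hz⟩ := hint N
    have hz' : a = z := hz
    have hz0 : z ≠ 0 := by rintro rfl; simp [hz'] at ha0
    rw [hz', ← Int.cast_abs]; exact_mod_cast Int.one_le_abs hz0
  have haH : |a| ≤ H := hH N
  -- (U) the top coefficient sees the largest root
  have hU : t * 16 ^ (N - 1) ≤ H := by
    have hcoeff : f.coeff (N - 1) = a * -(∑ k ∈ Finset.range N, c k) := by
      conv_lhs => rw [hfac]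
      rw [coeff_C_mul]
      congr 1
      have h := prod_X_sub_C_coeff_card_pred (Finset.range N) c (by simpa using hNpos)
      simpa using h
    have hsum : |x₀| * |c (N - 1)| ≤ |x₀| * |∑ k ∈ Finset.range N, c k| := by
      rw [← abs_mul, ← abs_mul, Finset.mul_sum,
        Finset.abs_sum_of_nonneg (fun k hk => (hc k (Finset.mem_range.1 hk)).2.1.le),
        abs_of_pos (hc (N - 1) (by omega)).2.1]
      exact Finset.single_le_sum (fun k hk => (hc k (Finset.mem_range.1 hk)).2.1.le)
        (Finset.mem_range.2 (by omega))
    have hsum' : |c (N - 1)| ≤ |∑ k ∈ Finset.range N, c k| := le_of_mul_le_mul_left hsum htpos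
    have hcell := (hc (N - 1) (by omega)).2.2.1
    calc t * 16 ^ (N - 1) ≤ |c (N - 1)| := hcell.le
      _ ≤ |∑ k ∈ Finset.range N, c k| := hsum'
      _ ≤ |a| * |∑ k ∈ Finset.range N, c k| := le_mul_of_one_le_left (abs_nonneg _) ha1
      _ = |f.coeff (N - 1)| := by rw [hcoeff, abs_mul, abs_neg]
      _ ≤ H := hH _
  -- (L) the constant coefficient is a nonzero integer, but the roots are small
  have hL : 1 ≤ H * (t ^ N * 16 ^ (∑ k ∈ Finset.range N, (k + 1))) := by
    have hcoeff : f.coeff 0 = a * ∏ k ∈ Finset.range N, (-(c k)) := by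
      conv_lhs => rw [hfac]
      rw [coeff_zero_eq_eval_zero, eval_mul, eval_C, eval_prod]
      congr 1
      refine Finset.prod_congr rfl fun k _ => ?_
      simp
    have hne : f.coeff 0 ≠ 0 := by
      rw [hcoeff]
      refine mul_ne_zero ha0 (Finset.prod_ne_zero_iff.2 fun k hk => ?_)
      have := (hc k (Finset.mem_range.1 hk)).2.1
      intro h0; rw [neg_eq_zero] at h0; rw [h0, mul_zero] at this; exact lt_irrefl _ this
    have hone : (1 : ℝ) ≤ |f.coeff 0| := by
      obtain ⟨z, hz⟩ := hint 0
      have hz0 : z ≠ 0 := by rintro rfl; simp [hz] at hne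
      rw [hz, ← Int.cast_abs]; exact_mod_cast Int.one_le_abs hz0
    have hprod : |∏ k ∈ Finset.range N, (-(c k))| ≤ t ^ N * 16 ^ (∑ k ∈ Finset.range N, (k + 1)) := by
      rw [Finset.abs_prod]
      calc ∏ k ∈ Finset.range N, |-(c k)| ≤ ∏ k ∈ Finset.range N, (t * 16 ^ (k + 1)) :=
            Finset.prod_le_prod (fun k _ => abs_nonneg _) fun k hk => by
              rw [abs_neg]; exact (hc k (Finset.mem_range.1 hk)).2.2.2.le
        _ = t ^ N * 16 ^ (∑ k ∈ Finset.range N, (k + 1)) := by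
            rw [Finset.prod_mul_distrib, Finset.prod_const, Finset.card_range,
              Finset.prod_pow_eq_pow_sum]
    calc (1 : ℝ) ≤ |f.coeff 0| := hone
      _ = |a| * |∏ k ∈ Finset.range N, (-(c k))| := by rw [hcoeff, abs_mul]
      _ ≤ H * (t ^ N * 16 ^ (∑ k ∈ Finset.range N, (k + 1))) :=
          mul_le_mul haH hprod (abs_nonneg _) (le_trans (by norm_num) hH1)
  -- combine: (t·16^{N-1})^N ≤ H^N and 1 ≤ H·t^N·16^S
  have hUN : t ^ N * 16 ^ ((N - 1) * N) ≤ H ^ N := by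
    rw [pow_mul, ← mul_pow]
    exact pow_le_pow_left₀ (by positivity) hU N
  have h16 : (0 : ℝ) ≤ 16 ^ (∑ k ∈ Finset.range N, (k + 1)) := by positivity
  calc (16 : ℝ) ^ ((N - 1) * N) = 16 ^ ((N - 1) * N) * 1 := by ring
    _ ≤ 16 ^ ((N - 1) * N) * (H * (t ^ N * 16 ^ (∑ k ∈ Finset.range N, (k + 1)))) :=
        mul_le_mul_of_nonneg_left hL (by positivity)
    _ = (H * 16 ^ (∑ k ∈ Finset.range N, (k + 1))) * (t ^ N * 16 ^ ((N - 1) * N)) := by ring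
    _ ≤ (H * 16 ^ (∑ k ∈ Finset.range N, (k + 1))) * H ^ N :=
        mul_le_mul_of_nonneg_left hUN (by positivity)
    _ = H ^ (N + 1) * 16 ^ (∑ k ∈ Finset.range N, (k + 1)) := by ring

/-! ### The pencil format: integrality and coefficient height `≤ m!·K^m·h^m` -/

/-- The integer pencil over `ℤ[X]`. -/
abbrev pencilInt {m K : ℕ} (d : Fin K → ℕ) (S : Fin K → Matrix (Fin m) (Fin m) ℤ) :
    Matrix (Fin m) (Fin m) ℤ[X] :=
  ∑ l, ((Polynomial.X : ℤ[X]) ^ d l) • (S l).map Polynomial.C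

theorem pencilZ_eq_map {m K : ℕ} (d : Fin K → ℕ) (S : Fin K → Matrix (Fin m) (Fin m) ℤ) :
    pencilZ d S = (pencilInt d S).map (Polynomial.map (Int.castRingHom ℝ)) := by
  ext i j
  simp [Matrix.sum_apply, Matrix.smul_apply, Matrix.map_apply, Polynomial.map_sum]

theorem det_pencilZ_eq_map {m K : ℕ} (d : Fin K → ℕ) (S : Fin K → Matrix (Fin m) (Fin m) ℤ) :
    (pencilZ d S).det = (pencilInt d S).det.map (Int.castRingHom ℝ) := by
  rw [pencilZ_eq_map, ← Polynomial.coe_mapRingHom, ← RingHom.mapMatrix_apply, RingHom.map_det]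

theorem coeff_det_pencilZ_int {m K : ℕ} (d : Fin K → ℕ) (S : Fin K → Matrix (Fin m) (Fin m) ℤ)
    (e : ℕ) : ∃ z : ℤ, (pencilZ d S).det.coeff e = z :=
  ⟨(pencilInt d S).det.coeff e, by rw [det_pencilZ_eq_map, Polynomial.coeff_map, eq_intCast]⟩

/-- Coefficient height of a pencil determinant: `|coeff_e det F| ≤ m!·K^m·h^m` when all entries are `≤ h`. -/
theorem abs_coeff_det_pencil_le {m K : ℕ} (d : Fin K → ℕ) (s : Fin K → Matrix (Fin m) (Fin m) ℝ)
    {h : ℝ} (h0 : 0 ≤ h) (hs : ∀ l i j, |s l i j| ≤ h) (e : ℕ) :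
    |(pencil d s).det.coeff e| ≤ (m.factorial : ℝ) * ((K : ℝ) ^ m * h ^ m) := by
  classical
  have hentry : ∀ i j, (pencil d s) i j = ∑ l, C (s l i j) * X ^ d l := by
    intro i j
    simp only [Matrix.sum_apply, Matrix.smul_apply, Matrix.map_apply, smul_eq_mul]
    exact Finset.sum_congr rfl fun l _ => mul_comm _ _
  rw [Matrix.det_apply', Polynomial.finsetSum_coeff]
  have hterm : ∀ σ : Equiv.Perm (Fin m),
      |((((Equiv.Perm.sign σ : ℤˣ) : ℤ) : ℝ[X]) * ∏ i, (pencil d s) (σ i) i).coeff e|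
        ≤ (K : ℝ) ^ m * h ^ m := by
    intro σ
    have habs : |((((Equiv.Perm.sign σ : ℤˣ) : ℤ) : ℝ[X]) * ∏ i, (pencil d s) (σ i) i).coeff e|
        = |(∏ i, (pencil d s) (σ i) i).coeff e| := by
      rcases Int.units_eq_one_or (Equiv.Perm.sign σ) with hσ | hσ
      · simp [hσ]
      · simp [hσ]
    rw [habs]
    simp_rw [hentry]
    rw [Fintype.prod_sum, Polynomial.finsetSum_coeff]
    refine (Finset.abs_sum_le_sum_abs _ _).trans ?_
    have hg : ∀ g : Fin m → Fin K, |(∏ i, (C (s (g i) (σ i) i) * X ^ d (g i))).coeff e| ≤ h ^ m := by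
      intro g
      rw [Finset.prod_mul_distrib, Finset.prod_pow_eq_pow_sum, ← map_prod C,
        Polynomial.coeff_C_mul_X_pow]
      split_ifs
      · rw [Finset.abs_prod]
        calc ∏ i, |s (g i) (σ i) i| ≤ ∏ _i : Fin m, h :=
              Finset.prod_le_prod (fun _ _ => abs_nonneg _) fun i _ => hs _ _ _
          _ = h ^ m := by simp
      · rw [abs_zero]; positivity
    calc ∑ g : Fin m → Fin K, |(∏ i, (C (s (g i) (σ i) i) * X ^ d (g i))).coeff e|
        ≤ ∑ _g : Fin m → Fin K, h ^ m := Finset.sum_le_sum fun g _ => hg g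
      _ = (K : ℝ) ^ m * h ^ m := by
          simp [Finset.sum_const, Finset.card_univ, Fintype.card_fin]
  calc |∑ σ : Equiv.Perm (Fin m),
          ((((Equiv.Perm.sign σ : ℤˣ) : ℤ) : ℝ[X]) * ∏ i, (pencil d s) (σ i) i).coeff e|
      ≤ ∑ σ : Equiv.Perm (Fin m),
          |((((Equiv.Perm.sign σ : ℤˣ) : ℤ) : ℝ[X]) * ∏ i, (pencil d s) (σ i) i).coeff e| :=
        Finset.abs_sum_le_sum_abs _ _
    _ ≤ ∑ _σ : Equiv.Perm (Fin m), (K : ℝ) ^ m * h ^ m := Finset.sum_le_sum fun σ _ => hterm σ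
    _ = (m.factorial : ℝ) * ((K : ℝ) ^ m * h ^ m) := by
        simp [Finset.sum_const, Finset.card_univ, Fintype.card_perm, Fintype.card_fin]

/-- **The height rung, linear form (PROVED).**  For INTEGER pencils of height `h` whose determinant is
hexadecadal of degree `N`:  `2N² ≤ m(⌊log₂(mKh)⌋+1)(N+1) + 6N`, i.e. `N ≤ ½·m(⌊log₂ mKh⌋+1) + O(1)` —
the sector law holds with exponential room in the constant-free / bounded-height world. -/
def HexHeightBound : Prop :=
  ∀ (m K h : ℕ) (d : Fin K → ℕ) (S : Fin K → Matrix (Fin m) (Fin m) ℤ),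
    (∀ l i j, (S l i j).natAbs ≤ h) → IsHexadecadal (pencilZ d S).det →
      2 * (pencilZ d S).det.natDegree * (pencilZ d S).det.natDegree
        ≤ m * (Nat.log 2 (m * K * h) + 1) * ((pencilZ d S).det.natDegree + 1)
          + 6 * (pencilZ d S).det.natDegree

theorem hexHeightBound : HexHeightBound := by
  intro m K h d S hS hhex
  set f := (pencilZ d S).det with hf
  set N := f.natDegree with hN
  set L := Nat.log 2 (m * K * h) with hL
  -- height: |coeff| ≤ m!·K^m·h^m ≤ (mKh)^m ≤ 2^{m(L+1)}
  have hsR : ∀ l i j, |((S l).map ((↑) : ℤ → ℝ)) i j| ≤ (h : ℝ) := by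
    intro l i j
    rw [Matrix.map_apply, ← Int.cast_abs, Int.abs_eq_natAbs]
    exact_mod_cast hS l i j
  have hHnat : m.factorial * (K ^ m * h ^ m) ≤ 2 ^ (m * (L + 1)) := by
    calc m.factorial * (K ^ m * h ^ m) ≤ m ^ m * (K ^ m * h ^ m) :=
          Nat.mul_le_mul_right _ (Nat.factorial_le_pow m)
      _ = (m * K * h) ^ m := by rw [mul_pow, mul_pow, mul_assoc]
      _ ≤ (2 ^ (L + 1)) ^ m := Nat.pow_le_pow_left (Nat.lt_pow_succ_log_self (by norm_num) _).le m
      _ = 2 ^ (m * (L + 1)) := by rw [← pow_mul, mul_comm]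
  have hH : ∀ e, |f.coeff e| ≤ (2 : ℝ) ^ (m * (L + 1)) := by
    intro e
    refine (abs_coeff_det_pencil_le d _ (Nat.cast_nonneg h) hsR e).trans ?_
    exact_mod_cast hHnat
  have heart := height_ineq_of_isHexadecadal hhex (coeff_det_pencilZ_int d S)
    (one_le_pow₀ (by norm_num)) hH
  -- rewrite everything as powers of 2 and compare exponents
  rw [← hN] at heart
  have h16 : (16 : ℝ) = 2 ^ 4 := by norm_num
  rw [h16, ← pow_mul, ← pow_mul, ← pow_mul, ← pow_add] at heart
  have hexp : 4 * ((N - 1) * N) ≤ m * (L + 1) * (N + 1) + 4 * ∑ k ∈ Finset.range N, (k + 1) :=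
    (pow_le_pow_iff_right₀ (by norm_num : (1 : ℝ) < 2)).1 heart
  have hsum : (∑ k ∈ Finset.range N, (k + 1)) * 2 = N * (N - 1) + 2 * N := by
    rw [Finset.sum_add_distrib, Finset.sum_const, Finset.card_range, smul_eq_mul, mul_one, add_mul,
      Finset.sum_range_id_mul_two]
    ring
  rcases Nat.eq_zero_or_pos N with hN0 | hNpos
  · simp [hN0]
  obtain ⟨n, hn⟩ : ∃ n, N = n + 1 := ⟨N - 1, by omega⟩
  rw [hn] at hexp hsum ⊢
  simp only [Nat.add_sub_cancel] at hexp hsum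
  nlinarith [hexp, hsum]

/-! ## EDGES: the crux is weaker than every door of record -/

/-- `MatrixDescartes → LinLogLaw 1` (verbatim from «amplify»). -/
theorem linLogLaw_of_matrixDescartes (h : MatrixDescartes) : LinLogLaw 1 := by
  intro c
  obtain ⟨K₀, hK⟩ := h c 1 (by norm_num)
  refine ⟨K₀, fun K m hK₀ hm d S hS => ?_⟩
  have h1 := hK K m hK₀ hm d S hS
  rw [pow_one] at h1
  rw [one_mul]
  exact h1

/-- `LinLogLaw A → GPLinLogLaw A` (flips ≤ roots). -/
theorem gpLinLogLaw_of_linLogLaw {A : ℕ} (h : LinLogLaw A) : GPLinLogLaw A := by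
  intro c
  obtain ⟨K₀, hK⟩ := h c
  exact ⟨K₀, fun K m hK₀ hm d S hS N hN =>
    (le_card_roots_of_alternatesGP (by norm_num) hN).trans (hK K m hK₀ hm d S hS)⟩

/-- `GPLinLogLaw A → HexLinLogLaw A` (roots ≤ degree = flips in the sector). -/
theorem hexLinLogLaw_of_gpLinLogLaw {A : ℕ} (h : GPLinLogLaw A) : HexLinLogLaw A := by
  intro c
  obtain ⟨K₀, hK⟩ := h c
  refine ⟨K₀, fun K m hK₀ hm d S hS hP => ?_⟩
  calc (pencil d S).det.roots.toFinset.card ≤ (pencil d S).det.natDegree :=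
        (Multiset.toFinset_card_le _).trans (card_roots' _)
    _ ≤ 2 ^ (A * (K * Nat.log 2 K)) := hK K m hK₀ hm d S hS _ hP

/-- `HypLinLogLaw A → HexLinLogLaw A` (the hexadecadal sector is a sub-sector of the real-rooted-simple one). -/
theorem hexLinLogLaw_of_hypLinLogLaw {A : ℕ} (h : HypLinLogLaw A) : HexLinLogLaw A := by
  intro c
  obtain ⟨K₀, hK⟩ := h c
  exact ⟨K₀, fun K m hK₀ hm d S hS hP =>
    hK K m hK₀ hm d S hS (card_roots_eq_natDegree_of_isHexadecadal hP)⟩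

/-- `LinLogLaw A → HypLinLogLaw A` (restriction). -/
theorem hypLinLogLaw_of_linLogLaw {A : ℕ} (h : LinLogLaw A) : HypLinLogLaw A := by
  intro c
  obtain ⟨K₀, hK⟩ := h c
  exact ⟨K₀, fun K m hK₀ hm d S hS _ => hK K m hK₀ hm d S hS⟩

/-- The chain from the crux of record: `MatrixDescartes → HexLinLogLaw 1`. -/
theorem hexLinLogLaw_of_matrixDescartes (h : MatrixDescartes) : ∃ A, HexLinLogLaw A :=
  ⟨1, hexLinLogLaw_of_gpLinLogLaw (gpLinLogLaw_of_linLogLaw (linLogLaw_of_matrixDescartes h))⟩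

/-! ## WITNESS MEMBERSHIP (PROVED): Tavenas' `V_ν` is hexadecadal -/

theorem natDegree_map_tavenasV (ν : ℕ) :
    ((tavenasV ν).map (Int.castRingHom ℝ)).natDegree = 2 ^ ν - 1 := by
  apply le_antisymm
  · have := natDegree_tavenasV_lt ν
    exact natDegree_map_le.trans (by omega)
  · calc 2 ^ ν - 1 = ((tavenasV ν).map (Int.castRingHom ℝ)).roots.toFinset.card :=
        (card_roots_toFinset_map_tavenasV ν).symm
      _ ≤ _ := (Multiset.toFinset_card_le _).trans (card_roots' _)

/-- `V_ν` flips sign `2^ν − 1` times along the ratio-16 progression `x_u` (tree `sign_eval_xPt`, Tavenas Lemme 3.36). -/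
theorem alternatesGP_map_tavenasV (ν : ℕ) :
    AlternatesGP 16 (2 ^ ν - 1) ((tavenasV ν).map (Int.castRingHom ℝ)) := by
  refine ⟨-(4 : ℝ) / 4 ^ (2 ^ ν), div_ne_zero (by norm_num) (by positivity), fun k hk => ?_⟩
  have h1 := sign_eval_xPt ν k (by omega)
  have h2 := sign_eval_xPt ν (k + 1) (by omega)
  rw [xPt_eq] at h1 h2
  rw [pow_succ] at h2
  rcases neg_one_pow_eq_or ℝ k with h | h <;> rw [h] at h1 h2 <;> nlinarith

/-- **`V_ν` lies in the hexadecadal sector.** -/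
theorem isHexadecadal_map_tavenasV (ν : ℕ) : IsHexadecadal ((tavenasV ν).map (Int.castRingHom ℝ)) := by
  unfold IsHexadecadal
  rw [natDegree_map_tavenasV]
  exact alternatesGP_map_tavenasV ν

/-- **X2 PROVED — the amplified witness in the sector at every rate** (master witness = tree
`Hyperbolic.exists_thetaPow`, restriction `= V_{a n ⌊log₂n⌋}` as a polynomial). -/
theorem hexWitnessPow (a : ℕ) : SectorWitnessPow IsHexadecadal a := by
  obtain ⟨Θ, d, hV, hres⟩ :=
    Summit.ValiantsHypothesis.ValiantsHypothesis.Theorems.LacunarySymmetroidMatrixDescartes.Hyperbolic.exists_thetaPow a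
  refine ⟨Θ, d, hV, 1, fun n hn => ?_⟩
  rw [hres n hn]
  refine ⟨isHexadecadal_map_tavenasV _, ?_⟩
  rw [card_roots_toFinset_map_tavenasV]
  have h1 : 1 ≤ 2 ^ (a * (n * Nat.log 2 n)) := Nat.one_le_two_pow
  omega

/-! ## GLUE (verbatim from LINE «amplify» v5; kernel-checked there and here) -/

/-- Det-exact symmetric transfer. -/
def DetTransfer : Prop :=
  ∀ (v : ℕ → ℕ) (f : ∀ n, MvPolynomial (Fin (v n)) ℝ),
    IsVPFamily (fun n => MvPolynomial.map (algebraMap ℝ ℂ) (f n)) →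
    ∀ d : (n : ℕ) → Fin (v n) → ℕ, ∃ c : ℕ, ∀ n : ℕ, ∃ m : ℕ, m ≤ 2 ^ ((Nat.log 2 n + c) ^ c) ∧
      ∃ S : Fin (v n + 1) → Matrix (Fin m) (Fin m) ℝ, (∀ l, (S l).IsSymm) ∧
        (pencil (Fin.cons (α := fun _ => ℕ) (0 : ℕ) (d n)) S).det =
          MvPolynomial.aeval (fun i => (Polynomial.X : ℝ[X]) ^ d n i) (f n)

theorem detTransfer_proof : DetTransfer := by
  intro v f hf d
  obtain ⟨⟨c₀, hc₀⟩, hrep⟩ :=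
    Summit.ValiantsHypothesis.ValiantsHypothesis.Theorems.LacunarySymmetroid.symmAffineRepr_of_isVPFamily_complex
      v f hf
  refine ⟨c₀ + 11, fun n => ?_⟩
  obtain ⟨B, hsymm, hB⟩ := hrep n
  refine ⟨4 * determinantalComplexity (f n) ^ 3 + 7,
    Summit.ValiantsHypothesis.ValiantsHypothesis.Theorems.LacunarySymmetroid.pencilTransfer_size_bound (hc₀ n),
    Fin.cons (α := fun _ => Matrix (Fin (4 * determinantalComplexity (f n) ^ 3 + 7))
      (Fin (4 * determinantalComplexity (f n) ^ 3 + 7)) ℝ) (constPart B) (fun i => LRPencil.coeffMat B i),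
    ?_, ?_⟩
  · refine Fin.cases ?_ (fun i => ?_)
    · rw [Fin.cons_zero]; exact hsymm.map _
    · rw [Fin.cons_succ]; exact hsymm.map _
  · rw [Summit.ValiantsHypothesis.ValiantsHypothesis.Theorems.LacunarySymmetroid.pencilDet_of_affine B hB.1 (d n),
      hB.2]

/-- Core lemma (verbatim from «amplify»): a real VP family in the sector with `≥ 2^{(2A+1)·n⌊log₂n⌋} − 1` roots
contradicts `SectorLinLogLaw P A`. -/
theorem false_of_vpFamily (P : ℝ[X] → Prop) (A : ℕ) (hlaw : SectorLinLogLaw P A)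
    (Θ : ∀ n : ℕ, MvPolynomial (Fin n) ℝ) (d : ∀ n : ℕ, Fin n → ℕ)
    (hVP : IsVPFamily (fun n => MvPolynomial.map (algebraMap ℝ ℂ) (Θ n))) (n₀ : ℕ)
    (hw : ∀ n : ℕ, n₀ ≤ n →
      P (MvPolynomial.aeval (fun i => (Polynomial.X : ℝ[X]) ^ d n i) (Θ n)) ∧
      2 ^ ((2 * A + 1) * (n * Nat.log 2 n)) ≤
        (MvPolynomial.aeval (fun i => (Polynomial.X : ℝ[X]) ^ d n i) (Θ n)).roots.toFinset.card + 1) :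
    False := by
  obtain ⟨c, hc⟩ := detTransfer_proof (fun n => n) Θ hVP d
  obtain ⟨K₀, hK⟩ := hlaw c
  obtain ⟨n, hn₀, hnK, hn4⟩ : ∃ n, n₀ ≤ n ∧ K₀ ≤ n ∧ 4 ≤ n := ⟨n₀ + K₀ + 4, by omega, by omega, by omega⟩
  obtain ⟨m, hm, S, hS, hdet⟩ := hc n
  obtain ⟨hP, h2⟩ := hw n hn₀
  set Z := (MvPolynomial.aeval (fun i => (Polynomial.X : ℝ[X]) ^ d n i) (Θ n)).roots.toFinset.card with hZ
  have hm' : m ≤ 2 ^ ((Nat.log 2 (n + 1) + c) ^ c) :=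
    hm.trans (Nat.pow_le_pow_right (by norm_num)
      (Nat.pow_le_pow_left (Nat.add_le_add_right (Nat.log_mono_right (Nat.le_succ n)) c) c))
  have hP' : P (pencil (Fin.cons (α := fun _ => ℕ) (0 : ℕ) (d n)) S).det := by rw [hdet]; exact hP
  have h1 := hK (n + 1) m (by omega) hm' (Fin.cons (α := fun _ => ℕ) (0 : ℕ) (d n)) S hS hP'
  rw [hdet] at h1
  set L := Nat.log 2 n with hL
  have hL2 : 2 ≤ L := by
    rw [hL]
    calc 2 = Nat.log 2 4 := by decide
      _ ≤ Nat.log 2 n := Nat.log_mono_right hn4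
  have hL' : Nat.log 2 (n + 1) ≤ L + 1 := by
    rw [hL]
    calc Nat.log 2 (n + 1) ≤ Nat.log 2 (n * 2) := Nat.log_mono_right (by omega)
      _ = Nat.log 2 n + 1 := Nat.log_mul_base (by norm_num) (by omega)
  have h3 : Z ≤ 2 ^ (A * ((n + 1) * (L + 1))) :=
    h1.trans (Nat.pow_le_pow_right (by norm_num) (Nat.mul_le_mul_left _ (Nat.mul_le_mul_left _ hL')))
  have h4 : 2 ^ ((2 * A + 1) * (n * L)) ≤ 2 ^ (A * ((n + 1) * (L + 1)) + 1) := by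
    have h1' : 1 ≤ 2 ^ (A * ((n + 1) * (L + 1))) := Nat.one_le_two_pow
    calc 2 ^ ((2 * A + 1) * (n * L)) ≤ Z + 1 := h2
      _ ≤ 2 ^ (A * ((n + 1) * (L + 1))) + 2 ^ (A * ((n + 1) * (L + 1))) := by omega
      _ = 2 ^ (A * ((n + 1) * (L + 1)) + 1) := by rw [pow_succ]; ring
  have h5 : (2 * A + 1) * (n * L) ≤ A * ((n + 1) * (L + 1)) + 1 :=
    (Nat.pow_le_pow_iff_right (by norm_num)).1 h4
  have hsum : (n + 1) * (L + 1) ≤ 2 * (n * L) := by nlinarith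
  have h6 : A * ((n + 1) * (L + 1)) ≤ 2 * (A * (n * L)) := by
    calc A * ((n + 1) * (L + 1)) ≤ A * (2 * (n * L)) := Nat.mul_le_mul_left _ hsum
      _ = 2 * (A * (n * L)) := by ring
  have h7 : (2 * A + 1) * (n * L) = 2 * (A * (n * L)) + n * L := by ring
  have h8 : 8 ≤ n * L := by nlinarith
  rw [h7] at h5
  generalize hQ : A * (n * L) = Q at h5 h6
  generalize hP0 : n * L = P0 at h5 h8
  omega

/-- Sector-generic deciding glue (verbatim from «amplify»). -/
theorem valiant_of_sectorLinLogLaw (P : ℝ[X] → Prop) (hlaw : ∃ A, SectorLinLogLaw P A)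
    (hW : ∀ a, SectorWitnessPow P a) : _root_.ValiantsHypothesis := by
  show Literature.Computability.AlgebraicComplexity.VP ℂ ≠ Literature.Computability.AlgebraicComplexity.VNP ℂ
  intro hEq
  obtain ⟨A, hA⟩ := hlaw
  obtain ⟨Θ, d, hVNP, n₀, hw⟩ := hW (2 * A + 1)
  have hVP : IsVPFamily (fun n => MvPolynomial.map (algebraMap ℝ ℂ) (Θ n)) := by
    have hmem := (mem_VNP_ofFintype_iff_holds _).2 hVNP
    rw [← hEq] at hmem
    exact (mem_VP_ofFintype_iff_holds _).1 hmem
  exact false_of_vpFamily P A hA Θ d hVP n₀ hw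

/-- **THE DECIDING GLUE OF THE LINE (kernel-checked; witness consumed PROVED)**:
`(∃ A, HexLinLogLaw A) → ValiantsHypothesis`. -/
theorem valiant_of_hexLinLogLaw (hlaw : ∃ A, HexLinLogLaw A) : _root_.ValiantsHypothesis :=
  valiant_of_sectorLinLogLaw IsHexadecadal hlaw hexWitnessPow

/-- **Composition to the EXISTING target by name**: the ONE law stub gives `ValiantsHypothesis`. -/
theorem valiantsHypothesis_of_stubs : _root_.ValiantsHypothesis :=
  valiant_of_hexLinLogLaw stub_hexLinLogLaw

/-! ## v9/v10 — THE W-TOWER IN THE KERNEL (val-idea-crit-4's refuting family of VERDICT #2, typed here)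

**v10 (this version): `WTower.not_hexRealZeroTauBound : ∀ c, ¬ HexRealZeroTauBound c` — SORRY-FREE**
(`#print axioms` = propext, Classical.choice, Quot.sound), via `WTower.wTowerSigns_all : ∀ k ≥ 1, WTowerSigns k`
(the Joukowski itinerary, § at the end: phase A error factor `∏(1+16^{-2m_s}) ≤ 1/(1 − 1/50)` by the chain
lemma / distinct small-time values / injective geometric sums; phase B `[2, 2.2]`; phase C self-reproducing;
parity decides).  So the Literature-currency twin of this line is now a kernel NEGATIVE: the hexadecadal sector
is inside the `TauRealZeros` barrier class, witnessed by an explicit family `W_k` with `τ(W_k) ≤ k²+12k+5` and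
`2^k` real roots, one per hexadecade `(16^i, 16^{i+1})`.

`H_0 = Y − 4Z`, `H_{j+1} = H_j(Y² + λ_j²Z², λ_j Y Z)`, `λ_j = 16^{2^j} = 2^{2^{j+2}}`, `W_k = H_k(X, 1) ∈ ℤ[X]`
(credit: val-idea-crit-4, W_tower_certificate.md a15d977173a2 — "Chebyshev doubling conjugated by the Joukowski
map, re-dilated per level").  PROVED below (no sorry):
* `WTower.tau_wPoly_le : τ(W_k) ≤ k² + 12k + 5` (tree's substitution bound `constantFreeComplexity_aeval_le`,
  one use of the level-`j` circuit; sharing would give `7k + O(1)` but is not needed);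
* `WTower.wPoly_monic : W_k monic ∧ natDegree W_k = 2^k` (descent on pairs, `desc_monic`);
* `WTower.eval_map_wPoly_grid : W_k(16^i) = Y − 4Z` for the INTEGER pair descent `natPair k (16^i, 1)`;
* `WTower.wTowerSigns_eight : WTowerSigns 8` — the EXACT grid-sign certificate (257 points, 8 levels,
  ≤ 2^18-bit integers) checked by the kernel (`decide +kernel`, GMP arithmetic);
* `WTower.isHexadecadal_wPoly`, `WTower.card_roots_wPoly : WTowerSigns k → W_k ∈ sector ∧ #roots = 2^k`;
* **`WTower.not_hexRealZeroTauBound_one : ¬ HexRealZeroTauBound 1`** (and `_zero`): `W_8` has 256 real roots,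
  one per hexadecade, and `τ(W_8) + 2 ≤ 167 < 256`;
* `WTower.not_hexRealZeroTauBound_of_wTowerSigns : (∀ k ≥ 1, WTowerSigns k) → ∀ c, ¬ HexRealZeroTauBound c` with
  `WTower.exists_level : ∃ k ≥ 1, (k²+12k+7)^c < 2^k` PROVED (`WTowerSigns 0` itself is false — `W_0(1) = −3` — hence the `k ≥ 1`) — so the critic's full verdict `∀ c` is reduced in the
  kernel to the all-`k` grid-sign statement `WTowerSigns k`, an elementary property of an explicit integer
  recursion (paper proof: Joukowski itinerary `θ ↦ g(θ − 2^{k−1−t})`, `g(a) = log₁₆(16^a + 16^{−a})` is 1-Lipschitz,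
  ideal itinerary `m ↦ |m − 2^{k−1−t}|` with each value `≥ 1` visited at most twice, total drift `< 0.01 < 0.275`
  = margin; numerically verified for `k ≤ 17` by this seat; NOT yet a kernel theorem). -/
namespace WTower

/-- Level-`j+1` substitution of the tower: `(Y, Z) ↦ (Y² + λ_j² Z², λ_j Y Z)` with
`λ_j = 16^(2^j) = 2^(2^(j+2))` (so `λ_j² = 2^(2^(j+3))`). -/
noncomputable def sig (j : ℕ) : Fin 2 → MvPolynomial (Fin 2) ℤ :=
  ![MvPolynomial.X 0 ^ 2 + MvPolynomial.C ((2:ℤ) ^ 2 ^ (j + 3)) * MvPolynomial.X 1 ^ 2,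
    MvPolynomial.C ((2:ℤ) ^ 2 ^ (j + 2)) * MvPolynomial.X 0 * MvPolynomial.X 1]

/-- The homogeneous tower `H_0 = Y − 4Z`, `H_{j+1} = H_j ∘ σ_j` (composition = ONE use of the
circuit for `H_j`: this is where the `τ = O(k²)` (with sharing `O(k)`) comes from). -/
noncomputable def wH : ℕ → MvPolynomial (Fin 2) ℤ
  | 0 => MvPolynomial.X 0 - MvPolynomial.C ((2:ℤ) ^ 2 ^ 1) * MvPolynomial.X 1
  | j + 1 => MvPolynomial.aeval (sig j) (wH j)

theorem tau_sig_zero (j : ℕ) : constantFreeComplexity (sig j 0) ≤ j + 8 := by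
  simp only [sig, Matrix.cons_val_zero]
  calc constantFreeComplexity (MvPolynomial.X 0 ^ 2
          + MvPolynomial.C ((2:ℤ) ^ 2 ^ (j + 3)) * MvPolynomial.X 1 ^ 2 : MvPolynomial (Fin 2) ℤ)
      ≤ constantFreeComplexity (MvPolynomial.X (0 : Fin 2) ^ 2 : MvPolynomial (Fin 2) ℤ)
        + constantFreeComplexity (MvPolynomial.C ((2:ℤ) ^ 2 ^ (j + 3)) * MvPolynomial.X 1 ^ 2 :
            MvPolynomial (Fin 2) ℤ) + 1 := constantFreeComplexity_add_le _ _
    _ ≤ (0 + 1) + ((j + 3 + 1) + (0 + 1) + 1) + 1 := by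
        gcongr
        · exact (constantFreeComplexity_sq_le _).trans (by simp)
        · exact (constantFreeComplexity_mul_le _ _).trans (by
            gcongr
            · exact constantFreeComplexity_C_two_pow_two_pow_le _
            · exact (constantFreeComplexity_sq_le _).trans (by simp))
    _ = j + 8 := by ring

theorem tau_sig_one (j : ℕ) : constantFreeComplexity (sig j 1) ≤ j + 5 := by
  simp only [sig, Matrix.cons_val_one]
  calc constantFreeComplexity (MvPolynomial.C ((2:ℤ) ^ 2 ^ (j + 2)) * MvPolynomial.X 0 * MvPolynomial.X 1 :
          MvPolynomial (Fin 2) ℤ)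
      ≤ constantFreeComplexity (MvPolynomial.C ((2:ℤ) ^ 2 ^ (j + 2)) * MvPolynomial.X 0 :
            MvPolynomial (Fin 2) ℤ)
        + constantFreeComplexity (MvPolynomial.X (1 : Fin 2) : MvPolynomial (Fin 2) ℤ) + 1 :=
          constantFreeComplexity_mul_le _ _
    _ ≤ ((j + 2 + 1) + 0 + 1) + 0 + 1 := by
        gcongr
        · exact (constantFreeComplexity_mul_le _ _).trans (by
            gcongr
            · exact constantFreeComplexity_C_two_pow_two_pow_le _
            · simp)
        · simp
    _ = j + 5 := by ring

/-- **`τ(H_k) ≤ k² + 12k + 5`** (sharing-free bookkeeping with the tree's substitution bound). -/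
theorem tau_wH_le (k : ℕ) : constantFreeComplexity (wH k) ≤ k ^ 2 + 12 * k + 5 := by
  induction k with
  | zero =>
    simp only [wH]
    calc constantFreeComplexity (MvPolynomial.X 0 - MvPolynomial.C ((2:ℤ) ^ 2 ^ 1) * MvPolynomial.X 1 :
            MvPolynomial (Fin 2) ℤ)
        ≤ constantFreeComplexity (MvPolynomial.X (0 : Fin 2) : MvPolynomial (Fin 2) ℤ)
          + constantFreeComplexity (MvPolynomial.C ((2:ℤ) ^ 2 ^ 1) * MvPolynomial.X 1 :
              MvPolynomial (Fin 2) ℤ) + 2 := constantFreeComplexity_sub_le _ _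
      _ ≤ 0 + ((1 + 1) + 0 + 1) + 2 := by
          gcongr
          · simp
          · exact (constantFreeComplexity_mul_le _ _).trans (by
              gcongr
              · exact constantFreeComplexity_C_two_pow_two_pow_le _
              · simp)
      _ = _ := by norm_num
  | succ k ih =>
    simp only [wH]
    calc constantFreeComplexity (MvPolynomial.aeval (sig k) (wH k))
        ≤ constantFreeComplexity (wH k) + ∑ i, constantFreeComplexity (sig k i) :=
          constantFreeComplexity_aeval_le _ _
      _ ≤ (k ^ 2 + 12 * k + 5) + ((k + 8) + (k + 5)) := by
          rw [Fin.sum_univ_two]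
          gcongr
          · exact tau_sig_zero k
          · exact tau_sig_one k
      _ = (k + 1) ^ 2 + 12 * (k + 1) + 5 := by ring

/-- The descent evaluator: `desc j Y Z = H_j(Y, Z)` computed top-down on pairs. -/
def desc {R : Type*} [CommRing R] : ℕ → R → R → R
  | 0, Y, Z => Y - (2:R) ^ 2 ^ 1 * Z
  | j + 1, Y, Z => desc j (Y ^ 2 + (2:R) ^ 2 ^ (j + 3) * Z ^ 2) ((2:R) ^ 2 ^ (j + 2) * Y * Z)

theorem aeval_wH {R : Type*} [CommRing R] (j : ℕ) (Y Z : R) :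
    MvPolynomial.aeval ![Y, Z] (wH j) = desc j Y Z := by
  induction j generalizing Y Z with
  | zero => simp [wH, desc]; norm_num
  | succ j ih =>
    simp only [wH, desc]
    rw [MvPolynomial.comp_aeval_apply]
    have : (fun i => MvPolynomial.aeval ![Y, Z] (sig j i)) =
        ![Y ^ 2 + (2:R) ^ 2 ^ (j + 3) * Z ^ 2, (2:R) ^ 2 ^ (j + 2) * Y * Z] := by
      funext i; fin_cases i <;> simp [sig, map_pow]
    rw [this, ih]

/-- **The W-tower** `W_k := H_k(X, 1) ∈ ℤ[X]`. -/
noncomputable def wPoly (k : ℕ) : ℤ[X] := MvPolynomial.aeval ![(X : ℤ[X]), 1] (wH k)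

theorem wPoly_eq_desc (k : ℕ) : wPoly k = desc k (X : ℤ[X]) 1 := aeval_wH k X 1

private theorem natDegree_two_pow_mul_le (n : ℕ) (p : ℤ[X]) :
    ((2:ℤ[X]) ^ n * p).natDegree ≤ p.natDegree := by
  have : ((2:ℤ[X]) ^ n) = C ((2:ℤ) ^ n) := by simp
  rw [this]; exact natDegree_C_mul_le _ _

theorem desc_monic (j : ℕ) : ∀ (D : ℕ) (Y Z : ℤ[X]), Y.Monic → Y.natDegree = D →
    Z.natDegree + 1 ≤ D → (desc j Y Z).Monic ∧ (desc j Y Z).natDegree = D * 2 ^ j := by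
  induction j with
  | zero =>
    intro D Y Z hY hD hZ
    simp only [desc]
    have hlt : ((2:ℤ[X]) ^ 2 ^ 1 * Z).degree < Y.degree := by
      apply degree_lt_degree
      calc ((2:ℤ[X]) ^ 2 ^ 1 * Z).natDegree ≤ Z.natDegree := natDegree_two_pow_mul_le _ _
        _ < Y.natDegree := by omega
    have hlt' : ((2:ℤ[X]) ^ 2 ^ 1 * Z).natDegree < Y.natDegree := by
      calc ((2:ℤ[X]) ^ 2 ^ 1 * Z).natDegree ≤ Z.natDegree := natDegree_two_pow_mul_le _ _
        _ < Y.natDegree := by omega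
    exact ⟨hY.sub_of_left hlt, by rw [natDegree_sub_eq_left_of_natDegree_lt hlt', hD]; ring⟩
  | succ j ih =>
    intro D Y Z hY hD hZ
    simp only [desc]
    have hY2 : (Y ^ 2).Monic := hY.pow 2
    have hY2d : (Y ^ 2).natDegree = 2 * D := by rw [hY.natDegree_pow, hD]
    have hlt : ((2:ℤ[X]) ^ 2 ^ (j + 3) * Z ^ 2).degree < (Y ^ 2).degree := by
      apply degree_lt_degree
      calc ((2:ℤ[X]) ^ 2 ^ (j + 3) * Z ^ 2).natDegree ≤ (Z ^ 2).natDegree := natDegree_two_pow_mul_le _ _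
        _ ≤ 2 * Z.natDegree := natDegree_pow_le
        _ < (Y ^ 2).natDegree := by rw [hY2d]; omega
    have hY' : (Y ^ 2 + (2:ℤ[X]) ^ 2 ^ (j + 3) * Z ^ 2).Monic := hY2.add_of_left hlt
    have hY'd : (Y ^ 2 + (2:ℤ[X]) ^ 2 ^ (j + 3) * Z ^ 2).natDegree = 2 * D := by
      rw [natDegree_add_eq_left_of_degree_lt hlt, hY2d]
    have hZ' : ((2:ℤ[X]) ^ 2 ^ (j + 2) * Y * Z).natDegree + 1 ≤ 2 * D := by
      calc ((2:ℤ[X]) ^ 2 ^ (j + 2) * Y * Z).natDegree + 1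
          ≤ (((2:ℤ[X]) ^ 2 ^ (j + 2) * Y).natDegree + Z.natDegree) + 1 := by
            gcongr; exact natDegree_mul_le
        _ ≤ (Y.natDegree + Z.natDegree) + 1 := by gcongr; exact natDegree_two_pow_mul_le _ _
        _ ≤ 2 * D := by omega
    obtain ⟨hm, hd⟩ := ih (2 * D) _ _ hY' hY'd hZ'
    exact ⟨hm, by rw [hd]; ring⟩

/-- `W_k` is monic of degree `2^k` (hence nonzero). -/
theorem wPoly_monic (k : ℕ) : (wPoly k).Monic ∧ (wPoly k).natDegree = 2 ^ k := by
  rw [wPoly_eq_desc]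
  have h := desc_monic k 1 (X : ℤ[X]) 1 monic_X natDegree_X (by simp)
  simpa using h

/-- Evaluation of `W_k` over `ℝ` is the descent. -/
theorem eval_map_wPoly (k : ℕ) (x : ℝ) :
    ((wPoly k).map (Int.castRingHom ℝ)).eval x = desc k x 1 := by
  rw [Polynomial.eval_map, ← algebraMap_int_eq, ← Polynomial.aeval_def, wPoly,
    MvPolynomial.comp_aeval_apply]
  have : (fun i => Polynomial.aeval x ((![(X : ℤ[X]), 1] : Fin 2 → ℤ[X]) i)) = ![x, 1] := by
    funext i; fin_cases i <;> simp
  rw [this, aeval_wH]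

/-- The integer pair descent used for the exact sign certificate. -/
def natPair : ℕ → ℕ × ℕ → ℕ × ℕ
  | 0, p => p
  | j + 1, p => natPair j (p.1 ^ 2 + 2 ^ 2 ^ (j + 3) * p.2 ^ 2, 2 ^ 2 ^ (j + 2) * p.1 * p.2)

theorem desc_natCast (j : ℕ) : ∀ (Y Z : ℕ),
    desc j (Y : ℝ) (Z : ℝ) = ((natPair j (Y, Z)).1 : ℝ) - 4 * ((natPair j (Y, Z)).2 : ℝ) := by
  induction j with
  | zero => intro Y Z; simp only [desc, natPair]; norm_num
  | succ j ih =>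
    intro Y Z
    simp only [desc, natPair]
    rw [show ((Y:ℝ) ^ 2 + (2:ℝ) ^ 2 ^ (j + 3) * (Z:ℝ) ^ 2) = ((Y ^ 2 + 2 ^ 2 ^ (j + 3) * Z ^ 2 : ℕ) : ℝ) by
          push_cast; ring,
        show ((2:ℝ) ^ 2 ^ (j + 2) * (Y:ℝ) * (Z:ℝ)) = ((2 ^ 2 ^ (j + 2) * Y * Z : ℕ) : ℝ) by
          push_cast; ring, ih]

/-- `W_k(16^i) > 0` for even `i`, `< 0` for odd `i` (`i ≤ 2^k`): the grid-sign statement, as a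
property of the integer descent. -/
def WTowerSigns (k : ℕ) : Prop :=
  ∀ i : ℕ, i < 2 ^ k + 1 →
    (i % 2 = 0 → 4 * (natPair k (16 ^ i, 1)).2 < (natPair k (16 ^ i, 1)).1) ∧
    (i % 2 = 1 → (natPair k (16 ^ i, 1)).1 < 4 * (natPair k (16 ^ i, 1)).2)

/-- Boolean certificate checker (run by the kernel with GMP arithmetic). -/
def signOK (k i : ℕ) : Bool :=
  if i % 2 = 0 then decide (4 * (natPair k (16 ^ i, 1)).2 < (natPair k (16 ^ i, 1)).1)
  else decide ((natPair k (16 ^ i, 1)).1 < 4 * (natPair k (16 ^ i, 1)).2)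

def certOK (k : ℕ) : Bool := (List.range (2 ^ k + 1)).all (signOK k)

theorem wTowerSigns_of_certOK {k : ℕ} (h : certOK k = true) : WTowerSigns k := by
  intro i hi
  have hs : signOK k i = true := by
    unfold certOK at h; rw [List.all_eq_true] at h; exact h i (List.mem_range.mpr hi)
  unfold signOK at hs
  split_ifs at hs with hpar
  · exact ⟨fun _ => of_decide_eq_true hs, fun h1 => by omega⟩
  · exact ⟨fun h0 => absurd h0 hpar, fun _ => of_decide_eq_true hs⟩

/-- **Exact kernel certificate, `k = 8`**: `W_8` alternates strictly in sign on `16^0, …, 16^256`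
(257 evaluations of an 8-level integer recursion on ≤ 2^18-bit numbers). -/
theorem wTowerSigns_eight : WTowerSigns 8 := wTowerSigns_of_certOK (by decide +kernel)

theorem eval_map_wPoly_grid (k i : ℕ) :
    ((wPoly k).map (Int.castRingHom ℝ)).eval ((16:ℝ) ^ i) =
      ((natPair k (16 ^ i, 1)).1 : ℝ) - 4 * ((natPair k (16 ^ i, 1)).2 : ℝ) := by
  rw [eval_map_wPoly, show ((16:ℝ) ^ i) = ((16 ^ i : ℕ) : ℝ) by push_cast; ring,
    show (1:ℝ) = ((1:ℕ) : ℝ) by simp, desc_natCast]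

/-- Grid signs ⇒ `W_k` is hexadecadal (base point `x₀ = 1`). -/
theorem isHexadecadal_wPoly {k : ℕ} (h : WTowerSigns k) :
    IsHexadecadal ((wPoly k).map (Int.castRingHom ℝ)) := by
  obtain ⟨hmon, hdeg⟩ := wPoly_monic k
  have hdeg' : ((wPoly k).map (Int.castRingHom ℝ)).natDegree = 2 ^ k := by
    rw [hmon.natDegree_map, hdeg]
  unfold IsHexadecadal
  rw [hdeg']
  refine ⟨1, one_ne_zero, fun i hi => ?_⟩
  rw [one_mul, one_mul, eval_map_wPoly_grid, eval_map_wPoly_grid]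
  obtain ⟨h0, h1⟩ := h i (by omega)
  obtain ⟨h0', h1'⟩ := h (i + 1) (by omega)
  rcases Nat.mod_two_eq_zero_or_one i with hp | hp
  · have ha := h0 hp
    have hb := h1' (by omega)
    apply mul_neg_of_pos_of_neg
    · have : ((4 * (natPair k (16 ^ i, 1)).2 : ℕ) : ℝ) < ((natPair k (16 ^ i, 1)).1 : ℝ) := by
        exact_mod_cast ha
      push_cast at this; linarith
    · have : (((natPair k (16 ^ (i+1), 1)).1 : ℕ) : ℝ) < ((4 * (natPair k (16 ^ (i+1), 1)).2 : ℕ) : ℝ) := by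
        exact_mod_cast hb
      push_cast at this; linarith
  · have ha := h1 hp
    have hb := h0' (by omega)
    apply mul_neg_of_neg_of_pos
    · have : (((natPair k (16 ^ i, 1)).1 : ℕ) : ℝ) < ((4 * (natPair k (16 ^ i, 1)).2 : ℕ) : ℝ) := by
        exact_mod_cast ha
      push_cast at this; linarith
    · have : ((4 * (natPair k (16 ^ (i+1), 1)).2 : ℕ) : ℝ) < ((natPair k (16 ^ (i+1), 1)).1 : ℝ) := by
        exact_mod_cast hb
      push_cast at this; linarith

/-- `τ` of `W_k` rendered as in the barrier file: `≤ k² + 12k + 5`. -/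
theorem symm_wPoly (k : ℕ) :
    (MvPolynomial.uniqueAlgEquiv ℤ (Fin 1)).symm (wPoly k) =
      MvPolynomial.aeval ![MvPolynomial.X 0, 1] (wH k) := by
  rw [AlgEquiv.symm_apply_eq, wPoly]
  rw [show (MvPolynomial.uniqueAlgEquiv ℤ (Fin 1)) (MvPolynomial.aeval ![MvPolynomial.X 0, 1] (wH k))
      = ((MvPolynomial.uniqueAlgEquiv ℤ (Fin 1) : MvPolynomial (Fin 1) ℤ →ₐ[ℤ] ℤ[X]))
          (MvPolynomial.aeval ![MvPolynomial.X 0, 1] (wH k)) from rfl,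
    MvPolynomial.comp_aeval_apply]
  have : (fun i => (MvPolynomial.uniqueAlgEquiv ℤ (Fin 1) : MvPolynomial (Fin 1) ℤ →ₐ[ℤ] ℤ[X])
      ((![MvPolynomial.X 0, 1] : Fin 2 → MvPolynomial (Fin 1) ℤ) i)) = ![(X : ℤ[X]), 1] := by
    funext i; fin_cases i <;> simp [MvPolynomial.uniqueAlgEquiv_apply]
  rw [this]

theorem tau_wPoly_le (k : ℕ) :
    constantFreeComplexity ((MvPolynomial.uniqueAlgEquiv ℤ (Fin 1)).symm (wPoly k)) ≤
      k ^ 2 + 12 * k + 5 := by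
  rw [symm_wPoly]
  calc constantFreeComplexity (MvPolynomial.aeval ![MvPolynomial.X 0, 1] (wH k))
      ≤ constantFreeComplexity (wH k)
        + ∑ i, constantFreeComplexity ((![MvPolynomial.X 0, 1] : Fin 2 → MvPolynomial (Fin 1) ℤ) i) :=
        constantFreeComplexity_aeval_le _ _
    _ ≤ (k ^ 2 + 12 * k + 5) + 0 := by
        gcongr
        · exact tau_wH_le k
        · simp [Fin.sum_univ_two]

/-- Grid signs at level `k` ⇒ `W_k` has exactly `2^k` distinct real roots. -/
theorem card_roots_wPoly {k : ℕ} (h : WTowerSigns k) :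
    ((wPoly k).map (Int.castRingHom ℝ)).roots.toFinset.card = 2 ^ k := by
  rw [card_roots_eq_natDegree_of_isHexadecadal (isHexadecadal_wPoly h),
    (wPoly_monic k).1.natDegree_map, (wPoly_monic k).2]

/-- **`HexRealZeroTauBound 1` is FALSE** (kernel-checked): `W_8` is hexadecadal with `256`
real roots and `τ(W_8) + 2 ≤ 167`. -/
theorem not_hexRealZeroTauBound_one : ¬ HexRealZeroTauBound 1 := by
  intro h
  have h1 := h (wPoly 8) (wPoly_monic 8).1.ne_zero (isHexadecadal_wPoly wTowerSigns_eight)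
  rw [card_roots_wPoly wTowerSigns_eight, pow_one] at h1
  have h2 := tau_wPoly_le 8
  omega

theorem not_hexRealZeroTauBound_zero : ¬ HexRealZeroTauBound 0 := by
  intro h
  have h1 := h (wPoly 8) (wPoly_monic 8).1.ne_zero (isHexadecadal_wPoly wTowerSigns_eight)
  rw [card_roots_wPoly wTowerSigns_eight, pow_zero] at h1
  omega

/-- Polynomial vs exponential: the level at which the tower beats exponent `c`. -/
theorem exists_level (c : ℕ) : ∃ k : ℕ, 1 ≤ k ∧ (k ^ 2 + 12 * k + 5 + 2) ^ c < 2 ^ k := by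
  refine ⟨2 ^ (2 * c + 5), Nat.one_le_two_pow, ?_⟩
  set t := 2 * c + 5 with ht
  have hk : (32:ℕ) ≤ 2 ^ t := by
    calc (32:ℕ) = 2 ^ 5 := by norm_num
      _ ≤ 2 ^ t := Nat.pow_le_pow_right (by norm_num) (by omega)
  have hpoly : (2 ^ t) ^ 2 + 12 * 2 ^ t + 5 + 2 ≤ 2 ^ (2 * t + 1) := by
    have : 2 ^ (2 * t + 1) = 2 * (2 ^ t) ^ 2 := by ring
    rw [this]; nlinarith
  have hexp : (2 * t + 1) * c < 2 ^ t := by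
    have hc : c < 2 ^ c := Nat.lt_two_pow_self
    have h4 : 2 ^ t = 32 * (2 ^ c) ^ 2 := by rw [ht]; ring
    rw [h4]; nlinarith
  calc ((2 ^ t) ^ 2 + 12 * 2 ^ t + 5 + 2) ^ c ≤ (2 ^ (2 * t + 1)) ^ c := Nat.pow_le_pow_left hpoly c
    _ = 2 ^ ((2 * t + 1) * c) := by rw [← pow_mul]
    _ < 2 ^ 2 ^ t := Nat.pow_lt_pow_right (by norm_num) hexp

/-- **All-`k` grid signs (`k ≥ 1`; note `WTowerSigns 0` is false: `W_0 = X − 4 < 0` at `16^0`) ⇒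
`HexRealZeroTauBound c` fails for EVERY `c`.** -/
theorem not_hexRealZeroTauBound_of_wTowerSigns (h : ∀ k, 1 ≤ k → WTowerSigns k) (c : ℕ) :
    ¬ HexRealZeroTauBound c := by
  intro hc
  obtain ⟨k, hk1, hk⟩ := exists_level c
  have h1 := hc (wPoly k) (wPoly_monic k).1.ne_zero (isHexadecadal_wPoly (h k hk1))
  rw [card_roots_wPoly (h k hk1)] at h1
  have h2 : (constantFreeComplexity ((MvPolynomial.uniqueAlgEquiv ℤ (Fin 1)).symm (wPoly k)) + 2) ^ c
      ≤ (k ^ 2 + 12 * k + 5 + 2) ^ c := Nat.pow_le_pow_left (by have := tau_wPoly_le k; omega) c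
  omega

/-! ### The Joukowski itinerary — `WTowerSigns k` for ALL `k ≥ 1` (v10)

Write `v_t = Y_t / Z_t` for the ratio along the substitution tower read top-down
(`natPair k p₀ = pIt k i k`, largest dilation `16^(2^(k-1))` first).  Then `v_0 = 16^i` and
`v_{t+1} = J(v_t / 16^{n_t})·` with `J(w) = w + 1/w`, `n_t = 2^(k-1-t)`; the sign of `W_k(16^i)` is the
sign of `v_k − 4`.  The integer ("ideal") itinerary `m_0 = i`, `m_{t+1} = |m_t − n_t|` shadows `v_t`:
PHASE A (`m_1..m_t ≥ 1`): `v_t ∈ 16^{m_t}·[1/F_t, F_t]` with `F_t = ∏ (1 + 16^{-2 m_s}) ≤ 1/(1 − S_t)` and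
`S_t = ∑ 16^{-2 m_s} ≤ 1/50` — because SMALL times (`4 m_s < n_{s-1}`) carry pairwise DISTINCT values
(chain lemma `m_{s+r} = n_{s+r-1} − m_s`), and big times have `m_s ≥ k − 1 − s`; both sums are then
injective geometric sums `≤ 1/255` (+ `2/256` for the last two levels).  PHASE B (first `T` with
`m_T = n_T`): `v_{T+1} = J(w)`, `w ∈ [1/F, F]`, so `v_{T+1} ∈ [2, 2.2]`.  PHASE C (after B):
`v_t ∈ [16^{n_{t-1}}/2.2, 16^{n_{t-1}}/2 + 2.3·16^{-n_{t-1}}]` is self-reproducing.  Parity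
(`m_t ≡ i (mod 2)` for `t ≤ k−1`, `m_{k-1} ≤ 2`, `n_{k-1} = 1`) decides which phase is live at level `k`:
`i` odd ⇒ B at the last level ⇒ `v_k ≤ 2.2 < 4`; `i` even ⇒ A through `k` (`v_k ≥ 16/1.1`) or C
(`v_k ≥ 16/2.2`) ⇒ `v_k > 4`. -/

section Itinerary
variable (k i : ℕ)

/-- scale exponent at level `t`: `n_t = 2^(k-1-t)` (the level-`t` dilation is `16^(n_t)`). -/
def nS (t : ℕ) : ℕ := 2 ^ (k - 1 - t)

/-- integer (ideal) itinerary: `m_0 = i`, `m_{t+1} = |m_t − n_t|`. -/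
def mIt : ℕ → ℕ
  | 0 => i
  | t + 1 => Nat.dist (mIt t) (nS k t)

/-- real ratio itinerary: `v_0 = 16^i`, `v_{t+1} = v_t / 16^{n_t} + 16^{n_t} / v_t`. -/
noncomputable def vIt : ℕ → ℝ
  | 0 => (16:ℝ) ^ i
  | t + 1 => vIt t / (16:ℝ) ^ nS k t + (16:ℝ) ^ nS k t / vIt t

/-- forward integer pair sequence (`natPair` read top-down). -/
def pIt : ℕ → ℕ × ℕ
  | 0 => (16 ^ i, 1)
  | t + 1 => ((pIt t).1 ^ 2 + 2 ^ 2 ^ (k - 1 - t + 3) * (pIt t).2 ^ 2,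
      2 ^ 2 ^ (k - 1 - t + 2) * (pIt t).1 * (pIt t).2)

end Itinerary

variable {k i : ℕ}

theorem natPair_pIt (t : ℕ) (ht : t ≤ k) :
    natPair k (16 ^ i, 1) = natPair (k - t) (pIt k i t) := by
  induction t with
  | zero => rfl
  | succ t ih =>
    rw [ih (by omega), show k - t = (k - 1 - t) + 1 by omega, natPair]
    congr 1
    omega

theorem natPair_eq_pIt (k i : ℕ) : natPair k (16 ^ i, 1) = pIt k i k := by
  rw [natPair_pIt (k := k) (i := i) k le_rfl, Nat.sub_self]; rfl

theorem two_pow_two_pow_add_two (j : ℕ) : (2:ℕ) ^ 2 ^ (j + 2) = 16 ^ 2 ^ j := by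
  rw [show (16:ℕ) = 2 ^ 4 by norm_num, ← pow_mul]; congr 1; rw [pow_add]; norm_num; ring

theorem two_pow_two_pow_add_three (j : ℕ) : (2:ℕ) ^ 2 ^ (j + 3) = (16 ^ 2 ^ j) ^ 2 := by
  rw [← two_pow_two_pow_add_two, ← pow_mul]; congr 1

theorem pIt_pos (t : ℕ) : 0 < (pIt k i t).1 ∧ 0 < (pIt k i t).2 := by
  induction t with
  | zero => simp [pIt]
  | succ t ih =>
    simp only [pIt]
    exact ⟨Nat.add_pos_left (pow_pos ih.1 2) _,
      Nat.mul_pos (Nat.mul_pos (pow_pos (by norm_num) _) ih.1) ih.2⟩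

theorem vIt_pos (t : ℕ) : 0 < vIt k i t := by
  induction t with
  | zero => simp [vIt]
  | succ t ih => simp only [vIt]; positivity

theorem vIt_eq_div (t : ℕ) : vIt k i t = ((pIt k i t).1 : ℝ) / ((pIt k i t).2 : ℝ) := by
  induction t with
  | zero => simp [vIt, pIt]
  | succ t ih =>
    obtain ⟨h1, h2⟩ := pIt_pos (k := k) (i := i) t
    simp only [vIt, pIt]
    rw [ih, two_pow_two_pow_add_three, two_pow_two_pow_add_two]
    have hL : (0:ℝ) < (16:ℝ) ^ 2 ^ (k - 1 - t) := by positivity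
    have h1' : (0:ℝ) < ((pIt k i t).1 : ℝ) := by exact_mod_cast h1
    have h2' : (0:ℝ) < ((pIt k i t).2 : ℝ) := by exact_mod_cast h2
    push_cast
    simp only [nS]
    field_simp

/-- the sign of `Y − 4Z` at level `k` is the sign of `v_k − 4`. -/
theorem sign_iff (k i : ℕ) :
    (4 * (natPair k (16 ^ i, 1)).2 < (natPair k (16 ^ i, 1)).1 ↔ 4 < vIt k i k) ∧
    ((natPair k (16 ^ i, 1)).1 < 4 * (natPair k (16 ^ i, 1)).2 ↔ vIt k i k < 4) := by
  rw [natPair_eq_pIt, vIt_eq_div]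
  obtain ⟨h1, h2⟩ := pIt_pos (k := k) (i := i) k
  have h2' : (0:ℝ) < ((pIt k i k).2 : ℝ) := by exact_mod_cast h2
  constructor
  · rw [lt_div_iff₀ h2']; exact_mod_cast Iff.rfl
  · rw [div_lt_iff₀ h2']; exact_mod_cast Iff.rfl

/-! #### combinatorics of the integer itinerary -/

theorem nS_succ (t : ℕ) (ht : t + 2 ≤ k) : nS k t = 2 * nS k (t + 1) := by
  simp only [nS]; rw [show k - 1 - t = (k - 1 - (t + 1)) + 1 by omega, pow_succ]; ring

theorem nS_last (hk : 1 ≤ k) : nS k (k - 1) = 1 := by simp [nS]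

theorem nS_pos (t : ℕ) : 1 ≤ nS k t := Nat.one_le_two_pow

theorem nS_anti {t t' : ℕ} (h : t ≤ t') : nS k t' ≤ nS k t := by
  simp only [nS]; exact Nat.pow_le_pow_right (by norm_num) (by omega)

theorem mIt_le (hk : 1 ≤ k) (hi : i ≤ 2 ^ k) (t : ℕ) (ht : t + 1 ≤ k) : mIt k i t ≤ 2 * nS k t := by
  induction t with
  | zero => simp only [mIt, nS]; rw [show k = (k - 1 - 0) + 1 by omega, pow_succ] at hi; omega
  | succ t ih =>
    have h := ih (by omega)
    simp only [mIt]
    have h2 := nS_succ (k := k) t (by omega)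
    rw [Nat.dist.eq_def]; omega

theorem mIt_mod_two (hk : 1 ≤ k) (t : ℕ) (ht : t + 1 ≤ k) : mIt k i t % 2 = i % 2 := by
  induction t with
  | zero => rfl
  | succ t ih =>
    have h := ih (by omega)
    simp only [mIt]
    have h2 := nS_succ (k := k) t (by omega)
    rw [Nat.dist.eq_def]; omega

/-- the chain after a visit to `μ = m_s`: `m_{s+r} = n_{s+r-1} − μ` as long as `μ ≤ n_{s+r-1}`. -/
theorem chain (s : ℕ) : ∀ r : ℕ, 1 ≤ r → s + r ≤ k → mIt k i s ≤ nS k (s + r - 1) →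
    mIt k i (s + r) = nS k (s + r - 1) - mIt k i s := by
  intro r
  induction r with
  | zero => intro h; omega
  | succ r ih =>
    intro _ hsr hle
    rcases Nat.eq_zero_or_pos r with rfl | hr
    · simp only [Nat.add_zero, add_tsub_cancel_right] at hle ⊢
      show Nat.dist (mIt k i s) (nS k s) = _
      rw [Nat.dist.eq_def]; omega
    · have hle' : mIt k i s ≤ nS k (s + r - 1) := hle.trans (nS_anti (by omega))
      have h := ih hr (by omega) hle'
      have hd : nS k (s + r - 1) = 2 * nS k (s + r) := by
        have := nS_succ (k := k) (s + r - 1) (by omega)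
        rwa [show s + r - 1 + 1 = s + r by omega] at this
      have e1 : s + (r + 1) - 1 = s + r := by omega
      rw [e1] at hle ⊢
      show Nat.dist (mIt k i (s + r)) (nS k (s + r)) = nS k (s + r) - mIt k i s
      rw [h, hd, Nat.dist.eq_def]; omega

/-- a time `s ≥ 1` is SMALL if `4 m_s < n_{s-1}` (i.e. `m_s < n_{s+1}`). -/
def Small (k i s : ℕ) : Prop := 4 * mIt k i s < nS k (s - 1)

/-- values at small times are pairwise distinct (a later small time cannot repeat a value). -/
theorem mIt_ne_of_small {s s' : ℕ} (hss : s < s') (hs' : s' ≤ k) (hsm : Small k i s') :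
    mIt k i s ≠ mIt k i s' := by
  intro heq
  unfold Small at hsm
  have hle : mIt k i s ≤ nS k (s + (s' - s) - 1) := by
    rw [show s + (s' - s) - 1 = s' - 1 by omega]; omega
  have h := chain (k := k) (i := i) s (s' - s) (by omega) (by omega) hle
  rw [show s + (s' - s) = s' by omega] at h
  omega

/-! #### phase A: the multiplicative error factor -/

/-- per-step relative error `16^(−2 m_s)`. -/
noncomputable def xA (k i s : ℕ) : ℝ := 1 / ((16:ℝ) ^ mIt k i s) ^ 2
/-- accumulated error factor `F_t = ∏_{1 ≤ s ≤ t} (1 + 16^(−2 m_s))`. -/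
noncomputable def FA (k i t : ℕ) : ℝ := ∏ s ∈ Finset.Icc 1 t, (1 + xA k i s)
/-- accumulated error sum `S_t = ∑_{1 ≤ s ≤ t} 16^(−2 m_s)`. -/
noncomputable def SA (k i t : ℕ) : ℝ := ∑ s ∈ Finset.Icc 1 t, xA k i s

theorem xA_pos (s : ℕ) : 0 < xA k i s := by unfold xA; positivity

theorem xA_eq (s : ℕ) : xA k i s = (1 / 256 : ℝ) ^ mIt k i s := by
  unfold xA; rw [← pow_mul, one_div_pow, show (256:ℝ) = 16 ^ 2 by norm_num, ← pow_mul, mul_comm]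

theorem FA_succ (t : ℕ) : FA k i (t + 1) = FA k i t * (1 + xA k i (t + 1)) := by
  unfold FA; rw [Finset.prod_Icc_succ_top (by omega)]

theorem SA_succ (t : ℕ) : SA k i (t + 1) = SA k i t + xA k i (t + 1) := by
  unfold SA; rw [Finset.sum_Icc_succ_top (by omega)]

theorem one_le_FA (t : ℕ) : 1 ≤ FA k i t := by
  induction t with
  | zero => simp [FA]
  | succ t ih => rw [FA_succ]; have := xA_pos (k := k) (i := i) (t + 1); nlinarith

theorem SA_nonneg (t : ℕ) : 0 ≤ SA k i t :=
  Finset.sum_nonneg fun s _ => (xA_pos (k := k) (i := i) s).le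

theorem FA_le (t : ℕ) (h : SA k i t < 1) : FA k i t ≤ 1 / (1 - SA k i t) := by
  induction t with
  | zero => simp [FA, SA]
  | succ t ih =>
    rw [SA_succ] at h ⊢
    rw [FA_succ]
    have hx := xA_pos (k := k) (i := i) (t + 1)
    have hS := SA_nonneg (k := k) (i := i) t
    have h' : SA k i t < 1 := by linarith
    have ih' := ih h'
    have hF := one_le_FA (k := k) (i := i) t
    rw [le_div_iff₀ (by linarith)] at ih' ⊢
    have hF0 : (0:ℝ) ≤ FA k i t := by linarith
    nlinarith [mul_nonneg (mul_nonneg hF0 hx.le) hS, mul_nonneg hF0 (mul_nonneg hx.le hx.le)]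

/-- the abstract Joukowski step: big term `a ∈ [E/F, E·F]`, small term `0 < b ≤ F/E`. -/
theorem joukowski_bound (E F a b : ℝ) (hE : 0 < E) (hF : 1 ≤ F) (ha : E / F ≤ a) (ha' : a ≤ E * F)
    (hb : 0 < b) (hb' : b ≤ F / E) :
    E / (F * (1 + 1 / E ^ 2)) ≤ a + b ∧ a + b ≤ E * (F * (1 + 1 / E ^ 2)) := by
  constructor
  · calc E / (F * (1 + 1 / E ^ 2)) ≤ E / F := by
          apply div_le_div_of_nonneg_left hE.le (by positivity)
          have : 0 ≤ F * (1 / E ^ 2) := by positivity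
          nlinarith
      _ ≤ a + b := by linarith
  · have : E * (F * (1 + 1 / E ^ 2)) = E * F + F / E := by field_simp
    rw [this]; linarith

/-- **Phase A invariant**: while `m_1, …, m_t ≥ 1`, `v_t ∈ 16^(m_t) · [1/F_t, F_t]`. -/
theorem phaseA_bounds (t : ℕ) (h : ∀ s, 1 ≤ s → s ≤ t → 1 ≤ mIt k i s) :
    (16:ℝ) ^ mIt k i t / FA k i t ≤ vIt k i t ∧ vIt k i t ≤ (16:ℝ) ^ mIt k i t * FA k i t := by
  induction t with
  | zero => simp [FA, vIt, mIt]
  | succ t ih =>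
    have hprev := ih (fun s h1 h2 => h s h1 (by omega))
    have hm1 : 1 ≤ mIt k i (t + 1) := h (t + 1) (by omega) le_rfl
    have hF := one_le_FA (k := k) (i := i) t
    have hv := vIt_pos (k := k) (i := i) t
    rw [FA_succ]
    set F := FA k i t with hFdef
    set v := vIt k i t with hvdef
    set L : ℝ := (16:ℝ) ^ nS k t with hLdef
    set E : ℝ := (16:ℝ) ^ mIt k i (t + 1) with hEdef
    have hL : 0 < L := by positivity
    have hE : 0 < E := by positivity
    have hx : xA k i (t + 1) = 1 / E ^ 2 := rfl
    have hv' : vIt k i (t + 1) = v / L + L / v := rfl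
    rw [hx, hv']
    have hmdef : mIt k i (t + 1) = Nat.dist (mIt k i t) (nS k t) := rfl
    rcases lt_or_gt_of_ne (show mIt k i t ≠ nS k t by
      intro heq; rw [hmdef, heq, Nat.dist_self] at hm1; omega) with hlt | hgt
    · -- m_t < n_t : the big term is L / v
      have hn : nS k t = mIt k i (t + 1) + mIt k i t := by rw [hmdef, Nat.dist.eq_def]; omega
      set M : ℝ := (16:ℝ) ^ mIt k i t with hMdef
      have hM : 0 < M := by positivity
      have hF0 : 0 < F := by linarith
      have hLEM : L = E * M := by rw [hLdef, hEdef, hMdef, hn, pow_add]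
      obtain ⟨h1, h2⟩ := hprev
      have h1' : M ≤ v * F := (div_le_iff₀ hF0).mp h1
      have hb1 : E / F ≤ L / v := by
        rw [hLEM, div_le_div_iff₀ hF0 hv]; nlinarith [mul_le_mul_of_nonneg_left h2 hE.le]
      have hb2 : L / v ≤ E * F := by
        rw [hLEM, div_le_iff₀ hv]; nlinarith [mul_le_mul_of_nonneg_left h1' hE.le]
      have hs1 : 0 < v / L := by positivity
      have hs2 : v / L ≤ F / E := by
        rw [hLEM, div_le_div_iff₀ (by positivity) hE]; nlinarith [mul_le_mul_of_nonneg_left h2 hE.le]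
      have := joukowski_bound E F (L / v) (v / L) hE hF hb1 hb2 hs1 hs2
      have hcomm : v / L + L / v = L / v + v / L := add_comm _ _
      rw [hcomm]; exact this
    · -- n_t < m_t : the big term is v / L
      have hm : mIt k i t = mIt k i (t + 1) + nS k t := by rw [hmdef, Nat.dist.eq_def]; omega
      have hMEL : (16:ℝ) ^ mIt k i t = E * L := by rw [hm, pow_add]
      rw [hMEL] at hprev
      obtain ⟨h1, h2⟩ := hprev
      have hF0 : 0 < F := by linarith
      have h1' : E * L ≤ v * F := (div_le_iff₀ hF0).mp h1
      have hb1 : E / F ≤ v / L := by rw [div_le_div_iff₀ hF0 hL]; exact h1'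
      have hb2 : v / L ≤ E * F := by
        rw [div_le_iff₀ hL]; have : E * L * F = E * F * L := by ring
        linarith
      have hs1 : 0 < L / v := by positivity
      have hs2 : L / v ≤ F / E := by
        rw [div_le_div_iff₀ hv hE]; have : L * E = E * L := mul_comm _ _
        have : F * v = v * F := mul_comm _ _
        linarith
      exact joukowski_bound E F (v / L) (L / v) hE hF hb1 hb2 hs1 hs2

/-! #### the error sum is small: `S_t ≤ 1/50` -/

theorem geomInj_le (T : Finset ℕ) (a : ℕ → ℕ) (hinj : ∀ x ∈ T, ∀ y ∈ T, a x = a y → x = y)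
    (h1 : ∀ s ∈ T, 1 ≤ a s) : ∑ s ∈ T, (1 / 256 : ℝ) ^ a s ≤ 1 / 255 := by
  rw [← Finset.sum_image (f := fun μ => (1 / 256 : ℝ) ^ μ) hinj]
  have hsub : T.image a ⊆ Finset.Ico 1 (T.sup a + 1) := by
    intro μ hμ
    rw [Finset.mem_image] at hμ
    obtain ⟨s, hs, rfl⟩ := hμ
    rw [Finset.mem_Ico]
    exact ⟨h1 s hs, Nat.lt_succ_of_le (Finset.le_sup (f := a) hs)⟩
  calc ∑ μ ∈ T.image a, (1 / 256 : ℝ) ^ μ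
      ≤ ∑ μ ∈ Finset.Ico 1 (T.sup a + 1), (1 / 256 : ℝ) ^ μ :=
        Finset.sum_le_sum_of_subset_of_nonneg hsub (fun _ _ _ => by positivity)
    _ ≤ (1 / 256 : ℝ) ^ 1 / (1 - 1 / 256) := geom_sum_Ico_le_of_lt_one (by norm_num) (by norm_num)
    _ = 1 / 255 := by norm_num

instance (k i s : ℕ) : Decidable (Small k i s) := by unfold Small; infer_instance

theorem SA_le (hk : 1 ≤ k) (hi : i ≤ 2 ^ k) (t : ℕ) (ht : t ≤ k)
    (h : ∀ s, 1 ≤ s → s ≤ t → 1 ≤ mIt k i s) : SA k i t ≤ 1 / 50 := by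
  have hx : ∀ s, xA k i s = (1 / 256 : ℝ) ^ mIt k i s := xA_eq
  unfold SA
  simp_rw [hx]
  set T := Finset.Icc 1 t with hT
  have hmem : ∀ s ∈ T, 1 ≤ s ∧ s ≤ t := fun s hs => by simpa [hT] using hs
  rw [← Finset.sum_filter_add_sum_filter_not T (fun s => Small k i s)]
  -- small part
  have hsmall : ∑ s ∈ T.filter (fun s => Small k i s), (1 / 256 : ℝ) ^ mIt k i s ≤ 1 / 255 := by
    apply geomInj_le
    · intro x hx y hy hxy
      rw [Finset.mem_filter] at hx hy
      rcases lt_trichotomy x y with hlt | heq | hgt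
      · exact absurd hxy (mIt_ne_of_small hlt (by linarith [(hmem y hy.1).2]) hy.2)
      · exact heq
      · exact absurd hxy.symm (mIt_ne_of_small hgt (by linarith [(hmem x hx.1).2]) hx.2)
    · intro s hs
      rw [Finset.mem_filter] at hs
      exact h s (hmem s hs.1).1 (hmem s hs.1).2
  -- big part, early times `s ≤ k - 2`
  set B := T.filter (fun s => ¬ Small k i s) with hB
  rw [← Finset.sum_filter_add_sum_filter_not B (fun s => s + 2 ≤ k)]
  have hbig1 : ∑ s ∈ B.filter (fun s => s + 2 ≤ k), (1 / 256 : ℝ) ^ mIt k i s ≤ 1 / 255 := by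
    calc ∑ s ∈ B.filter (fun s => s + 2 ≤ k), (1 / 256 : ℝ) ^ mIt k i s
        ≤ ∑ s ∈ B.filter (fun s => s + 2 ≤ k), (1 / 256 : ℝ) ^ (k - 1 - s) := by
          apply Finset.sum_le_sum
          intro s hs
          rw [Finset.mem_filter, hB, Finset.mem_filter] at hs
          obtain ⟨⟨hsT, hns⟩, hs2⟩ := hs
          have hs1 := (hmem s hsT).1
          unfold Small at hns
          push Not at hns
          have hn : nS k (s - 1) = 4 * 2 ^ (k - 2 - s) := by
            simp only [nS]; rw [show k - 1 - (s - 1) = (k - 2 - s) + 2 by omega, pow_add]; norm_num; ring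
          have hlt := Nat.lt_two_pow_self (n := k - 2 - s)
          apply pow_le_pow_of_le_one (by norm_num) (by norm_num)
          omega
      _ ≤ 1 / 255 := by
          apply geomInj_le
          · intro x hx y hy hxy
            simp only [Finset.mem_filter] at hx hy
            omega
          · intro s hs
            simp only [Finset.mem_filter] at hs
            omega
  -- big part, the last two times `s ∈ {k-1, k}`
  have hbig2 : ∑ s ∈ B.filter (fun s => ¬ (s + 2 ≤ k)), (1 / 256 : ℝ) ^ mIt k i s ≤ 2 * (1 / 256) := by
    have hcard : (B.filter (fun s => ¬ (s + 2 ≤ k))).card ≤ 2 := by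
      calc (B.filter (fun s => ¬ (s + 2 ≤ k))).card ≤ ({k - 1, k} : Finset ℕ).card := by
            apply Finset.card_le_card
            intro s hs
            simp only [Finset.mem_filter, hB] at hs
            have := (hmem s hs.1.1).2
            simp only [Finset.mem_insert, Finset.mem_singleton]
            omega
        _ ≤ 2 := Finset.card_le_two
    calc ∑ s ∈ B.filter (fun s => ¬ (s + 2 ≤ k)), (1 / 256 : ℝ) ^ mIt k i s
        ≤ ∑ s ∈ B.filter (fun s => ¬ (s + 2 ≤ k)), (1 / 256 : ℝ) := by
          apply Finset.sum_le_sum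
          intro s hs
          simp only [Finset.mem_filter, hB] at hs
          have h1s := h s (hmem s hs.1.1).1 (hmem s hs.1.1).2
          calc (1 / 256 : ℝ) ^ mIt k i s ≤ (1 / 256 : ℝ) ^ 1 :=
                pow_le_pow_of_le_one (by norm_num) (by norm_num) h1s
            _ = 1 / 256 := by norm_num
      _ = (B.filter (fun s => ¬ (s + 2 ≤ k))).card * (1 / 256) := by
          rw [Finset.sum_const, nsmul_eq_mul]
      _ ≤ 2 * (1 / 256) := by
          have : ((B.filter (fun s => ¬ (s + 2 ≤ k))).card : ℝ) ≤ 2 := by exact_mod_cast hcard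
          nlinarith
  linarith

theorem FA_le_const (hk : 1 ≤ k) (hi : i ≤ 2 ^ k) (t : ℕ) (ht : t ≤ k)
    (h : ∀ s, 1 ≤ s → s ≤ t → 1 ≤ mIt k i s) : FA k i t ≤ 11 / 10 := by
  have hS := SA_le hk hi t ht h
  have := FA_le (k := k) (i := i) t (by linarith)
  calc FA k i t ≤ 1 / (1 - SA k i t) := this
    _ ≤ 1 / (1 - 1 / 50) := by
        apply div_le_div_of_nonneg_left (by norm_num) (by norm_num) (by linarith)
    _ ≤ 11 / 10 := by norm_num

/-! #### phases B and C -/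

theorem stepB (L F v : ℝ) (hL : 0 < L) (hF : F ≤ 11 / 10) (hlo : L / F ≤ v)
    (hhi : v ≤ L * F) (hv : 0 < v) :
    2 ≤ v / L + L / v ∧ v / L + L / v ≤ 22 / 10 := by
  have hF0 : 0 < F := by
    by_contra h0; push Not at h0
    have : L * F ≤ 0 := by nlinarith
    linarith
  rw [div_le_iff₀ hF0] at hlo
  rw [div_add_div _ _ hL.ne' hv.ne', le_div_iff₀ (by positivity), div_le_iff₀ (by positivity)]
  have hvL : v ≤ 11 / 10 * L := by nlinarith [mul_le_mul_of_nonneg_left hF hL.le]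
  have hLv : L ≤ 11 / 10 * v := by nlinarith [mul_le_mul_of_nonneg_left hF hv.le]
  constructor
  · nlinarith [sq_nonneg (v - L)]
  · have h1 : v * v ≤ (11 / 10 * L) * v := mul_le_mul_of_nonneg_right hvL hv.le
    have h2 : L * L ≤ (11 / 10 * v) * L := mul_le_mul_of_nonneg_right hLv hL.le
    nlinarith

theorem stepCstart (L v : ℝ) (hL : 16 ≤ L) (h2 : 2 ≤ v) (h22 : v ≤ 22 / 10) :
    L / (22 / 10) ≤ v / L + L / v ∧ v / L + L / v ≤ L / 2 + (23 / 10) / L := by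
  have hL0 : 0 < L := by linarith
  have hv : 0 < v := by linarith
  constructor
  · have h1 : L / (22 / 10) ≤ L / v := div_le_div_of_nonneg_left hL0.le hv h22
    have h2 : 0 ≤ v / L := by positivity
    linarith
  · have h1 : L / v ≤ L / 2 := div_le_div_of_nonneg_left hL0.le (by norm_num) h2
    have h3 : v / L ≤ (23 / 10) / L := div_le_div_of_nonneg_right (by linarith) hL0.le
    linarith

theorem stepC (L v : ℝ) (hL : 16 ≤ L) (hlo : L ^ 2 / (22 / 10) ≤ v)
    (hhi : v ≤ L ^ 2 / 2 + (23 / 10) / L ^ 2) :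
    L / (22 / 10) ≤ v / L + L / v ∧ v / L + L / v ≤ L / 2 + (23 / 10) / L := by
  have hL0 : 0 < L := by linarith
  have hv : 0 < v := lt_of_lt_of_le (by positivity) hlo
  constructor
  · have h1 : L / (22 / 10) ≤ v / L := by
      rw [le_div_iff₀ hL0]
      have : L ^ 2 / (22 / 10) = L / (22 / 10) * L := by ring
      linarith
    have h2 : 0 ≤ L / v := by positivity
    linarith
  · have h1 : v / L ≤ L / 2 + (23 / 10) / L ^ 3 := by
      have := div_le_div_of_nonneg_right hhi hL0.le
      have e : (L ^ 2 / 2 + (23 / 10) / L ^ 2) / L = L / 2 + (23 / 10) / L ^ 3 := by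
        field_simp
      linarith
    have h2 : L / v ≤ (22 / 10) / L := by
      have := div_le_div_of_nonneg_left hL0.le (by positivity : (0:ℝ) < L ^ 2 / (22 / 10)) hlo
      have e : L / (L ^ 2 / (22 / 10)) = (22 / 10) / L := by field_simp
      linarith
    have hL2 : (256:ℝ) ≤ L ^ 2 := by nlinarith
    have h3 : (23 / 10) / L ^ 3 ≤ (1 / 10) / L := by
      rw [div_le_div_iff₀ (by positivity) hL0]
      have : L ^ 3 = L * L ^ 2 := by ring
      nlinarith [mul_le_mul_of_nonneg_left hL2 hL0.le]
    have h4 : (1 / 10) / L + (22 / 10) / L = (23 / 10) / L := by ring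
    linarith

/-! #### the final sign theorem -/

theorem phaseA_of_noB (t : ℕ) (ht : t ≤ k)
    (hne : ∀ s, s < t → mIt k i s ≠ nS k s) : ∀ s, 1 ≤ s → s ≤ t → 1 ≤ mIt k i s := by
  intro s hs1 hst
  obtain ⟨s', rfl⟩ : ∃ s', s = s' + 1 := ⟨s - 1, by omega⟩
  have h := hne s' (by omega)
  show 1 ≤ Nat.dist (mIt k i s') (nS k s')
  rw [Nat.dist.eq_def]; omega

theorem vIt_final (hk : 1 ≤ k) (hi : i ≤ 2 ^ k) :
    (i % 2 = 1 → vIt k i k < 4) ∧ (i % 2 = 0 → 4 < vIt k i k) := by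
  by_cases hP : ∃ t, t + 1 ≤ k ∧ mIt k i t = nS k t
  · -- phase A ends at the first `T` with `m_T = n_T`
    let T := Nat.find hP
    have hT : T + 1 ≤ k ∧ mIt k i T = nS k T := Nat.find_spec hP
    have hmin : ∀ t, t < T → ¬ (t + 1 ≤ k ∧ mIt k i t = nS k t) := fun t ht => Nat.find_min hP ht
    have hA : ∀ s, 1 ≤ s → s ≤ T → 1 ≤ mIt k i s :=
      phaseA_of_noB T (by omega) (fun s hs heq => hmin s hs ⟨by omega, heq⟩)
    have hb := phaseA_bounds (k := k) (i := i) T hA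
    have hFle := FA_le_const hk hi T (by omega) hA
    have hpar := mIt_mod_two (k := k) (i := i) hk T hT.1
    rw [hT.2] at hb hpar
    set L : ℝ := (16:ℝ) ^ nS k T with hLdef
    have hL : 0 < L := by positivity
    have hvT := vIt_pos (k := k) (i := i) T
    have hB : 2 ≤ vIt k i (T + 1) ∧ vIt k i (T + 1) ≤ 22 / 10 :=
      stepB L (FA k i T) (vIt k i T) hL hFle hb.1 hb.2 hvT
    rcases Nat.eq_or_lt_of_le hT.1 with hTk | hTk
    · -- B at the last level: `i` odd, `v_k ∈ [2, 2.2]`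
      have hn1 : nS k T = 1 := by rw [← nS_last (k := k) hk]; congr 1; omega
      rw [hn1] at hpar
      rw [hTk] at hB
      exact ⟨fun _ => by linarith [hB.2], fun h0 => by omega⟩
    · -- B before the last level: `i` even, then phase C keeps `v` large
      have hn2 := nS_succ (k := k) T (by omega)
      rw [hn2] at hpar
      have hev : i % 2 = 0 := by omega
      refine ⟨fun h1 => by omega, fun _ => ?_⟩
      have hC : ∀ t, T + 2 ≤ t → t ≤ k →
          (16:ℝ) ^ nS k (t - 1) / (22 / 10) ≤ vIt k i t ∧
          vIt k i t ≤ (16:ℝ) ^ nS k (t - 1) / 2 + (23 / 10) / (16:ℝ) ^ nS k (t - 1) := by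
        intro t ht htk
        induction t, ht using Nat.le_induction with
        | base =>
          have hL' : (16:ℝ) ≤ (16:ℝ) ^ nS k (T + 1) := by
            calc (16:ℝ) = 16 ^ 1 := by norm_num
              _ ≤ 16 ^ nS k (T + 1) := pow_le_pow_right₀ (by norm_num) (nS_pos _)
          have := stepCstart ((16:ℝ) ^ nS k (T + 1)) (vIt k i (T + 1)) hL' hB.1 hB.2
          rw [show T + 2 - 1 = T + 1 by omega]
          exact this
        | succ t ht ih =>
          have ih' := ih (by omega)
          rw [show t + 1 - 1 = t by omega]
          have hsq : (16:ℝ) ^ nS k (t - 1) = ((16:ℝ) ^ nS k t) ^ 2 := by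
            rw [← pow_mul]; congr 1
            have := nS_succ (k := k) (t - 1) (by omega)
            rw [show t - 1 + 1 = t by omega] at this; omega
          rw [hsq] at ih'
          have hL' : (16:ℝ) ≤ (16:ℝ) ^ nS k t := by
            calc (16:ℝ) = 16 ^ 1 := by norm_num
              _ ≤ 16 ^ nS k t := pow_le_pow_right₀ (by norm_num) (nS_pos _)
          exact stepC ((16:ℝ) ^ nS k t) (vIt k i t) hL' ih'.1 ih'.2
      have hk' := hC k (by omega) le_rfl
      rw [nS_last hk] at hk'
      norm_num at hk'
      linarith [hk'.1]
  · -- no B: phase A all the way, `i` even, `v_k ≥ 16/1.1`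
    push Not at hP
    have hA : ∀ s, 1 ≤ s → s ≤ k → 1 ≤ mIt k i s :=
      phaseA_of_noB k le_rfl (fun s hs heq => hP s (by omega) heq)
    have hb := phaseA_bounds (k := k) (i := i) k hA
    have hFle := FA_le_const hk hi k le_rfl hA
    have hF1 := one_le_FA (k := k) (i := i) k
    have hpar := mIt_mod_two (k := k) (i := i) hk (k - 1) (by omega)
    have hle := mIt_le (k := k) (i := i) hk hi (k - 1) (by omega)
    have hne := hP (k - 1) (by omega)
    rw [nS_last hk] at hle hne
    have hev : i % 2 = 0 := by omega
    refine ⟨fun h1 => by omega, fun _ => ?_⟩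
    have hmk := hA k hk le_rfl
    have h16 : (16:ℝ) ≤ (16:ℝ) ^ mIt k i k := by
      calc (16:ℝ) = 16 ^ 1 := by norm_num
        _ ≤ 16 ^ mIt k i k := pow_le_pow_right₀ (by norm_num) hmk
    have h1 := hb.1
    rw [div_le_iff₀ (by linarith)] at h1
    nlinarith

/-- **The W-tower grid signs hold at every level `k ≥ 1`.** -/
theorem wTowerSigns_all (k : ℕ) (hk : 1 ≤ k) : WTowerSigns k := by
  intro i hi
  obtain ⟨h1, h2⟩ := vIt_final (k := k) (i := i) hk (by omega)
  obtain ⟨e1, e2⟩ := sign_iff k i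
  exact ⟨fun h => e1.2 (h2 h), fun h => e2.2 (h1 h)⟩


/-- **`HexRealZeroTauBound c` is FALSE for every `c` (v10, sorry-free): the hexadecadal sector does NOT
escape the `TauRealZeros` barrier — the W-tower `W_k` (τ ≤ k²+12k+5, `2^k` hexadecadal real roots) is a
barrier family INSIDE the sector.** -/
theorem not_hexRealZeroTauBound (c : ℕ) : ¬ HexRealZeroTauBound c :=
  not_hexRealZeroTauBound_of_wTowerSigns (fun k hk => wTowerSigns_all k hk) c

end WTower

end Summit.ValiantsHypothesis.ValiantsHypothesis.Theses.LacunarySymmetroid.HexadecadeLine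

end
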